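import Summits.HodgeConjecture.HodgeConjecture.Cruxes.H413.Lines.F0_T1InnerFormTraceIdentity
import Literature.NumberTheory.Rogawski1990.PreStabilisationRegularStabilised
import Literature.NumberTheory.Rogawski1990.StabilisationPackageWeights
import Literature.NumberTheory.Rogawski1990.StableClassTransferMap
import Literature.NumberTheory.Rogawski1990.CartanRealisation
import Literature.NumberTheory.Rogawski1990.EndoscopicSideVanishingOffArchImage
import Literature.NumberTheory.Rogawski1990.OccurrenceOfArchMatch
import Literature.NumberTheory.Rogawski1990.SingularClassOccursInAnisotropic
import Literature.NumberTheory.Rogawski1990.StabilizationSchemaSummed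
import Literature.NumberTheory.Rogawski1990.SingularEllipticTransferCanonicalPinned    -- ed. 1.26 «#175 PINNED» (registrar A-plan1 (g34) T2 ★): `SingularEllipticTransferCanonicalAtDelta` + `.exists_singularTransferMembers`
import HarnessLib

/-!
# ENGINE T1 — `F0_T1InnerFormTraceIdentity` — API (consumer projections of a pinned `ComparisonKit`)

Second workfile of the H413 crux line `F0_T1InnerFormTraceIdentity` (director s497, option (v) «API split», 2026-08-31; tree path
`Cruxes/H413/Lines/F0_T1InnerFormTraceIdentityAPI.lean` = module `Summits.HodgeConjecture.HodgeConjecture.Cruxes.H413.Lines.F0_T1InnerFormTraceIdentityAPI`, the flat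
name of s497 (4) — the nested subpath was refused by the workfile path rule): the CONSUMER-ONLY
declarations of the line — the by-name projections `IsPinned.*` of the pin conjunction, `finite_transfersTo_of_pin`,
`smooth_nonempty_of_isPinned` and the derived multiplicity formula `traceGp_hasSum_mult_mul_tsum_inner_of_isPinned` — moved here VERBATIM (ed. 1.20 adds
the per-pin lemma `IsPinned.kappaValues` of the new pin (κ-v) and the two consumer identities `IsPinned.kappaG_mul_card_add_one`, `IsPinned.half_kappaH_eq`;
ed. 1.24a₁ (API-only) folds F0P3a-p01 (g6)'s V-KIT v3.2: the law texts `LawT1bVanish`∕`LawT1bReg`∕`LawT1bNonreg`, `ellipticStabilisation_of_parts`, the kit-level vanishing `IsPinned.sjH_eq_zero_of_forall_not_transfersTo`, and the residual-free closers `IsPinned.lawT1bVanish` ∕ `IsPinned.ellipticStabilisation_of_lawT1bNonreg` (law T1b for every pinned kit modulo `LawT1bNonreg` alone); ed. 1.24b adds the per-pin lemmas of the 13 conjuncts appended in MAIN ed. 1.24b — `IsPinned.centralHVanish` ∕ `IsPinned.centralValueTransfer` ∕ `IsPinned.psiConj` ∕ `IsPinned.muAMassCentral` ∕ `IsPinned.muAShapeSingular`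 ∕ `IsPinned.singularArchInnerTransfer` ∕ `IsPinned.singularEndoscopicMass` ∕ `IsPinned.sjGCentral` ∕ `IsPinned.sjGSingular` ∕ `IsPinned.transfer_iff_local` ∕ `IsPinned.transferH_iff_local` ∕ `IsPinned.localUnitTransfer_off` ∕ `IsPinned.singularFamilies` (`IsPinned.sjHOffSemisimple`'s path gains a `.1`, no other path moves) — and the (M-c) § «converse transfer pins» corollaries; ed. 1.24a₀ adds `IsPinned.sjHCentralImage` ∕ `.singularHRegularVanish` ∕ `.sjHOffSemisimple`, the per-pin lemmas of the three sign-free O7 pins appended LAST (`IsPinned.stableBeta`'s path gains a `.1`); ed. 1.21 adds `IsPinned.stabilisationPackage`, the per-pin lemma of pin (xv); ed. 1.22 restates `IsPinned.transfer_arch` ∕ `.deltaTransfer` with the pins'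
TEST-NESS block and adds `IsPinned.transfer_tensors` ∕ `.deltaTransfer_tensors`, the pins unpacked in ★ O11-1d's currency; ed. 1.23 adds
`IsPinned.stableBeta`, the per-pin lemma of the (then) LAST conjunct (viii⁵) `PinStableBeta` — `IsPinned.stabilisationPackage`'s projection path gains a
final `.1`, no other path moves — and § «T1b AT THE REGULAR CLASSES» (F0P3a-p01 (g5) (D2) v5 7d38adf4 + F0P3a-p08 (g5) H-side half ffd7e530, folded
verbatim): for EVERY pinned kit, law T1b's class clause `J(𝒪, f′) = SJ_G(𝒪, f) + ½ · Σ SJ_H` at every REGULAR stable class, by ★ (D1)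
`…_stabilised₂` (Prop. 5.4.1 class by class) — `IsPinned.j_eq_sjG_add_half_sjHover_of_isRegularElt`, no residual hypothesis)
(same namespace, same fully qualified names, same statements and proofs) from the main workfile
`Cruxes/H413/Lines/F0_T1InnerFormTraceIdentity.lean`, which keeps the statement layer (`ComparisonKit`, pin texts, `IsPinned`), the seven
laws `LawsT1`, all registered stubs `stub_*`, the anchor witness and the head `engineT1_of_stubs`.  RULES (s497): this file holds ZERO `stub_`,
ZERO `sorry`; it imports the main line module (+ ★ files) and nothing imports it except scratch ∕ closer drafts; no `Theorems/` file imports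
either workfile (s476 (ii)) — closers land by name against ★ `Literature` ∕ `Theorems` files.  Nothing in the main workfile uses a declaration
of this file (ref1 R1-146 masked scan; LEAD re-check on ed. 1.19c₂′).

ed. 1.26 (2026-09-03, «#175 PINNED»; director g36 s1830 ORDER; heir LEAD F0P3a-plan (g19) T18-10∕T18-13 (3); desk F0P3-plan (g22) D-O7∕D-O7b; K2E4-r01 O7 VERDICT 9d20d85d782e07ce;
registrar A-plan1 (g34) pen; base ed. 1.25 6a182988547c232a): + ONE import (★ `…SingularEllipticTransferCanonicalPinned`) and TWO theorems appended at the end of § PackageAndExport —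
`anchorWitness_exists_of_packageAnd_pinned` (MAIN-b VERBATIM with `hSET` AT ONE finite collection `Δ₀` + the pin `hQΔ : Q Δ mH mG → Δ = Δ₀`; MAIN itself untouched) and
`anchoredKit_nonempty_of_stubsQ_loc_pinned` (the ed. 1.25 export over it); every ed. ≤ 1.25 byte unchanged.  ZERO `sorry`, ZERO `stub_`.

HONEST LABEL: HC_CM is proved only modulo the printed citations until rung 0 closes; this file adds no mathematics — every theorem is a
projection or a two-line consequence of the pin conjunction `ComparisonKit.IsPinned` — except § «T1b at the regular classes» (ed. 1.23), which is the
T1b closer's kit-level assembly of ★ tree theorems ((D1) ED. 2, G2 weights, KS, Landherr, F1, (K-R)) under the pins; still ZERO `sorry`, ZERO `stub_`.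
-/

set_option linter.dupNamespace false

noncomputable section

namespace Summit.HodgeConjecture.HodgeConjecture.Cruxes.H413.F0T1InnerFormTraceIdentity

open MeasureTheory Measure NumberField IsDedekindDomain
open Literature.NumberTheory.Automorphic
open Literature.AlgebraicGeometry.ShimuraVarieties (hermForm)
open scoped ENNReal NNReal

variable {L : Type} [Field L] [NumberField L] [IsCMField L] {H : Matrix (Fin 3) (Fin 3) L}
  {μ : Measure (UnitaryGroup.cmDatum L 3 H).automorphicQuotient} [(UnitaryGroup.cmDatum L 3 H).IsAutomorphicMeasure μ]

namespace ComparisonKit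

variable (𝔨 : ComparisonKit L H μ)

/-- **Finiteness of the transferring classes** from the (xiii-c) text: `{𝒪H | transfersTo 𝒪H 𝒪}` is finite for every `𝒪` (★
`StableClassH.finite_subtype_transfersTo_antidiagOne` pulled back along the injective `eStH`). [cite: Rogawski1990, §4.6 p. 49; Thm. 14.5.1 (a) p. 238] -/
theorem finite_transfersTo_of_pin
    (eStH : 𝔨.StClassH ≃ Literature.NumberTheory.Rogawski1990.StableClassH (cmConjRingHom L) (splitForm L 2) (splitForm L 1))
    (h : 𝔨.PinTransfersTo eStH) (𝒪 : 𝔨.StClass) : {𝒪H : 𝔨.StClassH | 𝔨.transfersTo 𝒪H 𝒪}.Finite := by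
  have hf := Literature.NumberTheory.Rogawski1990.StableClassH.finite_subtype_transfersTo_antidiagOne (L := L) H (𝔨.eSt 𝒪)
  have hf' : {c' : Literature.NumberTheory.Rogawski1990.StableClassH (cmConjRingHom L) (splitForm L 2) (splitForm L 1) |
      c'.TransfersTo H Literature.NumberTheory.Rogawski1990.endoForm_antidiagOne (𝔨.eSt 𝒪)}.Finite :=
    Set.finite_coe_iff.mp hf
  refine (hf'.preimage eStH.injective.injOn).subset fun 𝒪H h𝒪H => ?_
  exact (h 𝒪H 𝒪).1 h𝒪H

section T1bRegularReindex

open Literature.NumberTheory.Rogawski1990 Filter Function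
open scoped Matrix MatrixGroups BigOperators

/-! ### § T1b at the regular classes — (1) re-indexing `SJHover` along `eStH` (F0P3a-p08 (g5) `T1bHSideHalf` §1, rf ffd7e530, folded verbatim ed. 1.23) -/

/-! ## §1 Re-indexing `SJHover` along `eStH` (pin (xiii-c) only; no measures) -/

/-- **`SJHover` re-indexed over the TREE's transferring classes**: under the (xiii-c) text for an identification `eStH` and `𝔨.eSt 𝒪 = c`,
`Σ_{c′ : 𝔨.transfersTo c′ 𝒪} SJ_H(c′, f^H) = Σᶠ_{𝒪H : 𝒪H.TransfersTo H ξ c} SJ_H(eStH⁻¹ 𝒪H, f^H)` (Mathlib `finsum_comp_equiv` along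
`eStH.subtypeEquiv`). [cite: Rogawski1990, Thm. 14.5.1 (a) p. 238; §4.6 p. 49] -/
theorem sjHover_eq_finsum_of_pinTransfersTo
    (eStH : 𝔨.StClassH ≃ Literature.NumberTheory.Rogawski1990.StableClassH (cmConjRingHom L) (splitForm L 2) (splitForm L 1))
    (hT : 𝔨.PinTransfersTo eStH) (𝒪 : 𝔨.StClass)
    {c : Literature.NumberTheory.Rogawski1990.StableClass (cmConjRingHom L) H} (hc : 𝔨.eSt 𝒪 = c) (fH : TestH L) :
    𝔨.SJHover 𝒪 fH =
      ∑ᶠ i : {𝒪H : Literature.NumberTheory.Rogawski1990.StableClassH (cmConjRingHom L) (splitForm L 2) (splitForm L 1) //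
          𝒪H.TransfersTo H Literature.NumberTheory.Rogawski1990.endoForm_antidiagOne c},
        𝔨.SJH (eStH.symm i.1) fH := by
  subst hc
  let e : {c' : 𝔨.StClassH // 𝔨.transfersTo c' 𝒪} ≃
      {𝒪H : Literature.NumberTheory.Rogawski1990.StableClassH (cmConjRingHom L) (splitForm L 2) (splitForm L 1) //
          𝒪H.TransfersTo H Literature.NumberTheory.Rogawski1990.endoForm_antidiagOne (𝔨.eSt 𝒪)} :=
    eStH.subtypeEquiv fun c' => hT c' 𝒪
  have key := finsum_comp_equiv e
    (f := fun i : {𝒪H : Literature.NumberTheory.Rogawski1990.StableClassH (cmConjRingHom L) (splitForm L 2) (splitForm L 1) //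
          𝒪H.TransfersTo H Literature.NumberTheory.Rogawski1990.endoForm_antidiagOne (𝔨.eSt 𝒪)} => 𝔨.SJH (eStH.symm i.1) fH)
  rw [← key]
  unfold SJHover
  refine finsum_congr fun c' => ?_
  simp only [e, Equiv.subtypeEquiv_apply, Equiv.symm_apply_apply]

/-- **The transferring classes re-indexed: membership transport** — under (xiii-c) and `𝔨.eSt 𝒪 = c`, `eStH⁻¹ 𝒪H ↦ 𝒪` for every tree class
`𝒪H ↦ c`. [cite: Rogawski1990, Thm. 14.5.1 (a) p. 238] -/
theorem transfersTo_symm_of_pinTransfersTo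
    (eStH : 𝔨.StClassH ≃ Literature.NumberTheory.Rogawski1990.StableClassH (cmConjRingHom L) (splitForm L 2) (splitForm L 1))
    (hT : 𝔨.PinTransfersTo eStH) (𝒪 : 𝔨.StClass)
    {c : Literature.NumberTheory.Rogawski1990.StableClass (cmConjRingHom L) H} (hc : 𝔨.eSt 𝒪 = c)
    {𝒪H : Literature.NumberTheory.Rogawski1990.StableClassH (cmConjRingHom L) (splitForm L 2) (splitForm L 1)}
    (h𝒪H : 𝒪H.TransfersTo H Literature.NumberTheory.Rogawski1990.endoForm_antidiagOne c) :
    𝔨.transfersTo (eStH.symm 𝒪H) 𝒪 := by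
  subst hc
  rw [hT, Equiv.apply_symm_apply]
  exact h𝒪H

end T1bRegularReindex

/-! ## (ed. 1.24a₁) The T1b law texts of SPEC-O7 v2.3a §B and the sign-free T1b assembly (F0P3a-p01 (g6) V-KIT v3.2 ∕ A-p01 (g16), VERBATIM) -/

open Literature.NumberTheory.Rogawski1990 in
open scoped Matrix MatrixGroups in
/-- **T1b-vanish** (SPEC-O7 v2.2 text, VERBATIM): on transfers, `SJ_H(𝒪H, f^H) = 0` at every stable class `𝒪H` of `H` that transfers to NO stable class of
`G′`. [cite: Rogawski1990, §14.5 pp. 238–241] -/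
def LawT1bVanish : Prop :=
  ∀ (f' : TestGp L H) (f : TestG L) (fH : TestH L), 𝔨.Matches f' f fH →
    ∀ c' : 𝔨.StClassH, (∀ c : 𝔨.StClass, ¬ 𝔨.transfersTo c' c) → 𝔨.SJH c' fH = 0

open Literature.NumberTheory.Rogawski1990 in
open scoped Matrix MatrixGroups in
/-- **T1b-reg**: the class-by-class identity of `EllipticStabilisation` at the REGULAR stable classes (★ `StableClass.IsRegular` through `eSt`) — what
p01 (g5)'s closer over ED 1.23 delivers. [Rogawski1990, Thm. 14.5.1 (a) p. 238] -/
def LawT1bReg : Prop :=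
  ∀ (f' : TestGp L H) (f : TestG L) (fH : TestH L), 𝔨.Matches f' f fH →
    ∀ c : 𝔨.StClass, (𝔨.eSt c).IsRegular → 𝔨.J c f' = 𝔨.SJG c f + (1 / 2 : ℂ) * 𝔨.SJHover c fH

open Literature.NumberTheory.Rogawski1990 in
open scoped Matrix MatrixGroups in
/-- **T1b-nonreg** (= T1b-sing ∧ T1b-cent): the class-by-class identity at the NON-regular stable classes — the O7 closer row over the pins of §A and the
`SingularClassPackage`. [Rogawski1990, §14.5 p. 239; Lemma 14.5.2; Prop. 10.1.2] -/
def LawT1bNonreg : Prop :=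
  ∀ (f' : TestGp L H) (f : TestG L) (fH : TestH L), 𝔨.Matches f' f fH →
    ∀ c : 𝔨.StClass, ¬ (𝔨.eSt c).IsRegular → 𝔨.J c f' = 𝔨.SJG c f + (1 / 2 : ℂ) * 𝔨.SJHover c fH

open Literature.NumberTheory.Rogawski1990 in
open scoped Matrix MatrixGroups in
/-- Regrouping along a PARTIAL transfer map: if every `c′` transfers to AT MOST ONE `c` and `g` vanishes at the `c′` transferring to none, then
`Σᶠ_c Σᶠ_{c′ ↦ c} g c′ = Σᶠ_{c′} g c′` (`g` finitely supported). [Rogawski1990, §14.5 pp. 240–241] -/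
theorem finsum_finsum_subtype_eq_finsum_of_subsingleton_of_vanish {CG CH : Type} [Nonempty CG] (T : CH → CG → Prop)
    (huniq : ∀ c' c₁ c₂, T c' c₁ → T c' c₂ → c₁ = c₂) (g : CH → ℂ) (hg : (Function.support g).Finite)
    (hvan : ∀ c', (∀ c, ¬ T c' c) → g c' = 0) :
    ∑ᶠ c, ∑ᶠ c' : {c' : CH // T c' c}, g c'.1 = ∑ᶠ c', g c' := by
  classical
  -- the partial map made total: `t c′ :=` the target of `c′` if any, else a junk class — on the support of `g` it IS the target
  let t : CH → CG := fun c' => if h : ∃ c, T c' c then h.choose else Classical.arbitrary CG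
  have ht : ∀ c' c, T c' c → t c' = c := fun c' c h => by
    have hex : ∃ c, T c' c := ⟨c, h⟩
    simp only [t, dif_pos hex]
    exact huniq c' _ _ hex.choose_spec h
  -- replace `T` by the graph of `t` inside the support of `g`
  let g' : CH → ℂ := fun c' => if ∃ c, T c' c then g c' else 0
  have hg' : ∀ c', g' c' = g c' := fun c' => by
    by_cases h : ∃ c, T c' c
    · simp only [g', if_pos h]
    · simp only [g', if_neg h]
      exact (hvan c' (not_exists.1 h)).symm
  have hfin' : (Function.support g').Finite := by
    refine hg.subset fun c' hc' => ?_
    rw [Function.mem_support, hg'] at hc'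
    exact hc'
  have hinner : ∀ c, ∑ᶠ c' : {c' : CH // T c' c}, g c'.1 = ∑ᶠ c' : {c' : CH // t c' = c}, g' c'.1 := by
    intro c
    rw [finsum_subtype_eq_finsum_cond (p := fun c' => T c' c) (f := g), finsum_subtype_eq_finsum_cond (p := fun c' => t c' = c) (f := g')]
    refine finsum_congr fun c' => ?_
    rw [finsum_eq_if, finsum_eq_if]
    by_cases h : T c' c
    · rw [if_pos h, if_pos (ht c' c h), hg']
    · rw [if_neg h]
      by_cases h' : t c' = c
      · rw [if_pos h']
        have hex : ¬ ∃ c₂, T c' c₂ := by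
          rintro ⟨c₂, hc₂⟩
          have hcc : c₂ = c := (ht c' c₂ hc₂).symm.trans h'
          exact h (hcc ▸ hc₂)
        simp only [g', if_neg hex]
      · rw [if_neg h']
  simp_rw [hinner]
  rw [Literature.NumberTheory.Rogawski1990.finsum_finsum_subtype_eq_finsum_of_iff (fun c' c => t c' = c) t (fun _ _ => Iff.rfl) g' hfin']
  exact finsum_congr hg'

open Literature.NumberTheory.Rogawski1990 in
open scoped Matrix MatrixGroups in
/-- **THE T1b API CLOSER (RULING #113 (iv))**: the all-classes law `EllipticStabilisation` from its REGULAR part, its NON-REGULAR part (singular + central),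
the VANISHING at the non-transferring `H`-classes, the finite supports of `J(·, f′)` (T1a ∕ pin (viii⁗)), `SJ_G(·, f)` (pin (xii-f)), `SJ_H(·, f^H)` (pin
(xiii-f)), and «an `H`-class transfers to at most one `G′`-class» (★ `StableClass.eq_of_corresponds_right` through pin (xiii-c)).  The summed conjunct is
★ `StabilizationSchemaSummed` along the partial transfer map. [Rogawski1990, Thm. 14.5.1 (a) p. 238; §14.5 pp. 240–241] -/
theorem ellipticStabilisation_of_parts [Nonempty 𝔨.StClass]
    (hfinJ : ∀ f' : TestGp L H, (Function.support fun c : 𝔨.StClass => 𝔨.J c f').Finite)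
    (hfinG : 𝔨.PinSJGFinite) (hfinH : 𝔨.PinSJHFinite)
    (huniq : ∀ (c' : 𝔨.StClassH) (c₁ c₂ : 𝔨.StClass), 𝔨.transfersTo c' c₁ → 𝔨.transfersTo c' c₂ → c₁ = c₂)
    (hreg : 𝔨.LawT1bReg) (hnon : 𝔨.LawT1bNonreg) (hvan : 𝔨.LawT1bVanish) : 𝔨.EllipticStabilisation := by
  intro f' f fH hm
  have hcls : ∀ c : 𝔨.StClass, 𝔨.J c f' = 𝔨.SJG c f + (1 / 2 : ℂ) * 𝔨.SJHover c fH := fun c => by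
    by_cases hc : (𝔨.eSt c).IsRegular
    · exact hreg f' f fH hm c hc
    · exact hnon f' f fH hm c hc
  refine ⟨hcls, ?_⟩
  -- summed: `Σ J = Σ SJG + ½ Σ_c SJHover c = Σ SJG + ½ Σ_{c′} SJH c′`
  have hE : (Function.support fun c : 𝔨.StClass => (1 / 2 : ℂ) * 𝔨.SJHover c fH).Finite := by
    refine ((hfinJ f').union (hfinG f)).subset fun c hc => ?_
    rw [Function.mem_support] at hc
    by_contra hc'
    rw [Set.mem_union, Function.mem_support, Function.mem_support, not_or, not_not, not_not] at hc'
    apply hc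
    have h1 := hcls c
    rw [hc'.1, hc'.2, zero_add] at h1
    exact h1.symm
  have hS : (Function.support fun c : 𝔨.StClass => 𝔨.SJHover c fH).Finite := by
    refine hE.subset fun c hc => ?_
    simp only [Function.mem_support] at hc ⊢
    exact mul_ne_zero (by norm_num) hc
  unfold JGp SJGtot SJHtot
  rw [finsum_congr hcls, finsum_add_distrib (hfinG f) hE, ← mul_finsum' _ _ hS]
  congr 2
  unfold SJHover
  exact finsum_finsum_subtype_eq_finsum_of_subsingleton_of_vanish (fun c' c => 𝔨.transfersTo c' c) huniq (fun c' => 𝔨.SJH c' fH) (hfinH fH)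
    (fun c' hc' => hvan f' f fH hm c' hc')

open Literature.NumberTheory.Rogawski1990 in
open scoped Matrix MatrixGroups in
/-- **`LawT1bReg` from the ∀-representative class clause** (pure logic: a regular stable class has a regular representative, ★ `stableClassOf_surjective` +
★ `StableClass.isRegular_stableClassOf`) — instantiate `hcl` with ED 1.23's API wrapper `IsPinned.j_eq_sjG_add_half_sjHover_of_isRegularElt 𝔨 h hanis hherm
hνG hK hνH hKH` to get `LawT1bReg` for every pinned kit with NO residual hypothesis. [cite: Rogawski1990, Thm. 14.5.1 (a) p. 238] -/
theorem lawT1bReg_of_clause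
    (hcl : ∀ {𝒪 : 𝔨.StClass} {γ₀ : (UnitaryGroup.cmDatum L 3 H).Rational}, 𝔨.eSt 𝒪 = stableClassOf (cmConjRingHom L) H γ₀ →
      IsRegularElt (γ₀.val : GL (Fin 3) L) → ∀ {f' : TestGp L H} {f : TestG L} {fH : TestH L}, 𝔨.Matches f' f fH →
      𝔨.J 𝒪 f' = 𝔨.SJG 𝒪 f + (1 / 2 : ℂ) * 𝔨.SJHover 𝒪 fH) :
    𝔨.LawT1bReg := by
  intro f' f fH hm c hc
  obtain ⟨γ₀, hγ₀⟩ := stableClassOf_surjective (𝔨.eSt c)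
  exact hcl hγ₀.symm ((StableClass.isRegular_stableClassOf γ₀).mp (hγ₀ ▸ hc)) hm

section PinnedCanonical

variable [∀ v : HeightOneSpectrum (𝓞 ↥(maximalRealSubfield L)), MeasurableSpace (HLocal L v)] [∀ v : HeightOneSpectrum (𝓞 ↥(maximalRealSubfield L)), BorelSpace (HLocal L v)]
  [∀ v : HeightOneSpectrum (𝓞 ↥(maximalRealSubfield L)), MeasurableSpace (GpLocal L H v)] [∀ v : HeightOneSpectrum (𝓞 ↥(maximalRealSubfield L)), BorelSpace (GpLocal L H v)]
  [MeasurableSpace (GpInf L H)] [BorelSpace (GpInf L H)] [MeasurableSpace (GInf L)] [BorelSpace (GInf L)]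
  [MeasurableSpace (HInf L)] [BorelSpace (HInf L)]

variable
    {νH : ∀ v : HeightOneSpectrum (𝓞 ↥(maximalRealSubfield L)), Measure (HLocal L v)} {νG : ∀ v : HeightOneSpectrum (𝓞 ↥(maximalRealSubfield L)), Measure (GpLocal L H v)}
    [∀ v, IsFiniteMeasureOnCompacts (νH v)] [∀ v, (νH v).IsMulRightInvariant]
    [∀ v, IsFiniteMeasureOnCompacts (νG v)] [∀ v, (νG v).IsMulRightInvariant]
    {νGi : Measure (GpInf L H)} {νqi : Measure (GInf L)} {νHi : Measure (HInf L)}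
    [IsFiniteMeasureOnCompacts νGi] [νGi.IsMulRightInvariant] [IsFiniteMeasureOnCompacts νqi] [νqi.IsMulRightInvariant]
    [IsFiniteMeasureOnCompacts νHi] [νHi.IsMulRightInvariant]

/-- **Pin (iv) BY NAME**: `Smooth f′ ↔ f′` is a pure smooth tensor. (ed. 1.17 named projection) [cite: Rogawski1990, §14.5 p. 237] -/
theorem IsPinned.smooth_iff [MeasurableSpace (GpAdelic L H)] [BorelSpace (GpAdelic L H)]
    {ν : Measure (GpAdelic L H)} [ν.IsHaarMeasure] [ν.IsInvInvariant] {Tinf : Literature.NumberTheory.Rogawski1990.ArchTransferFactor L H} (h : 𝔨.IsPinned ν Tinf νH νG νGi νqi νHi) (f' : TestGp L H) :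
    𝔨.Smooth f' ↔ ∃ T : UnitaryGroup.PureTensor L 3 H, T.IsTest ∧ ⇑f' = T.eval :=
  h.2.2.2.1 f'

/-- **Pin (v) BY NAME**: `θ_{G′}` IS ★ `UnitaryGroup.diagTrace`. (ed. 1.17 named projection) [cite: Gelbart1975, (9.11)] -/
theorem IsPinned.traceGp_eq [MeasurableSpace (GpAdelic L H)] [BorelSpace (GpAdelic L H)]
    {ν : Measure (GpAdelic L H)} [ν.IsHaarMeasure] [ν.IsInvInvariant] {Tinf : Literature.NumberTheory.Rogawski1990.ArchTransferFactor L H} (h : 𝔨.IsPinned ν Tinf νH νG νGi νqi νHi) (hanis : IsAnisotropic L H) :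
    𝔨.traceGp = UnitaryGroup.diagTrace L 3 H μ ν hanis :=
  h.2.2.2.2.1 hanis

/-- **Pin (viii′-2) BY NAME** (ed. 1.18): the kit's ONE adelic orbital measure family `μA` is ADMISSIBLE AT EVERY rational class `[γ]` of `G′(L⁺)` —
`U(H)(𝔸)`-invariant, finite on compact sets and non-zero on `U(H)(𝔸) ⧸ U(H)(𝔸)_γ` (Borel σ-algebra). [cite: Rogawski1990, §14.5 p. 237] -/
theorem IsPinned.μA_admissible [MeasurableSpace (GpAdelic L H)] [BorelSpace (GpAdelic L H)]
    {ν : Measure (GpAdelic L H)} [ν.IsHaarMeasure] [ν.IsInvInvariant] {Tinf : Literature.NumberTheory.Rogawski1990.ArchTransferFactor L H} (h : 𝔨.IsPinned ν Tinf νH νG νGi νqi νHi)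
    (c : ConjClasses (UnitaryGroup.cmDatum L 3 H).Rational) :
    letI : ∀ g : GpAdelic L H, MeasurableSpace (GpAdelic L H ⧸ Subgroup.centralizer ({g} : Set (GpAdelic L H))) := fun _ => borel _
    SMulInvariantMeasure (GpAdelic L H) _ (𝔨.μA c) ∧ IsFiniteMeasureOnCompacts (𝔨.μA c) ∧ 𝔨.μA c ≠ 0 :=
  h.2.2.2.2.2.2.2.1.1 c

/-- **Pin (viii″) BY NAME** (ed. 1.18; ed. 1.19a over the FIELD `eSt`): the orbital terms are WEIGHT-FREE — along the kit's bijection `eSt : StClass ≃ StableClass`,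
`J(𝒪_st, f′) = Σ_{[γ] ⊂ 𝒪_st} Φ_{μA}([γ], f′)` with ★ `UnitaryGroup.adelicClassOrbitalIntegral` against the kit's ONE family `μA`. [cite: Rogawski1990, §14.5 pp. 237–238] -/
theorem IsPinned.J_eq [MeasurableSpace (GpAdelic L H)] [BorelSpace (GpAdelic L H)]
    {ν : Measure (GpAdelic L H)} [ν.IsHaarMeasure] [ν.IsInvInvariant] {Tinf : Literature.NumberTheory.Rogawski1990.ArchTransferFactor L H} (h : 𝔨.IsPinned ν Tinf νH νG νGi νqi νHi) :
    letI : ∀ g : GpAdelic L H, MeasurableSpace (GpAdelic L H ⧸ Subgroup.centralizer ({g} : Set (GpAdelic L H))) := fun _ => borel _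
    ∀ (c : 𝔨.StClass) (f' : TestGp L H), 𝔨.J c f' = (𝔨.eSt c).orbitalSum (UnitaryGroup.adelicClassOrbitalIntegral L 3 H 𝔨.μA f') :=
  h.2.2.2.2.2.2.2.1.2.1.1

/-- **Pin (viii⁗) BY NAME** (ed. 1.19a): for every `f′ ∈ C_c(G′(𝔸))` only FINITELY MANY rational classes carry a non-zero orbital integral `Φ_{μA}([γ], f′)`
(anisotropic `G′`: every class is elliptic, `G′(L⁺)` discrete and cocompact — ★ (O-H) `exists_weight_diagTrace_eq_finsum_orbitalSum_of_anisotropic`), so the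
`finsum`s of (viii″) and of the later β-∕SJ-sockets are honest finite sums. [cite: Rogawski1990, §14.5 p. 237] -/
theorem IsPinned.J_support_finite [MeasurableSpace (GpAdelic L H)] [BorelSpace (GpAdelic L H)]
    {ν : Measure (GpAdelic L H)} [ν.IsHaarMeasure] [ν.IsInvInvariant] {Tinf : Literature.NumberTheory.Rogawski1990.ArchTransferFactor L H} (h : 𝔨.IsPinned ν Tinf νH νG νGi νqi νHi)
    (f' : TestGp L H) :
    letI : ∀ g : GpAdelic L H, MeasurableSpace (GpAdelic L H ⧸ Subgroup.centralizer ({g} : Set (GpAdelic L H))) := fun _ => borel _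
    (Function.support (UnitaryGroup.adelicClassOrbitalIntegral L 3 H 𝔨.μA f')).Finite :=
  h.2.2.2.2.2.2.2.1.2.1.2 f'

/-- **Pin (viii′-0) BY NAME** (ed. 1.18): the stable-class weights `α(𝒪_st)` are positive. [cite: Rogawski1990, §5.4 (5.4.3) p. 72] -/
theorem IsPinned.α_pos [MeasurableSpace (GpAdelic L H)] [BorelSpace (GpAdelic L H)]
    {ν : Measure (GpAdelic L H)} [ν.IsHaarMeasure] [ν.IsInvInvariant] {Tinf : Literature.NumberTheory.Rogawski1990.ArchTransferFactor L H} (h : 𝔨.IsPinned ν Tinf νH νG νGi νqi νHi) (c : 𝔨.StClass) : 0 < 𝔨.α c :=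
  h.2.2.2.2.2.2.2.1.2.2 c

/-- **Pin (ix) BY NAME**: `Transfer f′ f` forces pure tensors with `f_v = f′_v ∘ ψ_v⁻¹` at EVERY finite `v` ((14.2.1) at the finite places for
`D = M₃(E)`). (ed. 1.17 named projection) [cite: Rogawski1990, §14.2 p. 233] -/
theorem IsPinned.transfer_loc [MeasurableSpace (GpAdelic L H)] [BorelSpace (GpAdelic L H)]
    {ν : Measure (GpAdelic L H)} [ν.IsHaarMeasure] [ν.IsInvInvariant] {Tinf : Literature.NumberTheory.Rogawski1990.ArchTransferFactor L H} (h : 𝔨.IsPinned ν Tinf νH νG νGi νqi νHi) {f' : TestGp L H} {f : TestG L}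
    (hf : 𝔨.Transfer f' f) :
    ∃ (T : UnitaryGroup.PureTensor L 3 H) (T' : UnitaryGroup.PureTensor L 3 (splitForm L 3)),
      ⇑f' = T.eval ∧ ⇑f = T'.eval ∧ ∀ v, T'.loc v = T.loc v ∘ (𝔨.ψ v).symm := by
  obtain ⟨-, -, hall⟩ := h.2.2.2.2.2.2.2.2.1
  obtain ⟨T, T', -, h₁, h₂, h₃, -⟩ := hall f' f hf
  exact ⟨T, T', h₁, h₂, h₃⟩

/-- **Pin (ix′) BY NAME**: the kit's archimedean orbital measure families `𝔨.mGi`, `𝔨.mqi` on `G′_∞`, `G_∞` (FIELDS since ed. 1.18; admissible on the regular classes) under which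
`Transfer f′ f` forces, for the SAME pure tensors, `f_v = f′_v ∘ ψ_v⁻¹` at every finite `v` AND the archimedean inner transfer (14.2.1)
`IsArchInnerTransfer L H m′_∞ m_∞ T.arch T′.arch`; (ed. 1.22) the tensors are TEST tensors, `T.IsTest ∧ T′.IsTest`. (ed. 1.17 named projection)
[cite: Rogawski1990, §14.2 (14.2.1) pp. 232–233] [cite: Shelstad1979] -/
theorem IsPinned.transfer_arch [MeasurableSpace (GpAdelic L H)] [BorelSpace (GpAdelic L H)]
    {ν : Measure (GpAdelic L H)} [ν.IsHaarMeasure] [ν.IsInvInvariant] {Tinf : Literature.NumberTheory.Rogawski1990.ArchTransferFactor L H} (h : 𝔨.IsPinned ν Tinf νH νG νGi νqi νHi) :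
    letI : ∀ γ : UnitaryGroup.arch (↥(maximalRealSubfield L)) L (IsCMField.complexConj L) 3 H,
        MeasurableSpace (UnitaryGroup.arch (↥(maximalRealSubfield L)) L (IsCMField.complexConj L) 3 H ⧸ Subgroup.centralizer ({γ} : Set (UnitaryGroup.arch (↥(maximalRealSubfield L)) L (IsCMField.complexConj L) 3 H))) := fun _ => borel _
    letI : ∀ γ : UnitaryGroup.arch (↥(maximalRealSubfield L)) L (IsCMField.complexConj L) 3
          (Matrix.of fun i j : Fin 3 => if i.val + j.val + 1 = 3 then (1 : L) else 0),
        MeasurableSpace (UnitaryGroup.arch (↥(maximalRealSubfield L)) L (IsCMField.complexConj L) 3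
          (Matrix.of fun i j : Fin 3 => if i.val + j.val + 1 = 3 then (1 : L) else 0) ⧸
          Subgroup.centralizer ({γ} : Set (UnitaryGroup.arch (↥(maximalRealSubfield L)) L (IsCMField.complexConj L) 3
          (Matrix.of fun i j : Fin 3 => if i.val + j.val + 1 = 3 then (1 : L) else 0)))) := fun _ => borel _
    𝔨.mGi.IsAdmissibleOn (fun γ => Literature.NumberTheory.Rogawski1990.IsRegularElt (γ.val : GL (Fin 3) (NumberField.mixedEmbedding.mixedSpace L))) ∧
      𝔨.mqi.IsAdmissibleOn (fun γ => Literature.NumberTheory.Rogawski1990.IsRegularElt (γ.val : GL (Fin 3) (NumberField.mixedEmbedding.mixedSpace L))) ∧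
      ∀ (f' : TestGp L H) (f : TestG L), 𝔨.Transfer f' f →
        ∃ (T : UnitaryGroup.PureTensor L 3 H) (T' : UnitaryGroup.PureTensor L 3 (splitForm L 3)),
          (T.IsTest ∧ T'.IsTest) ∧ ⇑f' = T.eval ∧ ⇑f = T'.eval ∧ (∀ v, T'.loc v = T.loc v ∘ (𝔨.ψ v).symm) ∧
          Literature.NumberTheory.Rogawski1990.IsArchInnerTransfer L H 𝔨.mGi 𝔨.mqi T.arch T'.arch :=
  h.2.2.2.2.2.2.2.2.1

/-- **Pin (x) BY NAME, `G′ → G` direction**: `γ′ ↔ ψ_v γ′` (★ `Rogawski1990.Corresponds`). (ed. 1.17 named projection)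
[cite: Rogawski1990, §14.1 p. 232] -/
theorem IsPinned.corresponds [MeasurableSpace (GpAdelic L H)] [BorelSpace (GpAdelic L H)]
    {ν : Measure (GpAdelic L H)} [ν.IsHaarMeasure] [ν.IsInvInvariant] {Tinf : Literature.NumberTheory.Rogawski1990.ArchTransferFactor L H} (h : 𝔨.IsPinned ν Tinf νH νG νGi νqi νHi)
    (v : HeightOneSpectrum (𝓞 ↥(maximalRealSubfield L))) (γ' : (UnitaryGroup.cmDatum L 3 H).Local v) :
    Literature.NumberTheory.Rogawski1990.Corresponds (UnitaryGroup.conjLocal L (IsCMField.complexConj L) v)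
      ((UnitaryGroup.adelicForm L 3 H).map (UnitaryGroup.adeleToLocal L v))
      ((UnitaryGroup.adelicForm L 3 (splitForm L 3)).map (UnitaryGroup.adeleToLocal L v)) γ' (𝔨.ψ v γ') :=
  h.2.2.2.2.2.2.2.2.2.1.1 v γ'

/-- **Pin (x) BY NAME, `G → G′` direction**: `ψ_v⁻¹ γ ↔ γ`. (ed. 1.17 named projection) [cite: Rogawski1990, §14.1 p. 232] -/
theorem IsPinned.corresponds_symm [MeasurableSpace (GpAdelic L H)] [BorelSpace (GpAdelic L H)]
    {ν : Measure (GpAdelic L H)} [ν.IsHaarMeasure] [ν.IsInvInvariant] {Tinf : Literature.NumberTheory.Rogawski1990.ArchTransferFactor L H} (h : 𝔨.IsPinned ν Tinf νH νG νGi νqi νHi)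
    (v : HeightOneSpectrum (𝓞 ↥(maximalRealSubfield L))) (γ : (UnitaryGroup.cmDatum L 3 (splitForm L 3)).Local v) :
    Literature.NumberTheory.Rogawski1990.Corresponds (UnitaryGroup.conjLocal L (IsCMField.complexConj L) v)
      ((UnitaryGroup.adelicForm L 3 H).map (UnitaryGroup.adeleToLocal L v))
      ((UnitaryGroup.adelicForm L 3 (splitForm L 3)).map (UnitaryGroup.adeleToLocal L v)) ((𝔨.ψ v).symm γ) γ :=
  h.2.2.2.2.2.2.2.2.2.1.2 v γ

/-- **Pin (xi″) BY NAME**: the kit's local transfer factors `𝔨.Δ` and orbital measure families `𝔨.mH`, `𝔨.mG` at the finite places (FIELDS since ed. 1.18;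
non-degenerate ∕ admissible on the (`G`-)regular classes) — the SAME collection almost everywhere trivial and satisfying the product formula with `Tinf.Δ` (xi′) —
together with its archimedean families `𝔨.mHi`, `𝔨.mGi`, under which `TransferH f′ f^H` is, for the SAME pure tensors, a Δ_v-transfer at EVERY finite `v` AND an
archimedean Δ-transfer for `Tinf` (`IsArchDeltaTransfer`); (ed. 1.22) the tensors are TEST tensors, `T.IsTest ∧ T^H.IsUnramified₂ ∧ (∀ v ∈ T^H.S, IsLocSmooth (T^H.loc v)) ∧
ArchSmooth₂ L T^H.arch`. (ed. 1.17 named projection; ed. 1.18 over the fields) [cite: Rogawski1990, §14.3 p. 234]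
[cite: Rogawski1990, §4.9 p. 54] [cite: Rogawski1990, §14.3 p. 233] -/
theorem IsPinned.deltaTransfer [MeasurableSpace (GpAdelic L H)] [BorelSpace (GpAdelic L H)]
    {ν : Measure (GpAdelic L H)} [ν.IsHaarMeasure] [ν.IsInvInvariant] {Tinf : Literature.NumberTheory.Rogawski1990.ArchTransferFactor L H} (h : 𝔨.IsPinned ν Tinf νH νG νGi νqi νHi) :
    letI : ∀ (v : HeightOneSpectrum (𝓞 ↥(maximalRealSubfield L))) (a : HLocal L v),
        MeasurableSpace (HLocal L v ⧸ Subgroup.centralizer ({a} : Set (HLocal L v))) := fun _ _ => borel _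
    letI : ∀ (v : HeightOneSpectrum (𝓞 ↥(maximalRealSubfield L))) (γ : (UnitaryGroup.cmDatum L 3 H).Local v),
        MeasurableSpace ((UnitaryGroup.cmDatum L 3 H).Local v ⧸
          Subgroup.centralizer ({γ} : Set ((UnitaryGroup.cmDatum L 3 H).Local v))) := fun _ _ => borel _
    letI : ∀ a : (UnitaryGroup.arch (↥(maximalRealSubfield L)) L (IsCMField.complexConj L) 2
            (Matrix.of fun i j : Fin 2 => if i.val + j.val + 1 = 2 then (1 : L) else 0) ×
          UnitaryGroup.arch (↥(maximalRealSubfield L)) L (IsCMField.complexConj L) 1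
            (Matrix.of fun i j : Fin 1 => if i.val + j.val + 1 = 1 then (1 : L) else 0)),
        MeasurableSpace ((UnitaryGroup.arch (↥(maximalRealSubfield L)) L (IsCMField.complexConj L) 2
            (Matrix.of fun i j : Fin 2 => if i.val + j.val + 1 = 2 then (1 : L) else 0) ×
          UnitaryGroup.arch (↥(maximalRealSubfield L)) L (IsCMField.complexConj L) 1
            (Matrix.of fun i j : Fin 1 => if i.val + j.val + 1 = 1 then (1 : L) else 0)) ⧸
          Subgroup.centralizer ({a} : Set (UnitaryGroup.arch (↥(maximalRealSubfield L)) L (IsCMField.complexConj L) 2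
            (Matrix.of fun i j : Fin 2 => if i.val + j.val + 1 = 2 then (1 : L) else 0) ×
          UnitaryGroup.arch (↥(maximalRealSubfield L)) L (IsCMField.complexConj L) 1
            (Matrix.of fun i j : Fin 1 => if i.val + j.val + 1 = 1 then (1 : L) else 0)))) := fun _ => borel _;
    letI : ∀ γ : UnitaryGroup.arch (↥(maximalRealSubfield L)) L (IsCMField.complexConj L) 3 H,
        MeasurableSpace (UnitaryGroup.arch (↥(maximalRealSubfield L)) L (IsCMField.complexConj L) 3 H ⧸ Subgroup.centralizer ({γ} : Set (UnitaryGroup.arch (↥(maximalRealSubfield L)) L (IsCMField.complexConj L) 3 H))) := fun _ => borel _;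
    (∀ v, Literature.NumberTheory.Rogawski1990.IsLocalNondegenerate L H v (𝔨.Δ v) ∧
        (𝔨.mH v).IsAdmissibleOn (Literature.NumberTheory.Rogawski1990.IsLocalGRegular L v) ∧
        (𝔨.mG v).IsAdmissibleOn fun γ =>
          Literature.NumberTheory.Rogawski1990.IsRegularElt (γ.val : GL (Fin 3) (UnitaryGroup.LocalRing L v))) ∧
      Literature.NumberTheory.Rogawski1990.IsAlmostEverywhereTrivial L H 𝔨.Δ ∧
      Literature.NumberTheory.Rogawski1990.SatisfiesProductFormula L H 𝔨.Δ Tinf.Δ ∧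
      𝔨.mHi.IsAdmissibleOn (Literature.NumberTheory.Rogawski1990.IsArchGRegular L) ∧
      𝔨.mGi.IsAdmissibleOn (fun γ => Literature.NumberTheory.Rogawski1990.IsRegularElt (γ.val : GL (Fin 3) (NumberField.mixedEmbedding.mixedSpace L))) ∧
      ∀ (f' : TestGp L H) (fH : TestH L), 𝔨.TransferH f' fH →
        ∃ (T : UnitaryGroup.PureTensor L 3 H) (TH : UnitaryGroup.PureTensor₂ L (splitForm L 2) (splitForm L 1)),
          (T.IsTest ∧ TH.IsUnramified₂ ∧ (∀ v ∈ TH.S, Literature.NumberTheory.Rogawski1990.IsLocSmooth (TH.loc v)) ∧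
            Literature.NumberTheory.Rogawski1990.ArchSmooth₂ L TH.arch) ∧
          ⇑f' = T.eval ∧ ⇑fH = TH.eval ∧
          (∀ v, Literature.NumberTheory.Rogawski1990.IsLocalDeltaTransfer L H v (𝔨.Δ v) (𝔨.mH v) (𝔨.mG v) (TH.loc v) (T.loc v)) ∧
          Literature.NumberTheory.Rogawski1990.IsArchDeltaTransfer L H Tinf 𝔨.mHi 𝔨.mGi TH.arch T.arch := by
  obtain ⟨hv, hae, hpf, h₁, h₂, h₃⟩ := h.2.2.2.2.2.2.2.2.2.2.1
  exact ⟨fun v => ⟨(hv v).1, (hv v).2.1, (hv v).2.2.1⟩, hae, hpf, h₁, h₂, h₃⟩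

/-- **(ed. 1.22) pin (ix′) UNPACKED at a `Transfer` pair**: `Transfer f′ f` is witnessed by TEST tensors `T`, `T′` (`T.IsTest`, `T′.IsTest`) with `f′ = T.eval`,
`f = T′.eval`, `T′_v = T_v ∘ ψ_v⁻¹` at every finite `v` and the archimedean inner transfer of `T.arch` to `T′.arch` — the currency of ★ O11-1d ∕ ★ G1
(`hT : T.IsTest`). [cite: Rogawski1990, §14.2 (14.2.1) pp. 232–233] -/
theorem IsPinned.transfer_tensors [MeasurableSpace (GpAdelic L H)] [BorelSpace (GpAdelic L H)]
    {ν : Measure (GpAdelic L H)} [ν.IsHaarMeasure] [ν.IsInvInvariant] {Tinf : Literature.NumberTheory.Rogawski1990.ArchTransferFactor L H} (h : 𝔨.IsPinned ν Tinf νH νG νGi νqi νHi) {f' : TestGp L H} {f : TestG L}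
    (hf : 𝔨.Transfer f' f) :
    letI : ∀ γ : UnitaryGroup.arch (↥(maximalRealSubfield L)) L (IsCMField.complexConj L) 3 H,
        MeasurableSpace (UnitaryGroup.arch (↥(maximalRealSubfield L)) L (IsCMField.complexConj L) 3 H ⧸ Subgroup.centralizer ({γ} : Set (UnitaryGroup.arch (↥(maximalRealSubfield L)) L (IsCMField.complexConj L) 3 H))) := fun _ => borel _
    letI : ∀ γ : UnitaryGroup.arch (↥(maximalRealSubfield L)) L (IsCMField.complexConj L) 3
          (Matrix.of fun i j : Fin 3 => if i.val + j.val + 1 = 3 then (1 : L) else 0),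
        MeasurableSpace (UnitaryGroup.arch (↥(maximalRealSubfield L)) L (IsCMField.complexConj L) 3
          (Matrix.of fun i j : Fin 3 => if i.val + j.val + 1 = 3 then (1 : L) else 0) ⧸
          Subgroup.centralizer ({γ} : Set (UnitaryGroup.arch (↥(maximalRealSubfield L)) L (IsCMField.complexConj L) 3
          (Matrix.of fun i j : Fin 3 => if i.val + j.val + 1 = 3 then (1 : L) else 0)))) := fun _ => borel _
    ∃ (T : UnitaryGroup.PureTensor L 3 H) (T' : UnitaryGroup.PureTensor L 3 (splitForm L 3)),
      T.IsTest ∧ T'.IsTest ∧ ⇑f' = T.eval ∧ ⇑f = T'.eval ∧ (∀ v, T'.loc v = T.loc v ∘ (𝔨.ψ v).symm) ∧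
        Literature.NumberTheory.Rogawski1990.IsArchInnerTransfer L H 𝔨.mGi 𝔨.mqi T.arch T'.arch := by
  obtain ⟨T, T', ⟨hT, hT'⟩, h₁, h₂, h₃, h₄⟩ := (IsPinned.transfer_arch 𝔨 h).2.2 f' f hf
  exact ⟨T, T', hT, hT', h₁, h₂, h₃, h₄⟩

/-- **(ed. 1.22) pin (xi″) UNPACKED at a `TransferH` pair, in ★ O11-1d's currency**: `TransferH f′ f^H` is witnessed by a TEST tensor `T` (`hT : T.IsTest`) and an
unramified pair tensor `T^H` (`hTH : T^H.IsUnramified₂`) whose bad factors and archimedean factor are continuous of compact support (`hTc`, `hTa`, `hTc′`, `hTa′` —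
from `IsLocSmooth` ∕ `ArchSmooth₂` of the pin), with `f′ = T.eval`, `f^H = T^H.eval`, a Δ_v-transfer at every finite `v` and the archimedean Δ-transfer for `Tinf`.
[cite: Rogawski1990, §14.3 pp. 233–234; §4.9 Prop. 4.9.1 p. 55] -/
theorem IsPinned.deltaTransfer_tensors [MeasurableSpace (GpAdelic L H)] [BorelSpace (GpAdelic L H)]
    {ν : Measure (GpAdelic L H)} [ν.IsHaarMeasure] [ν.IsInvInvariant] {Tinf : Literature.NumberTheory.Rogawski1990.ArchTransferFactor L H} (h : 𝔨.IsPinned ν Tinf νH νG νGi νqi νHi) {f' : TestGp L H} {fH : TestH L}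
    (hf : 𝔨.TransferH f' fH) :
    letI : ∀ (v : HeightOneSpectrum (𝓞 ↥(maximalRealSubfield L))) (a : HLocal L v),
        MeasurableSpace (HLocal L v ⧸ Subgroup.centralizer ({a} : Set (HLocal L v))) := fun _ _ => borel _
    letI : ∀ (v : HeightOneSpectrum (𝓞 ↥(maximalRealSubfield L))) (γ : (UnitaryGroup.cmDatum L 3 H).Local v),
        MeasurableSpace ((UnitaryGroup.cmDatum L 3 H).Local v ⧸
          Subgroup.centralizer ({γ} : Set ((UnitaryGroup.cmDatum L 3 H).Local v))) := fun _ _ => borel _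
    letI : ∀ a : (UnitaryGroup.arch (↥(maximalRealSubfield L)) L (IsCMField.complexConj L) 2
            (Matrix.of fun i j : Fin 2 => if i.val + j.val + 1 = 2 then (1 : L) else 0) ×
          UnitaryGroup.arch (↥(maximalRealSubfield L)) L (IsCMField.complexConj L) 1
            (Matrix.of fun i j : Fin 1 => if i.val + j.val + 1 = 1 then (1 : L) else 0)),
        MeasurableSpace ((UnitaryGroup.arch (↥(maximalRealSubfield L)) L (IsCMField.complexConj L) 2
            (Matrix.of fun i j : Fin 2 => if i.val + j.val + 1 = 2 then (1 : L) else 0) ×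
          UnitaryGroup.arch (↥(maximalRealSubfield L)) L (IsCMField.complexConj L) 1
            (Matrix.of fun i j : Fin 1 => if i.val + j.val + 1 = 1 then (1 : L) else 0)) ⧸
          Subgroup.centralizer ({a} : Set (UnitaryGroup.arch (↥(maximalRealSubfield L)) L (IsCMField.complexConj L) 2
            (Matrix.of fun i j : Fin 2 => if i.val + j.val + 1 = 2 then (1 : L) else 0) ×
          UnitaryGroup.arch (↥(maximalRealSubfield L)) L (IsCMField.complexConj L) 1
            (Matrix.of fun i j : Fin 1 => if i.val + j.val + 1 = 1 then (1 : L) else 0)))) := fun _ => borel _;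
    letI : ∀ γ : UnitaryGroup.arch (↥(maximalRealSubfield L)) L (IsCMField.complexConj L) 3 H,
        MeasurableSpace (UnitaryGroup.arch (↥(maximalRealSubfield L)) L (IsCMField.complexConj L) 3 H ⧸ Subgroup.centralizer ({γ} : Set (UnitaryGroup.arch (↥(maximalRealSubfield L)) L (IsCMField.complexConj L) 3 H))) := fun _ => borel _;
    ∃ (T : UnitaryGroup.PureTensor L 3 H) (TH : UnitaryGroup.PureTensor₂ L (splitForm L 2) (splitForm L 1)),
      T.IsTest ∧ TH.IsUnramified₂ ∧ (∀ v ∈ TH.S, HasCompactSupport (TH.loc v)) ∧ HasCompactSupport TH.arch ∧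
        (∀ v ∈ TH.S, Continuous (TH.loc v)) ∧ Continuous TH.arch ∧ ⇑f' = T.eval ∧ ⇑fH = TH.eval ∧
        (∀ v, Literature.NumberTheory.Rogawski1990.IsLocalDeltaTransfer L H v (𝔨.Δ v) (𝔨.mH v) (𝔨.mG v) (TH.loc v) (T.loc v)) ∧
        Literature.NumberTheory.Rogawski1990.IsArchDeltaTransfer L H Tinf 𝔨.mHi 𝔨.mGi TH.arch T.arch := by
  obtain ⟨T, TH, ⟨hT, hTH, hs, ha⟩, h₁, h₂, h₃, h₄⟩ := (IsPinned.deltaTransfer 𝔨 h).2.2.2.2.2 f' fH hf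
  exact ⟨T, TH, hT, hTH, fun v hv => (hs v hv).hasCompactSupport, ha.hasCompactSupport, fun v hv => (hs v hv).continuous, ha.continuous,
    h₁, h₂, h₃, h₄⟩

/-- **Pin (xi‴) BY NAME** (ed. 1.19a): at EVERY finite place `v` the kit's families `m^H_v`, `m^{G′}_v` are CANONICAL for the local Haar measures `νH_v`,
`νG_v` on the (`G`-)regular classes — `m[γ] = dν_v ∕ dt_γ`, `t_γ` THE Haar measure of the torus `G′_γ` ∕ `H_{γ_H}` of mass one on its compact core
(★ O9 `OrbitalMeasureFamily.IsCanonical`; print's convention [Rogawski1990, §4.3 (4.3.1) p. 43; §1.7 p. 6] up to the Tamagawa-vs-compact-core constant per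
torus, constant on stable classes and absorbed in `α`). [cite: Rogawski1990, §4.3 (4.3.1) p. 43; §1.7 p. 6] -/
theorem IsPinned.canonical [MeasurableSpace (GpAdelic L H)] [BorelSpace (GpAdelic L H)]
    {ν : Measure (GpAdelic L H)} [ν.IsHaarMeasure] [ν.IsInvInvariant] {Tinf : Literature.NumberTheory.Rogawski1990.ArchTransferFactor L H} (h : 𝔨.IsPinned ν Tinf νH νG νGi νqi νHi) :
    letI : ∀ (v : HeightOneSpectrum (𝓞 ↥(maximalRealSubfield L))) (a : HLocal L v),
        MeasurableSpace (HLocal L v ⧸ Subgroup.centralizer ({a} : Set (HLocal L v))) := fun _ _ => borel _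
    letI : ∀ (v : HeightOneSpectrum (𝓞 ↥(maximalRealSubfield L))) (γ : (UnitaryGroup.cmDatum L 3 H).Local v),
        MeasurableSpace ((UnitaryGroup.cmDatum L 3 H).Local v ⧸
          Subgroup.centralizer ({γ} : Set ((UnitaryGroup.cmDatum L 3 H).Local v))) := fun _ _ => borel _
    haveI : ∀ (v : HeightOneSpectrum (𝓞 ↥(maximalRealSubfield L))) (a : HLocal L v),
        BorelSpace (HLocal L v ⧸ Subgroup.centralizer ({a} : Set (HLocal L v))) := fun _ _ => ⟨rfl⟩
    haveI : ∀ (v : HeightOneSpectrum (𝓞 ↥(maximalRealSubfield L))) (γ : (UnitaryGroup.cmDatum L 3 H).Local v),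
        BorelSpace ((UnitaryGroup.cmDatum L 3 H).Local v ⧸
          Subgroup.centralizer ({γ} : Set ((UnitaryGroup.cmDatum L 3 H).Local v))) := fun _ _ => ⟨rfl⟩
    ∀ v, (𝔨.mH v).IsCanonical (Literature.NumberTheory.Rogawski1990.IsLocalGRegular L v) (νH v) ∧
      (𝔨.mG v).IsCanonical (fun γ =>
        Literature.NumberTheory.Rogawski1990.IsRegularElt (γ.val : GL (Fin 3) (UnitaryGroup.LocalRing L v))) (νG v) :=
  fun v => ⟨(h.2.2.2.2.2.2.2.2.2.2.1.1 v).2.2.2.1, (h.2.2.2.2.2.2.2.2.2.2.1.1 v).2.2.2.2⟩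

/-- **Pin (xii) BY NAME** (ed. 1.19a): the ARCHIMEDEAN COHERENCE of the kit's families `mGi`, `mqi`, `mHi` for `ν′_∞`, `ν_∞`, `ν_{H,∞}` (Weil form +
compatibility by transport, `ComparisonKit.ArchCoherence`). [cite: Rogawski1990, §4.3 (4.3.1) p. 43; §14.2 (14.2.1) p. 232; §14.3 p. 234] -/
theorem IsPinned.archCoherence [MeasurableSpace (GpAdelic L H)] [BorelSpace (GpAdelic L H)]
    {ν : Measure (GpAdelic L H)} [ν.IsHaarMeasure] [ν.IsInvInvariant] {Tinf : Literature.NumberTheory.Rogawski1990.ArchTransferFactor L H} (h : 𝔨.IsPinned ν Tinf νH νG νGi νqi νHi)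
    (hanis : IsAnisotropic L H) : 𝔨.ArchCoherence hanis νGi νqi νHi :=
  h.2.2.2.2.2.2.2.2.2.2.2.1 hanis

/-- **Pin (xiv) BY NAME** (ed. 1.19b₁): at every REGULAR rational class of `G′` the kit's local orbital family `mG` is NORMALISED OFF A FINITE SET —
`K′_v`-orbital mass 1 for almost all `v` (★ `UnitaryGroup.IsNormalisedOff`), the input of the Euler factorisation of `Φ_{ofLocal mG mGi}` at the rational
classes (★ `UnitaryGroup.exists_finset_adelicClassOrbitalIntegral_ofLocal_eval_eq_mul_prod`). [cite: Rogawski1990, §4.3 p. 43] -/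
theorem IsPinned.normalisedOff [MeasurableSpace (GpAdelic L H)] [BorelSpace (GpAdelic L H)]
    {ν : Measure (GpAdelic L H)} [ν.IsHaarMeasure] [ν.IsInvInvariant] {Tinf : Literature.NumberTheory.Rogawski1990.ArchTransferFactor L H} (h : 𝔨.IsPinned ν Tinf νH νG νGi νqi νHi)
    (c : ConjClasses (UnitaryGroup.cmDatum L 3 H).Rational)
    (hc : Literature.NumberTheory.Rogawski1990.IsRegularElt ((Quotient.out c).val : GL (Fin 3) L)) :
    letI : ∀ (v : HeightOneSpectrum (𝓞 ↥(maximalRealSubfield L))) (γ : (UnitaryGroup.cmDatum L 3 H).Local v),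
        MeasurableSpace ((UnitaryGroup.cmDatum L 3 H).Local v ⧸
          Subgroup.centralizer ({γ} : Set ((UnitaryGroup.cmDatum L 3 H).Local v))) := fun _ _ => borel _;
    ∃ S₀ : Finset (HeightOneSpectrum (𝓞 ↥(maximalRealSubfield L))),
      UnitaryGroup.IsNormalisedOff L 3 H 𝔨.mG ((UnitaryGroup.cmDatum L 3 H).toAdelic (Quotient.out c)) S₀ :=
  h.2.2.2.2.2.2.2.2.2.2.2.2.1 c hc

/-- **Pin (viii‴) BY NAME** (ed. 1.19b₂) THE PER-CLASS β-SOCKET: at every REGULAR rational class `[γ]` of `G′` the kit's ONE adelic family `μA` is a POSITIVE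
multiple of the family built from its local data, `μA [γ] = b • ofLocal m^{G′} m^{G′}_∞ [γ]` (★ `UnitaryGroup.AdelicOrbitalMeasureFamily.ofLocal`: the restricted
product of the local quotient measures `m^{G′}_v[γ_v]`, `m^{G′}_∞[γ_∞]` [§4.3 pp. 43–44]); so `Φ_{μA}([γ], ⊗ f′_v) = b · Φ_{m_∞}(γ_∞, f′_∞) · ∏_{v ∈ S} Φ_{m_v}(γ_v, f′_v)`
(★ `UnitaryGroup.exists_finset_adelicClassOrbitalIntegral_eq_mul_prod_of_eq_ofReal_smul_ofLocal`, with (xiv) and (xi‴)).  The STABLE-CLASS form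
`b = α(𝒪_st(γ))` [§5.4 (5.4.3) p. 72] waits on the explicit geometric side (quotient measures and covolume weights). [cite: Rogawski1990, §4.3 pp. 43–44; §5.4 p. 72] -/
theorem IsPinned.exists_μA_eq_smul_ofLocal [MeasurableSpace (GpAdelic L H)] [BorelSpace (GpAdelic L H)]
    {ν : Measure (GpAdelic L H)} [ν.IsHaarMeasure] [ν.IsInvInvariant] {Tinf : Literature.NumberTheory.Rogawski1990.ArchTransferFactor L H} (h : 𝔨.IsPinned ν Tinf νH νG νGi νqi νHi)
    (c : ConjClasses (UnitaryGroup.cmDatum L 3 H).Rational)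
    (hc : Literature.NumberTheory.Rogawski1990.IsRegularElt ((Quotient.out c).val : GL (Fin 3) L)) :
    letI : ∀ g : GpAdelic L H, MeasurableSpace (GpAdelic L H ⧸ Subgroup.centralizer ({g} : Set (GpAdelic L H))) := fun _ => borel _
    letI : ∀ γ : GpInf L H, MeasurableSpace (GpInf L H ⧸ Subgroup.centralizer ({γ} : Set (GpInf L H))) := fun _ => borel _
    letI : ∀ (v : HeightOneSpectrum (𝓞 ↥(maximalRealSubfield L))) (γ : (UnitaryGroup.cmDatum L 3 H).Local v),
        MeasurableSpace ((UnitaryGroup.cmDatum L 3 H).Local v ⧸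
          Subgroup.centralizer ({γ} : Set ((UnitaryGroup.cmDatum L 3 H).Local v))) := fun _ _ => borel _
    ∃ b : ℝ, 0 < b ∧ 𝔨.μA c = ENNReal.ofReal b • UnitaryGroup.AdelicOrbitalMeasureFamily.ofLocal L 3 H 𝔨.mG 𝔨.mGi c :=
  h.2.2.2.2.2.2.2.2.2.2.2.2.2.1 c hc

/-- **Pin (xii″) BY NAME** (ed. 1.19c₁): `SJ_G(𝒪, f) = α(𝒪) · κ_G(𝒪) · Φ^{st,𝐀}_G(γ₀; ofLocalAdelic m m_∞; f)` at every regular stable class, every representative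
`γ₀` (`ComparisonKit.PinSJG`). [cite: Rogawski1990, Thm. 14.5.1 (a) p. 238; §5.4 (5.4.3) pp. 72–73] -/
theorem IsPinned.sjG_eq [MeasurableSpace (GpAdelic L H)] [BorelSpace (GpAdelic L H)]
    {ν : Measure (GpAdelic L H)} [ν.IsHaarMeasure] [ν.IsInvInvariant] {Tinf : Literature.NumberTheory.Rogawski1990.ArchTransferFactor L H} (h : 𝔨.IsPinned ν Tinf νH νG νGi νqi νHi) :
    𝔨.PinSJG 𝔨.κG :=
  h.2.2.2.2.2.2.2.2.2.2.2.2.2.2.1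

/-- **Pin (xii-f) BY NAME** (ed. 1.19c₁): `𝒪 ↦ SJ_G(𝒪, f)` is finitely supported for every `f` (`ComparisonKit.PinSJGFinite`). [cite: Rogawski1990, §14.5 p. 238] -/
theorem IsPinned.sjG_support_finite [MeasurableSpace (GpAdelic L H)] [BorelSpace (GpAdelic L H)]
    {ν : Measure (GpAdelic L H)} [ν.IsHaarMeasure] [ν.IsInvInvariant] {Tinf : Literature.NumberTheory.Rogawski1990.ArchTransferFactor L H} (h : 𝔨.IsPinned ν Tinf νH νG νGi νqi νHi)
    (f : TestG L) : (Function.support fun 𝒪 => 𝔨.SJG 𝒪 f).Finite :=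
  h.2.2.2.2.2.2.2.2.2.2.2.2.2.2.2.1 f

/-- **Pin (xiii-c) BY NAME** (ed. 1.19c₁): `transfersTo 𝒪H 𝒪 ↔ (eStH 𝒪H).TransfersTo H ξ (eSt 𝒪)` (`ComparisonKit.PinTransfersTo`). [cite: Rogawski1990, Thm. 14.5.1 (a) p. 238; §4.6 p. 49] -/
theorem IsPinned.transfersTo_iff [MeasurableSpace (GpAdelic L H)] [BorelSpace (GpAdelic L H)]
    {ν : Measure (GpAdelic L H)} [ν.IsHaarMeasure] [ν.IsInvInvariant] {Tinf : Literature.NumberTheory.Rogawski1990.ArchTransferFactor L H} (h : 𝔨.IsPinned ν Tinf νH νG νGi νqi νHi)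
    (𝒪H : 𝔨.StClassH) (𝒪 : 𝔨.StClass) :
    𝔨.transfersTo 𝒪H 𝒪 ↔ (𝔨.eStH 𝒪H).TransfersTo H Literature.NumberTheory.Rogawski1990.endoForm_antidiagOne (𝔨.eSt 𝒪) :=
  h.2.2.2.2.2.2.2.2.2.2.2.2.2.2.2.2.1 𝒪H 𝒪

/-- **Pin (κ) BY NAME** (ed. 1.19c₁): `κ_G > 0` and `κ_H > 0` (`ComparisonKit.PinKappa`). [cite: Rogawski1990, §5.4 (5.4.3) p. 72] -/
theorem IsPinned.κ_pos [MeasurableSpace (GpAdelic L H)] [BorelSpace (GpAdelic L H)]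
    {ν : Measure (GpAdelic L H)} [ν.IsHaarMeasure] [ν.IsInvInvariant] {Tinf : Literature.NumberTheory.Rogawski1990.ArchTransferFactor L H} (h : 𝔨.IsPinned ν Tinf νH νG νGi νqi νHi) :
    (∀ 𝒪, 0 < 𝔨.κG 𝒪) ∧ ∀ 𝒪H, 0 < 𝔨.κH 𝒪H :=
  h.2.2.2.2.2.2.2.2.2.2.2.2.2.2.2.2.2.1

/-- **Pin (xiii″) BY NAME** (ed. 1.19c₂): `SJ_H(𝒪H, fH) = κ_H(𝒪H) · Φ^{st,𝐀}_H(γH; ofLocalAdelicPair 𝔨.mH 𝔨.mHi; fH)` at every `G`-regular stable class of `H(L⁺)` and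
every representative `γH` (`ComparisonKit.PinSJH`). [cite: Rogawski1990, Thm. 14.5.1 (a) p. 238; §5.4 (5.4.3) pp. 72–73] -/
theorem IsPinned.sjH_eq [MeasurableSpace (GpAdelic L H)] [BorelSpace (GpAdelic L H)]
    {ν : Measure (GpAdelic L H)} [ν.IsHaarMeasure] [ν.IsInvInvariant] {Tinf : Literature.NumberTheory.Rogawski1990.ArchTransferFactor L H} (h : 𝔨.IsPinned ν Tinf νH νG νGi νqi νHi) :
    𝔨.PinSJH 𝔨.eStH 𝔨.κH :=
  h.2.2.2.2.2.2.2.2.2.2.2.2.2.2.2.2.2.2.1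

/-- **Pin (xiii-f) BY NAME** (ed. 1.19c₂): `𝒪H ↦ SJ_H(𝒪H, fH)` is finitely supported for every `fH` (`ComparisonKit.PinSJHFinite`). [cite: Rogawski1990, §14.5 p. 238] -/
theorem IsPinned.sjH_support_finite [MeasurableSpace (GpAdelic L H)] [BorelSpace (GpAdelic L H)]
    {ν : Measure (GpAdelic L H)} [ν.IsHaarMeasure] [ν.IsInvInvariant] {Tinf : Literature.NumberTheory.Rogawski1990.ArchTransferFactor L H} (h : 𝔨.IsPinned ν Tinf νH νG νGi νqi νHi)
    (fH : TestH L) : (Function.support fun 𝒪H => 𝔨.SJH 𝒪H fH).Finite :=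
  h.2.2.2.2.2.2.2.2.2.2.2.2.2.2.2.2.2.2.2.1 fH

/-- **Pin (κ-v) BY NAME** (ed. 1.20): the VALUES `κ_G(𝒪) = (#{𝒪H ↦ 𝒪} + 1)⁻¹`, `κ_H(𝒪H) = 2·α(𝒪)·(#{𝒪H′ ↦ 𝒪} + 1)⁻¹` for `𝒪H ↦ 𝒪`
(`ComparisonKit.PinKappaValues`). [cite: Rogawski1990, §5.4 (5.4.3)–(5.4.5) pp. 72–73; Thm. 14.5.1 (a) p. 238] -/
theorem IsPinned.kappaValues [MeasurableSpace (GpAdelic L H)] [BorelSpace (GpAdelic L H)]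
    {ν : Measure (GpAdelic L H)} [ν.IsHaarMeasure] [ν.IsInvInvariant] {Tinf : Literature.NumberTheory.Rogawski1990.ArchTransferFactor L H} (h : 𝔨.IsPinned ν Tinf νH νG νGi νqi νHi) :
    𝔨.PinKappaValues 𝔨.κG 𝔨.κH :=
  h.2.2.2.2.2.2.2.2.2.2.2.2.2.2.2.2.2.2.2.2.1

/-- **Pin (xv) BY NAME** (ed. 1.21): the stabilisation package `(A, 𝓡, obs, e, hHasse, hκ)` of the kit's own `Δ` at every regular rational `γ₀`
(`ComparisonKit.PinStabilisationPackage`) — the T1b closer's input to ★ O11-1 `…_of_equiv (𝓡 obs e hHasse …)` and ★ G2 `…_of_globalKappaFormula`.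
[cite: Rogawski1990, §3.3 Prop. 3.3.1 p. 22; §4.3 (4.3.3) p. 44; §5.4 (5.4.5) pp. 72–74; §14.3 pp. 233–234] -/
theorem IsPinned.stabilisationPackage [MeasurableSpace (GpAdelic L H)] [BorelSpace (GpAdelic L H)]
    {ν : Measure (GpAdelic L H)} [ν.IsHaarMeasure] [ν.IsInvInvariant] {Tinf : Literature.NumberTheory.Rogawski1990.ArchTransferFactor L H} (h : 𝔨.IsPinned ν Tinf νH νG νGi νqi νHi) :
    𝔨.PinStabilisationPackage Tinf :=
  h.2.2.2.2.2.2.2.2.2.2.2.2.2.2.2.2.2.2.2.2.2.1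

/-- **Pin (viii⁵) BY NAME** (ed. 1.23, the LAST conjunct): at every REGULAR rational class `c`,
`μA c = α(eSt⁻¹ 𝒪_st(c)) • AdelicOrbitalMeasureFamily.ofLocal mG mGi c` (`ComparisonKit.PinStableBeta`) — the input of
`IsPinned.j_eq_sjG_add_half_sjHover_of_isRegularElt` (§ «T1b at the regular classes»). [cite: Rogawski1990, §4.3 (4.3.1)–(4.3.2) pp. 43–44; §5.4 (5.4.1) p. 72] -/
theorem IsPinned.stableBeta [MeasurableSpace (GpAdelic L H)] [BorelSpace (GpAdelic L H)]
    {ν : Measure (GpAdelic L H)} [ν.IsHaarMeasure] [ν.IsInvInvariant] {Tinf : Literature.NumberTheory.Rogawski1990.ArchTransferFactor L H} (h : 𝔨.IsPinned ν Tinf νH νG νGi νqi νHi) :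
    𝔨.PinStableBeta :=
  h.2.2.2.2.2.2.2.2.2.2.2.2.2.2.2.2.2.2.2.2.2.2.1

/-- **(ed. 1.24a₀) pin (xiii‴-cc) BY NAME**: at an `H`-class `[(ζ • 1₂, h₁)]` transferring to a CENTRAL class, `SJ_H(𝒪H, ·)` is some multiple of
`f^H(γH ⊗ 1)` (sign-free; the package clause (c-c) [Lemma 14.5.2 (c)] makes the product vanish on transfers).  PRINT READING (ref1 R1-169 n3):
Prop. 10.1.2 (a) reads `SJ(𝒪_st, φ) = m(Z_H∖H)·φ(γ) + C·Φ^{M_H}(γ, φ)`; the pure-multiple shape `κ · f^H(γ_H)` is the right reading for the §14.5 test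
functions because `f′^H = ⊗_w f′^H_w` has `Φ^{M_H}(γ, f′^H_w) = 0` at any place `w` with `G′_w ≄ G_w` (pp. 238–240), and such a `w` exists for the
anisotropic inner form. [cite: Rogawski1990, Prop. 10.1.2 (a) p. 146; Lemma 14.5.2 (c) p. 238; §14.5 pp. 238–240] -/
theorem IsPinned.sjHCentralImage [MeasurableSpace (GpAdelic L H)] [BorelSpace (GpAdelic L H)]
    {ν : Measure (GpAdelic L H)} [ν.IsHaarMeasure] [ν.IsInvInvariant] {Tinf : Literature.NumberTheory.Rogawski1990.ArchTransferFactor L H} (h : 𝔨.IsPinned ν Tinf νH νG νGi νqi νHi) :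
    𝔨.PinSJHCentralImage :=
  h.2.2.2.2.2.2.2.2.2.2.2.2.2.2.2.2.2.2.2.2.2.2.2.1

/-- **(ed. 1.24a₀) pin (c-s) BY NAME** [Lemma 14.5.2 (a)]: on transfers, `SJ_H` VANISHES at the `H`-regular classes `[(h₂, a)]`, `charpoly h₂ =
(X − a)(X − b)`, `a ≠ b`, whose image `{a, a, b}` is `G`-singular. [cite: Rogawski1990, Lemma 14.5.2 (a) p. 238] -/
theorem IsPinned.singularHRegularVanish [MeasurableSpace (GpAdelic L H)] [BorelSpace (GpAdelic L H)]
    {ν : Measure (GpAdelic L H)} [ν.IsHaarMeasure] [ν.IsInvInvariant] {Tinf : Literature.NumberTheory.Rogawski1990.ArchTransferFactor L H} (h : 𝔨.IsPinned ν Tinf νH νG νGi νqi νHi) :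
    𝔨.PinSingularHRegularVanish :=
  h.2.2.2.2.2.2.2.2.2.2.2.2.2.2.2.2.2.2.2.2.2.2.2.2.1

/-- **(ed. 1.24a₀) pin (xiii-0) BY NAME**: `SJ_H(𝒪H, ·) = 0` at every `H`-class whose image is NOT semisimple (the last conjunct of `IsPinned` in ed. 1.24a₀∕a₁; since ed. 1.24b followed by the tail below;
what makes law T1b-vanish hold for every pinned kit, F0P3a-p01 V-KIT). [cite: Rogawski1990, Thm. 14.5.1 (a) p. 238; Prop. 5.4.1 p. 77] -/
theorem IsPinned.sjHOffSemisimple [MeasurableSpace (GpAdelic L H)] [BorelSpace (GpAdelic L H)]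
    {ν : Measure (GpAdelic L H)} [ν.IsHaarMeasure] [ν.IsInvInvariant] {Tinf : Literature.NumberTheory.Rogawski1990.ArchTransferFactor L H} (h : 𝔨.IsPinned ν Tinf νH νG νGi νqi νHi) :
    𝔨.PinSJHOffSemisimple :=
  h.2.2.2.2.2.2.2.2.2.2.2.2.2.2.2.2.2.2.2.2.2.2.2.2.2.1

/-- **(ed. 1.24b) pin `PinCentralHVanish` BY NAME** (conjunct 27 of 39 of `IsPinned`): the text is `ComparisonKit.PinCentralHVanish` in the main workfile (appended in ed. 1.24b; RULING #119 (3), LEAD WORD #120 (b)). [cite: Rogawski1990, Lemma 14.5.2 (c) p. 238] -/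
theorem IsPinned.centralHVanish [MeasurableSpace (GpAdelic L H)] [BorelSpace (GpAdelic L H)]
    {ν : Measure (GpAdelic L H)} [ν.IsHaarMeasure] [ν.IsInvInvariant] {Tinf : Literature.NumberTheory.Rogawski1990.ArchTransferFactor L H} (h : 𝔨.IsPinned ν Tinf νH νG νGi νqi νHi) :
    𝔨.PinCentralHVanish :=
  h.2.2.2.2.2.2.2.2.2.2.2.2.2.2.2.2.2.2.2.2.2.2.2.2.2.2.1

/-- **(ed. 1.24b) pin `PinCentralValueTransfer` BY NAME** (conjunct 28 of 39 of `IsPinned`): the text is `ComparisonKit.PinCentralValueTransfer` in the main workfile (appended in ed. 1.24b; RULING #119 (3), LEAD WORD #120 (b)). [cite: Rogawski1990, §14.5 p. 239; §8.4] -/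
theorem IsPinned.centralValueTransfer [MeasurableSpace (GpAdelic L H)] [BorelSpace (GpAdelic L H)]
    {ν : Measure (GpAdelic L H)} [ν.IsHaarMeasure] [ν.IsInvInvariant] {Tinf : Literature.NumberTheory.Rogawski1990.ArchTransferFactor L H} (h : 𝔨.IsPinned ν Tinf νH νG νGi νqi νHi) :
    𝔨.PinCentralValueTransfer :=
  h.2.2.2.2.2.2.2.2.2.2.2.2.2.2.2.2.2.2.2.2.2.2.2.2.2.2.2.1

/-- **(ed. 1.24b) pin `PinPsiConj` BY NAME** (conjunct 29 of 39 of `IsPinned`): the text is `ComparisonKit.PinPsiConj` in the main workfile (appended in ed. 1.24b; RULING #119 (3), LEAD WORD #120 (b)). [cite: Rogawski1990, §14.1 p. 232] -/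
theorem IsPinned.psiConj [MeasurableSpace (GpAdelic L H)] [BorelSpace (GpAdelic L H)]
    {ν : Measure (GpAdelic L H)} [ν.IsHaarMeasure] [ν.IsInvInvariant] {Tinf : Literature.NumberTheory.Rogawski1990.ArchTransferFactor L H} (h : 𝔨.IsPinned ν Tinf νH νG νGi νqi νHi) :
    𝔨.PinPsiConj :=
  h.2.2.2.2.2.2.2.2.2.2.2.2.2.2.2.2.2.2.2.2.2.2.2.2.2.2.2.2.1

/-- **(ed. 1.24b) pin `PinMuAMassCentral` BY NAME** (conjunct 30 of 39 of `IsPinned`): the text is `ComparisonKit.PinMuAMassCentral` in the main workfile (appended in ed. 1.24b; RULING #119 (3), LEAD WORD #120 (b)). [cite: Rogawski1990, Prop. 10.1.2 (b)(2) p. 146; §14.5 p. 237] -/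
theorem IsPinned.muAMassCentral [MeasurableSpace (GpAdelic L H)] [BorelSpace (GpAdelic L H)]
    {ν : Measure (GpAdelic L H)} [ν.IsHaarMeasure] [ν.IsInvInvariant] {Tinf : Literature.NumberTheory.Rogawski1990.ArchTransferFactor L H} (h : 𝔨.IsPinned ν Tinf νH νG νGi νqi νHi) :
    𝔨.PinMuAMassCentral :=
  h.2.2.2.2.2.2.2.2.2.2.2.2.2.2.2.2.2.2.2.2.2.2.2.2.2.2.2.2.2.1

/-- **(ed. 1.24b) pin `PinMuAShapeSingular` BY NAME** (conjunct 31 of 39 of `IsPinned`): the text is `ComparisonKit.PinMuAShapeSingular` in the main workfile (appended in ed. 1.24b; RULING #119 (3), LEAD WORD #120 (b)). [cite: Rogawski1990, §5.4 (5.4.1) p. 72; §14.5 p. 239; Kottwitz1988 Thm. 1] -/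
theorem IsPinned.muAShapeSingular [MeasurableSpace (GpAdelic L H)] [BorelSpace (GpAdelic L H)]
    {ν : Measure (GpAdelic L H)} [ν.IsHaarMeasure] [ν.IsInvInvariant] {Tinf : Literature.NumberTheory.Rogawski1990.ArchTransferFactor L H} (h : 𝔨.IsPinned ν Tinf νH νG νGi νqi νHi) :
    𝔨.PinMuAShapeSingular :=
  h.2.2.2.2.2.2.2.2.2.2.2.2.2.2.2.2.2.2.2.2.2.2.2.2.2.2.2.2.2.2.1

/-- **(ed. 1.24b) pin `PinSingularArchInnerTransfer` BY NAME** (conjunct 32 of 39 of `IsPinned`): the text is `ComparisonKit.PinSingularArchInnerTransfer` in the main workfile (appended in ed. 1.24b; RULING #119 (3), LEAD WORD #120 (b)). [cite: Rogawski1990, §14.2 (14.2.1) p. 232; Lemma 14.5.2 (b) p. 238; §4.1 (4.1.2)] [cite: Kottwitz1988, Prop. 2] -/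
theorem IsPinned.singularArchInnerTransfer [MeasurableSpace (GpAdelic L H)] [BorelSpace (GpAdelic L H)]
    {ν : Measure (GpAdelic L H)} [ν.IsHaarMeasure] [ν.IsInvInvariant] {Tinf : Literature.NumberTheory.Rogawski1990.ArchTransferFactor L H} (h : 𝔨.IsPinned ν Tinf νH νG νGi νqi νHi) :
    𝔨.PinSingularArchInnerTransfer :=
  h.2.2.2.2.2.2.2.2.2.2.2.2.2.2.2.2.2.2.2.2.2.2.2.2.2.2.2.2.2.2.2.1

/-- **(ed. 1.24b) pin `PinSingularEndoscopicMass` BY NAME** (conjunct 33 of 39 of `IsPinned`): the text is `ComparisonKit.PinSingularEndoscopicMass` in the main workfile (appended in ed. 1.24b; RULING #119 (3), LEAD WORD #120 (b)). [cite: Kottwitz1988, Thm. 1] [cite: Rogawski1990, Prop. 10.1.2 (a) p. 146; Lemma 14.5.2 (b) p. 238; §4.3 (4.3.3) p. 44; §4.1 (4.1.2); §14.5 p. 239] [cite: Kottwitz1986, §9] [cite: Kottwitz1988, Thm. 1, Prop. 2] -/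
theorem IsPinned.singularEndoscopicMass [MeasurableSpace (GpAdelic L H)] [BorelSpace (GpAdelic L H)]
    {ν : Measure (GpAdelic L H)} [ν.IsHaarMeasure] [ν.IsInvInvariant] {Tinf : Literature.NumberTheory.Rogawski1990.ArchTransferFactor L H} (h : 𝔨.IsPinned ν Tinf νH νG νGi νqi νHi) :
    𝔨.PinSingularEndoscopicMass :=
  h.2.2.2.2.2.2.2.2.2.2.2.2.2.2.2.2.2.2.2.2.2.2.2.2.2.2.2.2.2.2.2.2.1

/-- **(ed. 1.24b) pin `PinSJGCentral` BY NAME** (conjunct 34 of 39 of `IsPinned`): the text is `ComparisonKit.PinSJGCentral` in the main workfile (appended in ed. 1.24b; RULING #119 (3), LEAD WORD #120 (b)). [cite: Rogawski1990, Prop. 10.1.2 (b)(2) p. 146; §14.5 p. 239] -/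
theorem IsPinned.sjGCentral [MeasurableSpace (GpAdelic L H)] [BorelSpace (GpAdelic L H)]
    {ν : Measure (GpAdelic L H)} [ν.IsHaarMeasure] [ν.IsInvInvariant] {Tinf : Literature.NumberTheory.Rogawski1990.ArchTransferFactor L H} (h : 𝔨.IsPinned ν Tinf νH νG νGi νqi νHi) :
    𝔨.PinSJGCentral :=
  h.2.2.2.2.2.2.2.2.2.2.2.2.2.2.2.2.2.2.2.2.2.2.2.2.2.2.2.2.2.2.2.2.2.1

/-- **(ed. 1.24b) pin `PinSJGSingular` BY NAME** (conjunct 35 of 39 of `IsPinned`): the text is `ComparisonKit.PinSJGSingular` in the main workfile (appended in ed. 1.24b; RULING #119 (3), LEAD WORD #120 (b)). [cite: Rogawski1990, Prop. 10.1.2 (b)(1) p. 146; §4.1 (4.1.2) p. 40; §14.5 p. 239] -/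
theorem IsPinned.sjGSingular [MeasurableSpace (GpAdelic L H)] [BorelSpace (GpAdelic L H)]
    {ν : Measure (GpAdelic L H)} [ν.IsHaarMeasure] [ν.IsInvInvariant] {Tinf : Literature.NumberTheory.Rogawski1990.ArchTransferFactor L H} (h : 𝔨.IsPinned ν Tinf νH νG νGi νqi νHi) :
    𝔨.PinSJGSingular :=
  h.2.2.2.2.2.2.2.2.2.2.2.2.2.2.2.2.2.2.2.2.2.2.2.2.2.2.2.2.2.2.2.2.2.2.1

/-- **(ed. 1.24b) pin `PinTransferIff` BY NAME** (conjunct 36 of 39 of `IsPinned`): the text is `ComparisonKit.PinTransferIff` in the main workfile (appended in ed. 1.24b; RULING #119 (3), LEAD WORD #120 (b)). [cite: Rogawski1990, §14.2 (14.2.1) pp. 232–233] -/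
theorem IsPinned.transfer_iff_local [MeasurableSpace (GpAdelic L H)] [BorelSpace (GpAdelic L H)]
    {ν : Measure (GpAdelic L H)} [ν.IsHaarMeasure] [ν.IsInvInvariant] {Tinf : Literature.NumberTheory.Rogawski1990.ArchTransferFactor L H} (h : 𝔨.IsPinned ν Tinf νH νG νGi νqi νHi) :
    𝔨.PinTransferIff :=
  h.2.2.2.2.2.2.2.2.2.2.2.2.2.2.2.2.2.2.2.2.2.2.2.2.2.2.2.2.2.2.2.2.2.2.2.1

/-- **(ed. 1.24b) pin `PinTransferHIff` BY NAME** (conjunct 37 of 39 of `IsPinned`): the text is `ComparisonKit.PinTransferHIff` in the main workfile (appended in ed. 1.24b; RULING #119 (3), LEAD WORD #120 (b)). [cite: Rogawski1990, §14.3 pp. 233–234; §4.9 Prop. 4.9.1 p. 55] -/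
theorem IsPinned.transferH_iff_local [MeasurableSpace (GpAdelic L H)] [BorelSpace (GpAdelic L H)]
    {ν : Measure (GpAdelic L H)} [ν.IsHaarMeasure] [ν.IsInvInvariant] {Tinf : Literature.NumberTheory.Rogawski1990.ArchTransferFactor L H} (h : 𝔨.IsPinned ν Tinf νH νG νGi νqi νHi) :
    𝔨.PinTransferHIff Tinf :=
  h.2.2.2.2.2.2.2.2.2.2.2.2.2.2.2.2.2.2.2.2.2.2.2.2.2.2.2.2.2.2.2.2.2.2.2.2.1

/-- **(ed. 1.24b) pin `PinLocalUnitTransferOff` BY NAME** (conjunct 38 of 39 of `IsPinned`): the text is `ComparisonKit.PinLocalUnitTransferOff` in the main workfile (appended in ed. 1.24b; RULING #119 (3), LEAD WORD #120 (b)). [cite: Rogawski1990, §4.9 Prop. 4.9.1 (b) p. 55; §14.3 p. 233] -/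
theorem IsPinned.localUnitTransfer_off [MeasurableSpace (GpAdelic L H)] [BorelSpace (GpAdelic L H)]
    {ν : Measure (GpAdelic L H)} [ν.IsHaarMeasure] [ν.IsInvInvariant] {Tinf : Literature.NumberTheory.Rogawski1990.ArchTransferFactor L H} (h : 𝔨.IsPinned ν Tinf νH νG νGi νqi νHi) :
    𝔨.PinLocalUnitTransferOff :=
  h.2.2.2.2.2.2.2.2.2.2.2.2.2.2.2.2.2.2.2.2.2.2.2.2.2.2.2.2.2.2.2.2.2.2.2.2.2.1

/-- **(ed. 1.24b) pin `PinSingularFamilies` BY NAME** (conjunct 39 of 39 of `IsPinned`): the text is `ComparisonKit.PinSingularFamilies` in the main workfile (appended in ed. 1.24b; RULING #119 (3), LEAD WORD #120 (b)). [cite: Rogawski1990, §4.3 pp. 43–44; §14.2 (14.2.1) pp. 232–233; §14.5 p. 239] -/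
theorem IsPinned.singularFamilies [MeasurableSpace (GpAdelic L H)] [BorelSpace (GpAdelic L H)]
    {ν : Measure (GpAdelic L H)} [ν.IsHaarMeasure] [ν.IsInvInvariant] {Tinf : Literature.NumberTheory.Rogawski1990.ArchTransferFactor L H} (h : 𝔨.IsPinned ν Tinf νH νG νGi νqi νHi) :
    𝔨.PinSingularFamilies :=
  h.2.2.2.2.2.2.2.2.2.2.2.2.2.2.2.2.2.2.2.2.2.2.2.2.2.2.2.2.2.2.2.2.2.2.2.2.2.2

/-- **(G5) as an identity of pinned values, `G`-side** (ed. 1.20): `κ_G(𝒪) · (#{𝒪H ↦ 𝒪} + 1) = 1`, i.e. `κ_G(𝒪) |𝓡(𝒪)| = 1` once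
`|𝓡(𝒪)| = #{𝒪H ↦ 𝒪} + 1` (★ `natCard_add_one_eq_two_pow_of_mem_iff`). [cite: Rogawski1990, §5.4 (5.4.5) pp. 72–73] -/
theorem IsPinned.kappaG_mul_card_add_one [MeasurableSpace (GpAdelic L H)] [BorelSpace (GpAdelic L H)]
    {ν : Measure (GpAdelic L H)} [ν.IsHaarMeasure] [ν.IsInvInvariant] {Tinf : Literature.NumberTheory.Rogawski1990.ArchTransferFactor L H} (h : 𝔨.IsPinned ν Tinf νH νG νGi νqi νHi)
    (𝒪 : 𝔨.StClass) : 𝔨.κG 𝒪 * ((Nat.card {𝒪H : 𝔨.StClassH // 𝔨.transfersTo 𝒪H 𝒪} + 1 : ℕ) : ℝ) = 1 := by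
  rw [(IsPinned.kappaValues 𝔨 h).1 𝒪]
  exact inv_mul_cancel₀ (by positivity)

/-- **(G5) as an identity of pinned values, `H`-side** (ed. 1.20): `½ κ_H(𝒪H) = α(𝒪) κ_G(𝒪)` whenever `𝒪H ↦ 𝒪` — the T1b constant bookkeeping
(`α|𝓡|⁻¹ · Φ^{st,𝐀}_H = ½ SJ_H`). [cite: Rogawski1990, §5.4 (5.4.3) p. 72; Thm. 14.5.1 (a) p. 238] -/
theorem IsPinned.half_kappaH_eq [MeasurableSpace (GpAdelic L H)] [BorelSpace (GpAdelic L H)]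
    {ν : Measure (GpAdelic L H)} [ν.IsHaarMeasure] [ν.IsInvInvariant] {Tinf : Literature.NumberTheory.Rogawski1990.ArchTransferFactor L H} (h : 𝔨.IsPinned ν Tinf νH νG νGi νqi νHi)
    {𝒪H : 𝔨.StClassH} {𝒪 : 𝔨.StClass} (h𝒪 : 𝔨.transfersTo 𝒪H 𝒪) : (1 / 2 : ℝ) * 𝔨.κH 𝒪H = 𝔨.α 𝒪 * 𝔨.κG 𝒪 := by
  rw [(IsPinned.kappaValues 𝔨 h).2 𝒪H 𝒪 h𝒪, (IsPinned.kappaValues 𝔨 h).1 𝒪]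
  ring

/-- **Finiteness of `{𝒪H | transfersTo 𝒪H 𝒪}` for every pinned kit** (ed. 1.19c₁; pin (xiii-c) + ★ `StableClassH.finite_subtype_transfersTo_antidiagOne`) — the
★ StableSide input `hfin` BY NAME. [cite: Rogawski1990, §4.6 p. 49; Thm. 14.5.1 (a) p. 238] -/
theorem IsPinned.finite_transfersTo [MeasurableSpace (GpAdelic L H)] [BorelSpace (GpAdelic L H)]
    {ν : Measure (GpAdelic L H)} [ν.IsHaarMeasure] [ν.IsInvInvariant] {Tinf : Literature.NumberTheory.Rogawski1990.ArchTransferFactor L H} (h : 𝔨.IsPinned ν Tinf νH νG νGi νqi νHi)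
    (𝒪 : 𝔨.StClass) : {𝒪H : 𝔨.StClassH | 𝔨.transfersTo 𝒪H 𝒪}.Finite :=
  𝔨.finite_transfersTo_of_pin 𝔨.eStH h.2.2.2.2.2.2.2.2.2.2.2.2.2.2.2.2.1 𝒪

/-- **(14.2.1) AT EVERY FINITE PLACE, CERTIFIED for any pinned kit** (ed. 1.17 (D), by ★ F0P3a-p01 (h)
`Rogawski1990.exists_measures_isLocalInnerTransfer`): pins (ix)+(x) make `f_v = f′_v ∘ ψ_v⁻¹` with `ψ_v` class-preserving in both directions, so there are
orbital measure families `m′_v` on `G′_v` (admissible on the regular classes, ★ `exists_isAdmissibleOn_isRegularElt_of_three_le`) and `m_v := (ψ_v)_* m′_v` on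
`U(Φ₃)(L⁺_v)` under which `Transfer f′ f` forces the LOCAL INNER TRANSFER IDENTITY (14.2.1) `IsLocalInnerTransfer L H v (m′ v) (m v) f′_v f_v` at EVERY finite
`v` (for anisotropic hermitian `H`: `det H ≠ 0` by ★ `Godement.det_ne_zero_of_anisotropic`). [cite: Rogawski1990, §14.2 (14.2.1) p. 232] [cite: Gelbart1975, §10 pp. 154–155] -/
theorem IsPinned.exists_measures_isLocalInnerTransfer [MeasurableSpace (GpAdelic L H)] [BorelSpace (GpAdelic L H)]
    {ν : Measure (GpAdelic L H)} [ν.IsHaarMeasure] [ν.IsInvInvariant] {Tinf : Literature.NumberTheory.Rogawski1990.ArchTransferFactor L H} (h : 𝔨.IsPinned ν Tinf νH νG νGi νqi νHi)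
    (hanis : IsAnisotropic L H) (hherm : IsHermitianCM L H) :
    letI : ∀ (v : HeightOneSpectrum (𝓞 ↥(maximalRealSubfield L))) (γ : (UnitaryGroup.cmDatum L 3 H).Local v),
        MeasurableSpace ((UnitaryGroup.cmDatum L 3 H).Local v ⧸ Subgroup.centralizer ({γ} : Set ((UnitaryGroup.cmDatum L 3 H).Local v))) := fun _ _ => borel _
    letI : ∀ (v : HeightOneSpectrum (𝓞 ↥(maximalRealSubfield L))) (γ : (UnitaryGroup.cmDatum L 3 (Matrix.of fun i j : Fin 3 => if i.val + j.val + 1 = 3 then (1 : L) else 0)).Local v),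
        MeasurableSpace ((UnitaryGroup.cmDatum L 3 (Matrix.of fun i j : Fin 3 => if i.val + j.val + 1 = 3 then (1 : L) else 0)).Local v ⧸
          Subgroup.centralizer ({γ} : Set ((UnitaryGroup.cmDatum L 3 (Matrix.of fun i j : Fin 3 => if i.val + j.val + 1 = 3 then (1 : L) else 0)).Local v))) := fun _ _ => borel _
    ∃ (m' : ∀ v, OrbitalMeasureFamily ((UnitaryGroup.cmDatum L 3 H).Local v))
      (m : ∀ v, OrbitalMeasureFamily ((UnitaryGroup.cmDatum L 3 (Matrix.of fun i j : Fin 3 => if i.val + j.val + 1 = 3 then (1 : L) else 0)).Local v)),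
      (∀ v, (m' v).IsAdmissibleOn fun γ => Literature.NumberTheory.Rogawski1990.IsRegularElt (γ.val : GL (Fin 3) (UnitaryGroup.LocalRing L v))) ∧
      (∀ v, (m v).IsAdmissibleOn fun γ => Literature.NumberTheory.Rogawski1990.IsRegularElt (γ.val : GL (Fin 3) (UnitaryGroup.LocalRing L v))) ∧
      ∀ (f' : TestGp L H) (f : TestG L), 𝔨.Transfer f' f →
        ∃ (T : UnitaryGroup.PureTensor L 3 H) (T' : UnitaryGroup.PureTensor L 3 (splitForm L 3)),
          ⇑f' = T.eval ∧ ⇑f = T'.eval ∧ ∀ v, Literature.NumberTheory.Rogawski1990.IsLocalInnerTransfer L H v (m' v) (m v) (T.loc v) (T'.loc v) := by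
  letI : ∀ (v : HeightOneSpectrum (𝓞 ↥(maximalRealSubfield L))) (γ : (UnitaryGroup.cmDatum L 3 H).Local v),
      MeasurableSpace ((UnitaryGroup.cmDatum L 3 H).Local v ⧸ Subgroup.centralizer ({γ} : Set ((UnitaryGroup.cmDatum L 3 H).Local v))) := fun _ _ => borel _
  letI : ∀ (v : HeightOneSpectrum (𝓞 ↥(maximalRealSubfield L))) (γ : (UnitaryGroup.cmDatum L 3 (Matrix.of fun i j : Fin 3 => if i.val + j.val + 1 = 3 then (1 : L) else 0)).Local v),
      MeasurableSpace ((UnitaryGroup.cmDatum L 3 (Matrix.of fun i j : Fin 3 => if i.val + j.val + 1 = 3 then (1 : L) else 0)).Local v ⧸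
        Subgroup.centralizer ({γ} : Set ((UnitaryGroup.cmDatum L 3 (Matrix.of fun i j : Fin 3 => if i.val + j.val + 1 = 3 then (1 : L) else 0)).Local v))) := fun _ _ => borel _
  haveI : ∀ (v : HeightOneSpectrum (𝓞 ↥(maximalRealSubfield L))) (γ : (UnitaryGroup.cmDatum L 3 H).Local v),
      BorelSpace ((UnitaryGroup.cmDatum L 3 H).Local v ⧸ Subgroup.centralizer ({γ} : Set ((UnitaryGroup.cmDatum L 3 H).Local v))) := fun _ _ => ⟨rfl⟩
  -- (ed. 1.19a) the Borel structure of the local groups `G′_v` is the section's instance binder (★ (h) takes it as such)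
  haveI : ∀ (v : HeightOneSpectrum (𝓞 ↥(maximalRealSubfield L))) (γ : (UnitaryGroup.cmDatum L 3 (Matrix.of fun i j : Fin 3 => if i.val + j.val + 1 = 3 then (1 : L) else 0)).Local v),
      BorelSpace ((UnitaryGroup.cmDatum L 3 (Matrix.of fun i j : Fin 3 => if i.val + j.val + 1 = 3 then (1 : L) else 0)).Local v ⧸
        Subgroup.centralizer ({γ} : Set ((UnitaryGroup.cmDatum L 3 (Matrix.of fun i j : Fin 3 => if i.val + j.val + 1 = 3 then (1 : L) else 0)).Local v))) := fun _ _ => ⟨rfl⟩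
  obtain ⟨m', m, hm', hm, htr⟩ := Literature.NumberTheory.Rogawski1990.exists_measures_isLocalInnerTransfer L H hherm
    (Literature.NumberTheory.Automorphic.Godement.det_ne_zero_of_anisotropic L H hanis) 𝔨.ψ (IsPinned.corresponds 𝔨 h)
    (IsPinned.corresponds_symm 𝔨 h)
  refine ⟨m', m, hm', hm, fun f' f hf => ?_⟩
  obtain ⟨T, T', h₁, h₂, h₃⟩ := IsPinned.transfer_loc 𝔨 h hf
  exact ⟨T, T', h₁, h₂, htr T T' h₃⟩

/-- **(xii-d) THE EULER FACTORISATION OF `Φ^{st,𝐀}_G` AT THE KIT'S TRANSPORT FAMILY, for any pinned kit** (★ E3t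
`MatchingAdeleG.exists_isEulerOnClasses_transport`): for `γ₀ ∈ G′(L⁺)` regular corresponding to `γ ∈ G(L⁺)` and a pure test tensor `T` on `G(𝔸)`,
`Φ^{st,𝐀}_G(γ₀; ofLocalAdelic m m_∞; ⊗ T_v) = Φ^{st}_∞ · ∏_{v ∈ S} Φ^{st}_v` for every finite `S ⊇ S₁` — the transported families `m_v = (ψ_v)_* m^{G′}_v` (D1) being
canonical for the transported Haar measures (pins (x), (xi‴); ★ `transport_isAdmissibleOn_isRegularElt_of_eq`), level-matched off `S₀` (pin (vi)), `m_∞` admissible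
(pin (ix′)).  Hypotheses beyond the pins: `νG_v` Haar (`hνG`, a plain hypothesis) with `νG_v(K′_v) = 1` (the head's guard `hK`).
[cite: Rogawski1990, §4.3 pp. 43–44; §5.4 (5.4.3) pp. 72–73; §14.2 (14.2.1) p. 232] [cite: Kottwitz1986, Prop. 7.1] -/
theorem IsPinned.sjG_isEulerOnClasses [MeasurableSpace (GpAdelic L H)] [BorelSpace (GpAdelic L H)]
    {ν : Measure (GpAdelic L H)} [ν.IsHaarMeasure] [ν.IsInvInvariant] {Tinf : Literature.NumberTheory.Rogawski1990.ArchTransferFactor L H} (h : 𝔨.IsPinned ν Tinf νH νG νGi νqi νHi)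
    (hνG : ∀ v, (νG v).IsHaarMeasure) (hK : ∀ v, νG v (UnitaryGroup.cmLocalIntegralLevel L 3 H v) = 1)
    {γ₀ : (UnitaryGroup.cmDatum L 3 H).Rational} (hreg : Literature.NumberTheory.Rogawski1990.IsRegularElt (γ₀.val : GL (Fin 3) L))
    {γ : (UnitaryGroup.cmDatum L 3 (splitForm L 3)).Rational} (hγ : Literature.NumberTheory.Rogawski1990.Corresponds (cmConjRingHom L) H (splitForm L 3) γ₀ γ)
    (T : UnitaryGroup.PureTensor L 3 (splitForm L 3)) (hT : T.IsTest) :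
    letI : ∀ g : GAdelic L, MeasurableSpace (GAdelic L ⧸ Subgroup.centralizer ({g} : Set (GAdelic L))) := fun _ => borel _
    letI : ∀ a : GInf L, MeasurableSpace (GInf L ⧸ Subgroup.centralizer ({a} : Set (GInf L))) := fun _ => borel _
    letI : ∀ (v : HeightOneSpectrum (𝓞 ↥(maximalRealSubfield L))) (x : (UnitaryGroup.cmDatum L 3 (splitForm L 3)).Local v),
        MeasurableSpace ((UnitaryGroup.cmDatum L 3 (splitForm L 3)).Local v ⧸ Subgroup.centralizer ({x} : Set ((UnitaryGroup.cmDatum L 3 (splitForm L 3)).Local v))) := fun _ _ => borel _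
    ∃ S₁ : Finset (HeightOneSpectrum (𝓞 ↥(maximalRealSubfield L))), ∀ S : Finset (HeightOneSpectrum (𝓞 ↥(maximalRealSubfield L))), S₁ ⊆ S →
      Literature.NumberTheory.Rogawski1990.IsEulerOnClasses (Literature.NumberTheory.Rogawski1990.MatchingAdeleG.classes L H γ₀)
        (UnitaryGroup.OrbitalMeasureFamily.ofLocalAdelic L 3 (splitForm L 3) 𝔨.mq 𝔨.mqi) T.eval S
        (fun v => Literature.NumberTheory.Rogawski1990.localStableOrbitalIntegral L 3 (splitForm L 3) v (𝔨.mq v) (T.loc v)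
          ((UnitaryGroup.cmDatum L 3 (splitForm L 3)).toLocal v ((UnitaryGroup.cmDatum L 3 (splitForm L 3)).toAdelic γ)))
        (Literature.NumberTheory.Rogawski1990.archStableOrbitalIntegral L 3 (splitForm L 3) 𝔨.mqi T.arch
          (Literature.NumberTheory.Rogawski1990.cmRationalToArch L 3 (splitForm L 3) γ)) := by
  letI : ∀ g : GAdelic L, MeasurableSpace (GAdelic L ⧸ Subgroup.centralizer ({g} : Set (GAdelic L))) := fun _ => borel _
  haveI : ∀ g : GAdelic L, BorelSpace (GAdelic L ⧸ Subgroup.centralizer ({g} : Set (GAdelic L))) := fun _ => ⟨rfl⟩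
  letI : ∀ a : GInf L, MeasurableSpace (GInf L ⧸ Subgroup.centralizer ({a} : Set (GInf L))) := fun _ => borel _
  haveI : ∀ a : GInf L, BorelSpace (GInf L ⧸ Subgroup.centralizer ({a} : Set (GInf L))) := fun _ => ⟨rfl⟩
  letI : ∀ v : HeightOneSpectrum (𝓞 ↥(maximalRealSubfield L)), MeasurableSpace ((UnitaryGroup.cmDatum L 3 (splitForm L 3)).Local v) := fun _ => borel _
  haveI : ∀ v : HeightOneSpectrum (𝓞 ↥(maximalRealSubfield L)), BorelSpace ((UnitaryGroup.cmDatum L 3 (splitForm L 3)).Local v) := fun _ => ⟨rfl⟩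
  letI : ∀ (v : HeightOneSpectrum (𝓞 ↥(maximalRealSubfield L))) (x : (UnitaryGroup.cmDatum L 3 (splitForm L 3)).Local v),
      MeasurableSpace ((UnitaryGroup.cmDatum L 3 (splitForm L 3)).Local v ⧸ Subgroup.centralizer ({x} : Set ((UnitaryGroup.cmDatum L 3 (splitForm L 3)).Local v))) := fun _ _ => borel _
  haveI : ∀ (v : HeightOneSpectrum (𝓞 ↥(maximalRealSubfield L))) (x : (UnitaryGroup.cmDatum L 3 (splitForm L 3)).Local v),
      BorelSpace ((UnitaryGroup.cmDatum L 3 (splitForm L 3)).Local v ⧸ Subgroup.centralizer ({x} : Set ((UnitaryGroup.cmDatum L 3 (splitForm L 3)).Local v))) := fun _ _ => ⟨rfl⟩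
  letI : ∀ (v : HeightOneSpectrum (𝓞 ↥(maximalRealSubfield L))) (x : (UnitaryGroup.cmDatum L 3 H).Local v),
      MeasurableSpace ((UnitaryGroup.cmDatum L 3 H).Local v ⧸ Subgroup.centralizer ({x} : Set ((UnitaryGroup.cmDatum L 3 H).Local v))) := fun _ _ => borel _
  haveI : ∀ (v : HeightOneSpectrum (𝓞 ↥(maximalRealSubfield L))) (x : (UnitaryGroup.cmDatum L 3 H).Local v),
      BorelSpace ((UnitaryGroup.cmDatum L 3 H).Local v ⧸ Subgroup.centralizer ({x} : Set ((UnitaryGroup.cmDatum L 3 H).Local v))) := fun _ _ => ⟨rfl⟩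
  haveI : ∀ v, (νG v).IsHaarMeasure := hνG
  obtain ⟨S₀, hψK, -, -⟩ := h.2.2.2.2.2.1
  obtain ⟨νq, hνq, hKq⟩ := UnitaryGroup.exists_isHaarMeasure_family_cmLocalIntegralLevel_eq_one L 3 (splitForm L 3)
  haveI : ∀ v, (νq v).IsHaarMeasure := hνq
  haveI : ∀ v, (νq v).IsMulRightInvariant := fun v => UnitaryGroup.isMulRightInvariant_cmDatum_local_antidiagOne L 3 v (νq v)
  exact Literature.NumberTheory.Rogawski1990.MatchingAdeleG.exists_isEulerOnClasses_transport 𝔨.mG 𝔨.ψ (IsPinned.corresponds_symm 𝔨 h) S₀ hψK νG νq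
    hK hKq (fun v => ((IsPinned.canonical 𝔨 h) v).2) 𝔨.mqi (IsPinned.transfer_arch 𝔨 h).2.1 hreg hγ T hT

/-- **(xiii-d) THE EULER FACTORISATION OF `Φ^{st,𝐀}_H` AT THE KIT'S FAMILIES, for every pinned kit** (★ E3c-H
`MatchingAdeleH.exists_isEulerOnClasses_ofLocalAdelicPair_of_isCanonical'`, F0P3a-p02): for a `G`-regular rational `γ_H ∈ H(L⁺)` and an unramified pure tensor
`T^H` with compactly supported continuous bad ∕ archimedean factors there is a finite `S₁` such that for every finite `S ⊇ S₁` the sum of the orbital integrals of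
`T^H.eval` over the adelic classes `𝒞′_𝐀(γ_H)` against ★ C3-H `ofLocalAdelicPair 𝔨.mH 𝔨.mHi` IS `Φ^{st}_{H,∞}(γ_H; f^H_∞) · ∏_{v ∈ S} Φ^{st}_{H,v}(γ_{H,v}; f^H_v)` at
the kit's OWN families (the currency of ★ `IsLocalDeltaTransfer` ∕ ★ `IsArchDeltaTransfer`).  Inputs: pins (xi″) (`IsPinned.deltaTransfer`) and (xi‴)
(`IsPinned.canonical`); beyond the pins: `νH_v` Haar (`hνH`, a plain hypothesis) with `νH_v(K_{2,v} × K_{1,v}) = 1` (the head's guard `hKH`; it IS ★ E3c-H's `hν`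
by `rfl`).  With (xiii″) this makes `SJ_H(𝒪′_st, T^H.eval)` an Euler product class by class — what [Rogawski1990] Prop. 14.6.2's proof invokes silently.
[cite: Rogawski1990, §4.3 pp. 43–44; §5.4 (5.4.3) pp. 72–73] [cite: Kottwitz1986, Prop. 7.1, Cor. 7.3] -/
theorem IsPinned.sjH_isEulerOnClasses [MeasurableSpace (GpAdelic L H)] [BorelSpace (GpAdelic L H)]
    {ν : Measure (GpAdelic L H)} [ν.IsHaarMeasure] [ν.IsInvInvariant] {Tinf : Literature.NumberTheory.Rogawski1990.ArchTransferFactor L H} (h : 𝔨.IsPinned ν Tinf νH νG νGi νqi νHi)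
    (hνH : ∀ v, (νH v).IsHaarMeasure)
    (hKH : ∀ v : HeightOneSpectrum (𝓞 ↥(maximalRealSubfield L)),
      νH v (((UnitaryGroup.cmLocalIntegralLevel L 2 (Matrix.of fun i j : Fin 2 => if i.val + j.val + 1 = 2 then (1 : L) else 0) v).prod
          (UnitaryGroup.cmLocalIntegralLevel L 1 (Matrix.of fun i j : Fin 1 => if i.val + j.val + 1 = 1 then (1 : L) else 0) v) :
            Subgroup (HLocal L v)) : Set (HLocal L v)) = 1)
    {γH : (UnitaryGroup.cmDatum L 2 (splitForm L 2)).Rational × (UnitaryGroup.cmDatum L 1 (splitForm L 1)).Rational}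
    (hreg : Literature.NumberTheory.Rogawski1990.IsGRegular (cmConjRingHom L) (splitForm L 2) (splitForm L 1) (splitForm L 3)
      Literature.NumberTheory.Rogawski1990.endoForm_antidiagOne γH)
    (TH : UnitaryGroup.PureTensor₂ L (splitForm L 2) (splitForm L 1)) (hTH : TH.IsUnramified₂)
    (hTc : ∀ v ∈ TH.S, HasCompactSupport (TH.loc v)) (hTa : HasCompactSupport TH.arch)
    (hTc' : ∀ v ∈ TH.S, Continuous (TH.loc v)) (hTa' : Continuous TH.arch) :
    letI : ∀ h : HAdelic L, MeasurableSpace (HAdelic L ⧸ Subgroup.centralizer ({h} : Set (HAdelic L))) := fun _ => borel _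
    letI : ∀ a : HInf L, MeasurableSpace (HInf L ⧸ Subgroup.centralizer ({a} : Set (HInf L))) := fun _ => borel _
    letI : ∀ (v : HeightOneSpectrum (𝓞 ↥(maximalRealSubfield L))) (a : HLocal L v),
        MeasurableSpace (HLocal L v ⧸ Subgroup.centralizer ({a} : Set (HLocal L v))) := fun _ _ => borel _
    ∃ S₁ : Finset (HeightOneSpectrum (𝓞 ↥(maximalRealSubfield L))), ∀ S : Finset (HeightOneSpectrum (𝓞 ↥(maximalRealSubfield L))), S₁ ⊆ S →
      Literature.NumberTheory.Rogawski1990.IsEulerOnClasses (Literature.NumberTheory.Rogawski1990.adelicStableClassesOverH L γH)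
        (UnitaryGroup.OrbitalMeasureFamily.ofLocalAdelicPair L (splitForm L 2) (splitForm L 1) 𝔨.mH 𝔨.mHi) TH.eval S
        (fun v => Literature.NumberTheory.Rogawski1990.stableOrbitalIntegralRel (G := HLocal L v)
          (Literature.NumberTheory.Rogawski1990.IsLocalStablyConjH L v) (𝔨.mH v) (TH.loc v)
          (Literature.NumberTheory.Rogawski1990.rationalComponent L γH v))
        (Literature.NumberTheory.Rogawski1990.stableOrbitalIntegralRel (G := HInf L)
          (Literature.NumberTheory.Rogawski1990.IsArchStablyConjH L) 𝔨.mHi TH.arch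
          (Literature.NumberTheory.Rogawski1990.rationalArch L γH)) := by
  letI : ∀ h : HAdelic L, MeasurableSpace (HAdelic L ⧸ Subgroup.centralizer ({h} : Set (HAdelic L))) := fun _ => borel _
  haveI : ∀ h : HAdelic L, BorelSpace (HAdelic L ⧸ Subgroup.centralizer ({h} : Set (HAdelic L))) := fun _ => ⟨rfl⟩
  letI : ∀ a : HInf L, MeasurableSpace (HInf L ⧸ Subgroup.centralizer ({a} : Set (HInf L))) := fun _ => borel _
  haveI : ∀ a : HInf L, BorelSpace (HInf L ⧸ Subgroup.centralizer ({a} : Set (HInf L))) := fun _ => ⟨rfl⟩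
  letI : ∀ (v : HeightOneSpectrum (𝓞 ↥(maximalRealSubfield L))) (a : HLocal L v),
      MeasurableSpace (HLocal L v ⧸ Subgroup.centralizer ({a} : Set (HLocal L v))) := fun _ _ => borel _
  haveI : ∀ (v : HeightOneSpectrum (𝓞 ↥(maximalRealSubfield L))) (a : HLocal L v),
      BorelSpace (HLocal L v ⧸ Subgroup.centralizer ({a} : Set (HLocal L v))) := fun _ _ => ⟨rfl⟩
  haveI : ∀ v, (νH v).IsHaarMeasure := hνH
  exact Literature.NumberTheory.Rogawski1990.MatchingAdeleH.exists_isEulerOnClasses_ofLocalAdelicPair_of_isCanonical' νH hKH hreg 𝔨.mH 𝔨.mHi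
    (fun v => ((IsPinned.deltaTransfer 𝔨 h).1 v).2.1) (fun v => ((IsPinned.canonical 𝔨 h) v).1) (IsPinned.deltaTransfer 𝔨 h).2.2.2.1
    TH hTH hTc hTa hTc' hTa'

/-- **«Smooth» is NON-EMPTY for every pinned kit** (ed. 1.11, by name): pin (iv) makes `Smooth` the pure smooth tensors, and ★
`UnitaryGroup.exists_compactlySupported_isTest_ne_zero` (F0P3a-p04 B14: an archimedean `C_c^∞` bump times `⊗_v 1_{U(H)(𝒪_v)}`) is a non-zero
one — so the universally quantified heads `TransferExistence` ∕ `InnerFormStableTraceIdentityNonvacuous` do not hold for want of test functions.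
[cite: Rogawski1990, §14.2 p. 233] [cite: BorelJacquet1979, §4.1] -/
theorem smooth_nonempty_of_isPinned [MeasurableSpace (GpAdelic L H)] [BorelSpace (GpAdelic L H)]
    {ν : Measure (GpAdelic L H)} [ν.IsHaarMeasure] [ν.IsInvInvariant] {Tinf : Literature.NumberTheory.Rogawski1990.ArchTransferFactor L H} (h : 𝔨.IsPinned ν Tinf νH νG νGi νqi νHi) :
    ∃ f' : TestGp L H, 𝔨.Smooth f' ∧ f' ≠ 0 := by
  obtain ⟨f', hT, -, hne⟩ := UnitaryGroup.exists_compactlySupported_isTest_ne_zero L 3 H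
  exact ⟨f', (h.2.2.2.1 f').mpr hT, hne⟩

/-- **MULTIPLICITY IN THE TRACE, for every pinned kit** ([Rogawski1990, §14.5 p. 237]: «`T_{G′}(f′) = Σ_{π′} m(π′) tr π′(f′)`», polarised, Gelbart
(1975) (10.14)): for anisotropic `H`, `F′ = g ⋆ h^*`, an orthogonal family `S` of closed irreducible subrepresentations of `L²(G′(F)\G′(𝔸), μ)` with dense
span, member Hilbert bases `b`, a map `q` classifying unitary equivalence on `S` with representatives `rep`: `θ_{G′}(F′) = Σ_{c} m(rep c) · Σ_k ⟪R(h)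
e^{rep c}_k, R(g) e^{rep c}_k⟫` (`HasSum`), with the KIT's `mult` as the coefficient (pins (ii), (v)).  By ★ `UnitaryGroup.diagTrace_hasSum_multiplicity_mul_tsum_inner`
(F0P3a-p01 B19); a DERIVED theorem — it constrains nothing new. [cite: Rogawski1990, §14.5 p. 237] [cite: Gelbart1975, (10.14)] [cite: DeitmarEchterhoff2014, Thm. 9.2.2] -/
theorem traceGp_hasSum_mult_mul_tsum_inner_of_isPinned [MeasurableSpace (GpAdelic L H)] [BorelSpace (GpAdelic L H)]
    {ν : Measure (GpAdelic L H)} [ν.IsHaarMeasure] [ν.IsInvInvariant] {Tinf : Literature.NumberTheory.Rogawski1990.ArchTransferFactor L H} (hpin : 𝔨.IsPinned ν Tinf νH νG νGi νqi νHi) (hanis : IsAnisotropic L H)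
    (g h F' : TestGp L H) (hF' : ∀ x, F' x = mulConv ν (⇑g) (mulStar (⇑h)) x)
    {S : Set (ContRepresentation.ClosedSubrep ((UnitaryGroup.cmDatum L 3 H).rightRegular μ))}
    (hirr : ∀ W ∈ S, W.toContRep.IsTopIrreducible)
    (horth : S.Pairwise fun W W' => W.toSubmodule ⟂ W'.toSubmodule) (hdense : ContRepresentation.ClosedSubrep.iSupClosure S = ⊤)
    {κ : S → Type*} (b : ∀ W : S, HilbertBasis (κ W) ℂ (W : ContRepresentation.ClosedSubrep ((UnitaryGroup.cmDatum L 3 H).rightRegular μ)).toSubmodule)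
    {Λ : Type*} (q : S → Λ)
    (hq : ∀ W W' : S, q W = q W' ↔
      ContRepresentation.AreUnitarilyEquivalent (W : ContRepresentation.ClosedSubrep ((UnitaryGroup.cmDatum L 3 H).rightRegular μ)).toContRep
        (W' : ContRepresentation.ClosedSubrep ((UnitaryGroup.cmDatum L 3 H).rightRegular μ)).toContRep)
    (rep : Set.range q → S) (hrep : ∀ c, q (rep c) = c) :
    HasSum (fun c : Set.range q =>
      ((𝔨.mult ⟨(rep c : ContRepresentation.ClosedSubrep ((UnitaryGroup.cmDatum L 3 H).rightRegular μ)), hirr _ (rep c).2⟩ : ℕ) : ℂ) *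
        ∑' k, inner ℂ
          (((UnitaryGroup.cmDatum L 3 H).rightRegular μ).integratedOperator ((UnitaryGroup.cmDatum L 3 H).isUnitary_rightRegular μ)
            ((UnitaryGroup.cmDatum L 3 H).isStronglyContinuous_rightRegular_holds μ) ν h (b (rep c) k))
          (((UnitaryGroup.cmDatum L 3 H).rightRegular μ).integratedOperator ((UnitaryGroup.cmDatum L 3 H).isUnitary_rightRegular μ)
            ((UnitaryGroup.cmDatum L 3 H).isStronglyContinuous_rightRegular_holds μ) ν g (b (rep c) k)))
      (𝔨.traceGp F') := by
  have hmult : ∀ c : Set.range q,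
      (𝔨.mult ⟨(rep c : ContRepresentation.ClosedSubrep ((UnitaryGroup.cmDatum L 3 H).rightRegular μ)), hirr _ (rep c).2⟩ : ℕ) =
        (((UnitaryGroup.cmDatum L 3 H).rightRegular μ).multiplicity
          (rep c : ContRepresentation.ClosedSubrep ((UnitaryGroup.cmDatum L 3 H).rightRegular μ)).toContRep).toNat := by
    intro c
    have h2 := congrArg ENat.toNat (hpin.2.1 ⟨(rep c : ContRepresentation.ClosedSubrep ((UnitaryGroup.cmDatum L 3 H).rightRegular μ)),
      hirr _ (rep c).2⟩)
    simpa only [ENat.toNat_coe] using h2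
  rw [hpin.2.2.2.2.1 hanis]
  simp_rw [hmult]
  exact UnitaryGroup.diagTrace_hasSum_multiplicity_mul_tsum_inner L 3 H μ ν hanis g h F' hF' hirr horth hdense b q hq rep hrep

section T1bRegular

open Literature.NumberTheory.Rogawski1990 Filter Function
open scoped Matrix MatrixGroups BigOperators

/-! ### § T1b at the regular classes — (2) the H-side half (F0P3a-p08 (g5) `T1bHSideHalf` §2, rf ffd7e530) and (3) the kit-level closer at a REGULAR
class (F0P3a-p01 (g5) (D2) v5 7d38adf4), folded verbatim ed. 1.23; (4) the no-hypothesis form from pin (viii⁵). -/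

/-- **Pin (xiii″) at the CHOSEN representative of a tree class**, for every pinned kit: for `𝒪H ↦ 𝒪_st(γ₀)` with `γ₀` regular,
`SJ_H(eStH⁻¹ 𝒪H, f^H) = κ_H(eStH⁻¹ 𝒪H) · Φ^{st,𝐀}_H(𝒪H.out; ofLocalAdelicPair 𝔨.mH 𝔨.mHi; f^H)` — `𝒪H.out` represents `𝒪H` (★ `StableClassH.stableClassHOf_out`) and is
`G`-regular (★ `StableClassH.isNormPair_out_of_transfersTo` ∘ ★ `IsNormPair.isGRegular_of_isRegularElt`). [cite: Rogawski1990, Thm. 14.5.1 (a) p. 238; §5.4 (5.4.3) pp. 72–73; §4.3 p. 42] -/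
theorem IsPinned.sjH_symm_eq_of_transfersTo [MeasurableSpace (GpAdelic L H)] [BorelSpace (GpAdelic L H)]
    {ν : Measure (GpAdelic L H)} [ν.IsHaarMeasure] [ν.IsInvInvariant] {Tinf : Literature.NumberTheory.Rogawski1990.ArchTransferFactor L H} (h : 𝔨.IsPinned ν Tinf νH νG νGi νqi νHi)
    {γ₀ : (UnitaryGroup.cmDatum L 3 H).Rational} (hreg : Literature.NumberTheory.Rogawski1990.IsRegularElt (γ₀.val : GL (Fin 3) L))
    {𝒪H : Literature.NumberTheory.Rogawski1990.StableClassH (cmConjRingHom L) (splitForm L 2) (splitForm L 1)}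
    (h𝒪H : 𝒪H.TransfersTo H Literature.NumberTheory.Rogawski1990.endoForm_antidiagOne
      (Literature.NumberTheory.Rogawski1990.stableClassOf (cmConjRingHom L) H γ₀)) (fH : TestH L) :
    letI : ∀ h : HAdelic L, MeasurableSpace (HAdelic L ⧸ Subgroup.centralizer ({h} : Set (HAdelic L))) := fun _ => borel _
    letI : ∀ a : HInf L, MeasurableSpace (HInf L ⧸ Subgroup.centralizer ({a} : Set (HInf L))) := fun _ => borel _
    letI : ∀ (v : HeightOneSpectrum (𝓞 ↥(maximalRealSubfield L))) (a : HLocal L v),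
        MeasurableSpace (HLocal L v ⧸ Subgroup.centralizer ({a} : Set (HLocal L v))) := fun _ _ => borel _
    𝔨.SJH (𝔨.eStH.symm 𝒪H) fH = ((𝔨.κH (𝔨.eStH.symm 𝒪H) : ℝ) : ℂ) *
      Literature.NumberTheory.Rogawski1990.adelicStableOrbitalIntegralH L (Quotient.out 𝒪H)
        (UnitaryGroup.OrbitalMeasureFamily.ofLocalAdelicPair L (splitForm L 2) (splitForm L 1) 𝔨.mH 𝔨.mHi) ⇑fH := by
  -- `IsPinned.sjH_eq 𝔨 h` (API): pin (xiii″) is the 19th conjunct of `IsPinned`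
  have hpin : 𝔨.PinSJH 𝔨.eStH 𝔨.κH := h.2.2.2.2.2.2.2.2.2.2.2.2.2.2.2.2.2.2.1
  unfold PinSJH at hpin
  exact hpin (𝔨.eStH.symm 𝒪H) (Quotient.out 𝒪H)
    (by rw [Equiv.apply_symm_apply]; exact (Literature.NumberTheory.Rogawski1990.StableClassH.stableClassHOf_out 𝒪H).symm)
    ((Literature.NumberTheory.Rogawski1990.StableClassH.isNormPair_out_of_transfersTo h𝒪H).isGRegular_of_isRegularElt hreg) fH

/-- **THE T1b CLOSER's `H`-SIDE HALF AT A REGULAR CLASS, for every pinned kit**: for `𝒪` with `𝔨.eSt 𝒪 = 𝒪_st(γ₀)`, `γ₀` regular, and every `f^H`,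
`½ · SJHover(𝒪, f^H) = α(𝒪) κ_G(𝒪) · Σᶠ_{𝒪H ↦ 𝒪_st(γ₀)} Φ^{st,𝐀}_H(𝒪H.out; ofLocalAdelicPair 𝔨.mH 𝔨.mHi; f^H)` — the right-hand `finsum` being VERBATIM the
`H`-side term of ★ O11-1d `…_stabilised{,₂}`.  Pins used: (xiii-c) `transfersTo_iff`, (xiii″) `sjH_eq`, (κ-v) `half_kappaH_eq`.
[cite: Rogawski1990, Thm. 14.5.1 (a) p. 238; §5.4 (5.4.3)–(5.4.5) pp. 72–74] -/
theorem IsPinned.half_mul_sjHover_eq_of_isRegularElt [MeasurableSpace (GpAdelic L H)] [BorelSpace (GpAdelic L H)]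
    {ν : Measure (GpAdelic L H)} [ν.IsHaarMeasure] [ν.IsInvInvariant] {Tinf : Literature.NumberTheory.Rogawski1990.ArchTransferFactor L H} (h : 𝔨.IsPinned ν Tinf νH νG νGi νqi νHi)
    (𝒪 : 𝔨.StClass) {γ₀ : (UnitaryGroup.cmDatum L 3 H).Rational}
    (h𝒪 : 𝔨.eSt 𝒪 = Literature.NumberTheory.Rogawski1990.stableClassOf (cmConjRingHom L) H γ₀)
    (hreg : Literature.NumberTheory.Rogawski1990.IsRegularElt (γ₀.val : GL (Fin 3) L)) (fH : TestH L) :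
    letI : ∀ h : HAdelic L, MeasurableSpace (HAdelic L ⧸ Subgroup.centralizer ({h} : Set (HAdelic L))) := fun _ => borel _
    letI : ∀ a : HInf L, MeasurableSpace (HInf L ⧸ Subgroup.centralizer ({a} : Set (HInf L))) := fun _ => borel _
    letI : ∀ (v : HeightOneSpectrum (𝓞 ↥(maximalRealSubfield L))) (a : HLocal L v),
        MeasurableSpace (HLocal L v ⧸ Subgroup.centralizer ({a} : Set (HLocal L v))) := fun _ _ => borel _
    (1 / 2 : ℂ) * 𝔨.SJHover 𝒪 fH = ((𝔨.α 𝒪 * 𝔨.κG 𝒪 : ℝ) : ℂ) *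
      ∑ᶠ i : {𝒪H : Literature.NumberTheory.Rogawski1990.StableClassH (cmConjRingHom L) (splitForm L 2) (splitForm L 1) //
          𝒪H.TransfersTo H Literature.NumberTheory.Rogawski1990.endoForm_antidiagOne
            (Literature.NumberTheory.Rogawski1990.stableClassOf (cmConjRingHom L) H γ₀)},
        Literature.NumberTheory.Rogawski1990.adelicStableOrbitalIntegralH L (Quotient.out i.1)
          (UnitaryGroup.OrbitalMeasureFamily.ofLocalAdelicPair L (splitForm L 2) (splitForm L 1) 𝔨.mH 𝔨.mHi) ⇑fH := by
  -- `IsPinned.transfersTo_iff 𝔨 h` (API): pin (xiii-c) is the 17th conjunct; `IsPinned.kappaValues 𝔨 h` (API): pin (κ-v) is the 21st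
  have hT : 𝔨.PinTransfersTo 𝔨.eStH := h.2.2.2.2.2.2.2.2.2.2.2.2.2.2.2.2.1
  have hκv : 𝔨.PinKappaValues 𝔨.κG 𝔨.κH := h.2.2.2.2.2.2.2.2.2.2.2.2.2.2.2.2.2.2.2.2.1
  rw [𝔨.sjHover_eq_finsum_of_pinTransfersTo 𝔨.eStH hT 𝒪 h𝒪 fH, mul_finsum, mul_finsum]
  refine finsum_congr fun i => ?_
  rw [IsPinned.sjH_symm_eq_of_transfersTo 𝔨 h hreg i.2 fH, ← mul_assoc]
  congr 1
  -- `IsPinned.half_kappaH_eq` (API): `½ κ_H(𝒪H) = α(𝒪) κ_G(𝒪)` for `𝒪H ↦ 𝒪`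
  rw [hκv.2 _ 𝒪 (𝔨.transfersTo_symm_of_pinTransfersTo 𝔨.eStH hT 𝒪 h𝒪 i.2), hκv.1 𝒪]
  push_cast
  ring

/-- **The same with print's constant `(#{𝒪H ↦ 𝒪_st(γ₀)} + 1)⁻¹` in place of `κ_G(𝒪)`** (pin (κ-v) `kappaValues`.1, the tree count re-indexed along `eStH`):
`½ · SJHover(𝒪, f^H) = α(𝒪) · (#{𝒪H ↦ 𝒪_st(γ₀)} + 1)⁻¹ · Σᶠ_{𝒪H ↦ 𝒪_st(γ₀)} Φ^{st,𝐀}_H(𝒪H.out; …; f^H)` — the shape of ★ O11-1d's right-hand side with `r = α(𝒪)`.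
[cite: Rogawski1990, Thm. 14.5.1 (a) p. 238; §5.4 (5.4.5) pp. 72–74] -/
theorem IsPinned.half_mul_sjHover_eq_mul_inv_natCard_add_one_mul [MeasurableSpace (GpAdelic L H)] [BorelSpace (GpAdelic L H)]
    {ν : Measure (GpAdelic L H)} [ν.IsHaarMeasure] [ν.IsInvInvariant] {Tinf : Literature.NumberTheory.Rogawski1990.ArchTransferFactor L H} (h : 𝔨.IsPinned ν Tinf νH νG νGi νqi νHi)
    (𝒪 : 𝔨.StClass) {γ₀ : (UnitaryGroup.cmDatum L 3 H).Rational}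
    (h𝒪 : 𝔨.eSt 𝒪 = Literature.NumberTheory.Rogawski1990.stableClassOf (cmConjRingHom L) H γ₀)
    (hreg : Literature.NumberTheory.Rogawski1990.IsRegularElt (γ₀.val : GL (Fin 3) L)) (fH : TestH L) :
    letI : ∀ h : HAdelic L, MeasurableSpace (HAdelic L ⧸ Subgroup.centralizer ({h} : Set (HAdelic L))) := fun _ => borel _
    letI : ∀ a : HInf L, MeasurableSpace (HInf L ⧸ Subgroup.centralizer ({a} : Set (HInf L))) := fun _ => borel _
    letI : ∀ (v : HeightOneSpectrum (𝓞 ↥(maximalRealSubfield L))) (a : HLocal L v),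
        MeasurableSpace (HLocal L v ⧸ Subgroup.centralizer ({a} : Set (HLocal L v))) := fun _ _ => borel _
    (1 / 2 : ℂ) * 𝔨.SJHover 𝒪 fH = (𝔨.α 𝒪 : ℂ) *
      (((Nat.card {𝒪H : Literature.NumberTheory.Rogawski1990.StableClassH (cmConjRingHom L) (splitForm L 2) (splitForm L 1) //
          𝒪H.TransfersTo H Literature.NumberTheory.Rogawski1990.endoForm_antidiagOne
            (Literature.NumberTheory.Rogawski1990.stableClassOf (cmConjRingHom L) H γ₀)} + 1 : ℕ) : ℂ)⁻¹ *
      ∑ᶠ i : {𝒪H : Literature.NumberTheory.Rogawski1990.StableClassH (cmConjRingHom L) (splitForm L 2) (splitForm L 1) //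
          𝒪H.TransfersTo H Literature.NumberTheory.Rogawski1990.endoForm_antidiagOne
            (Literature.NumberTheory.Rogawski1990.stableClassOf (cmConjRingHom L) H γ₀)},
        Literature.NumberTheory.Rogawski1990.adelicStableOrbitalIntegralH L (Quotient.out i.1)
          (UnitaryGroup.OrbitalMeasureFamily.ofLocalAdelicPair L (splitForm L 2) (splitForm L 1) 𝔨.mH 𝔨.mHi) ⇑fH) := by
  rw [IsPinned.half_mul_sjHover_eq_of_isRegularElt 𝔨 h 𝒪 h𝒪 hreg fH, ← mul_assoc]
  congr 1
  have hT : 𝔨.PinTransfersTo 𝔨.eStH := h.2.2.2.2.2.2.2.2.2.2.2.2.2.2.2.2.1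
  have hκv : 𝔨.PinKappaValues 𝔨.κG 𝔨.κH := h.2.2.2.2.2.2.2.2.2.2.2.2.2.2.2.2.2.2.2.2.1
  have hcard : Nat.card {c' : 𝔨.StClassH // 𝔨.transfersTo c' 𝒪} =
      Nat.card {𝒪H : Literature.NumberTheory.Rogawski1990.StableClassH (cmConjRingHom L) (splitForm L 2) (splitForm L 1) //
          𝒪H.TransfersTo H Literature.NumberTheory.Rogawski1990.endoForm_antidiagOne
            (Literature.NumberTheory.Rogawski1990.stableClassOf (cmConjRingHom L) H γ₀)} := by
    rw [← h𝒪]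
    exact Nat.card_congr (𝔨.eStH.subtypeEquiv fun c' => hT c' 𝒪)
  rw [hκv.1 𝒪, hcard]
  push_cast
  ring

/-- The constant bookkeeping of T1b at a regular class: `α |𝓡|⁻¹ (X + S) = (α κ_G) X + (α |𝓡|⁻¹) S` with `κ_G = |𝓡|⁻¹`; the second summand is
p08's `½ SJHover = α |𝓡|⁻¹ S`. -/
theorem t1b_regular_algebra (a : ℝ) (n : ℕ) (X S : ℂ) :
    (a : ℂ) * ((((n + 1 : ℕ) : ℂ))⁻¹ * (X + S)) =
      ((a * ((n + 1 : ℕ) : ℝ)⁻¹ : ℝ) : ℂ) * X + (a : ℂ) * ((((n + 1 : ℕ) : ℂ))⁻¹ * S) := by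
  push_cast
  ring

/-- **T1b AT A REGULAR STABLE CLASS, for every pinned kit and EXPLICIT TEST WITNESSES** (draft for ED ≥ 1.22 of the API): for anisotropic hermitian `H`,
the head's Haar guards `hK`∕`hKH`, a regular `𝒪 = 𝒪_st(γ₀)`, the STABLE-CLASS β-socket at `𝒪` (the (viii⁵) text, hypothesis `hβst`), and test
witnesses `(T₁, T′)` of `Transfer f′ f` (pin (ix′)'s clauses + `IsTest`) and `(T₂, T^H)` of `TransferH f′ f^H` (pin (xi″)'s clauses + test-ness),
`J(𝒪, f′) = SJ_G(𝒪, f) + ½ Σ_{𝒪H ↦ 𝒪} SJ_H(𝒪H, f^H)`.  Composition of ★ O11-1c∕O11-1d (two-tensor form (D1)), ★ G1, ★ G2-kernel C, ★ E3t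
(`IsPinned.sjG_isEulerOnClasses`), ★ A-p06 `exists_weights_of_globalKappaFormula`, ★ Kottwitz–Steinberg `exists_corresponds_antidiagThree_all`,
and the pins (viii″)(xii″)(xiii″)(xiii-c)(κ-v)(xv). [cite: Rogawski1990, §5.4 (5.4.1)–(5.4.5) pp. 72–74; §14.5 Thm. 14.5.1 (a) p. 238] -/
theorem IsPinned.j_eq_sjG_add_half_sjHover_of_regular_of_witnesses [MeasurableSpace (GpAdelic L H)] [BorelSpace (GpAdelic L H)]
    {ν : Measure (GpAdelic L H)} [ν.IsHaarMeasure] [ν.IsInvInvariant] {Tinf : Literature.NumberTheory.Rogawski1990.ArchTransferFactor L H}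
    (h : 𝔨.IsPinned ν Tinf νH νG νGi νqi νHi) (hanis : IsAnisotropic L H) (hherm : IsHermitianCM L H)
    (hνG : ∀ v, (νG v).IsHaarMeasure) (hK : ∀ v : HeightOneSpectrum (𝓞 ↥(maximalRealSubfield L)), νG v (UnitaryGroup.cmLocalIntegralLevel L 3 H v : Set (GpLocal L H v)) = 1)
    (hνH : ∀ v, (νH v).IsHaarMeasure)
    (hKH : ∀ v : HeightOneSpectrum (𝓞 ↥(maximalRealSubfield L)),
      νH v (((UnitaryGroup.cmLocalIntegralLevel L 2 (Matrix.of fun i j : Fin 2 => if i.val + j.val + 1 = 2 then (1 : L) else 0) v).prod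
          (UnitaryGroup.cmLocalIntegralLevel L 1 (Matrix.of fun i j : Fin 1 => if i.val + j.val + 1 = 1 then (1 : L) else 0) v) :
            Subgroup (HLocal L v)) : Set (HLocal L v)) = 1)
    {𝒪 : 𝔨.StClass} {γ₀ : (UnitaryGroup.cmDatum L 3 H).Rational} (h𝒪 : 𝔨.eSt 𝒪 = stableClassOf (cmConjRingHom L) H γ₀)
    (hreg : IsRegularElt (γ₀.val : GL (Fin 3) L))
    (f' : TestGp L H) (f : TestG L) (fH : TestH L)
    (T₁ : UnitaryGroup.PureTensor L 3 H) (T' : UnitaryGroup.PureTensor L 3 (splitForm L 3))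
    (T₂ : UnitaryGroup.PureTensor L 3 H) (TH : UnitaryGroup.PureTensor₂ L (splitForm L 2) (splitForm L 1))
    (hT₁ : T₁.IsTest) (hT' : T'.IsTest) (hf'₁ : ⇑f' = T₁.eval) (hf : ⇑f = T'.eval) (hloc₁ : ∀ v, T'.loc v = T₁.loc v ∘ (𝔨.ψ v).symm)
    (hT₂ : T₂.IsTest) (hTH : TH.IsUnramified₂) (hTc : ∀ v ∈ TH.S, HasCompactSupport (TH.loc v)) (hTa : HasCompactSupport TH.arch)
    (hTc' : ∀ v ∈ TH.S, Continuous (TH.loc v)) (hTa' : Continuous TH.arch) (hf'₂ : ⇑f' = T₂.eval) (hfH : ⇑fH = TH.eval) :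
    letI : ∀ g : GpAdelic L H, MeasurableSpace (GpAdelic L H ⧸ Subgroup.centralizer ({g} : Set (GpAdelic L H))) := fun _ => borel _
    letI : ∀ γ : GpInf L H, MeasurableSpace (GpInf L H ⧸ Subgroup.centralizer ({γ} : Set (GpInf L H))) := fun _ => borel _
    letI : ∀ γ : GInf L, MeasurableSpace (GInf L ⧸ Subgroup.centralizer ({γ} : Set (GInf L))) := fun _ => borel _
    letI : ∀ a : HInf L, MeasurableSpace (HInf L ⧸ Subgroup.centralizer ({a} : Set (HInf L))) := fun _ => borel _
    letI : ∀ (v : HeightOneSpectrum (𝓞 ↥(maximalRealSubfield L))) (a : HLocal L v),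
        MeasurableSpace (HLocal L v ⧸ Subgroup.centralizer ({a} : Set (HLocal L v))) := fun _ _ => borel _
    haveI : ∀ (v : HeightOneSpectrum (𝓞 ↥(maximalRealSubfield L))) (a : HLocal L v),
        BorelSpace (HLocal L v ⧸ Subgroup.centralizer ({a} : Set (HLocal L v))) := fun _ _ => ⟨rfl⟩
    letI : ∀ (v : HeightOneSpectrum (𝓞 ↥(maximalRealSubfield L))) (γ : GpLocal L H v),
        MeasurableSpace (GpLocal L H v ⧸ Subgroup.centralizer ({γ} : Set (GpLocal L H v))) := fun _ _ => borel _
    haveI : ∀ (v : HeightOneSpectrum (𝓞 ↥(maximalRealSubfield L))) (γ : GpLocal L H v),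
        BorelSpace (GpLocal L H v ⧸ Subgroup.centralizer ({γ} : Set (GpLocal L H v))) := fun _ _ => ⟨rfl⟩
    -- (viii⁵) text at `𝒪`: the STABLE-CLASS β-socket
    (∀ c ∈ conjClassesIn (cmConjRingHom L) H γ₀, 𝔨.μA c = ENNReal.ofReal (𝔨.α 𝒪) • UnitaryGroup.AdelicOrbitalMeasureFamily.ofLocal L 3 H 𝔨.mG 𝔨.mGi c) →
    -- (ix′) archimedean clause for the witness `(T₁, T′)`
    IsArchInnerTransfer L H 𝔨.mGi 𝔨.mqi T₁.arch T'.arch →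
    -- (xi″) clauses for the witness `(T₂, T^H)`
    (∀ v, IsLocalDeltaTransfer L H v (𝔨.Δ v) (𝔨.mH v) (𝔨.mG v) (TH.loc v) (T₂.loc v)) →
    IsArchDeltaTransfer L H Tinf 𝔨.mHi 𝔨.mGi TH.arch T₂.arch →
    𝔨.J 𝒪 f' = 𝔨.SJG 𝒪 f + (1 / 2 : ℂ) * 𝔨.SJHover 𝒪 fH := by
  -- Borel σ-algebras on every orbit quotient (the pins' `letI`s) and on `G_v`
  letI : ∀ g : GpAdelic L H, MeasurableSpace (GpAdelic L H ⧸ Subgroup.centralizer ({g} : Set (GpAdelic L H))) := fun _ => borel _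
  haveI : ∀ g : GpAdelic L H, BorelSpace (GpAdelic L H ⧸ Subgroup.centralizer ({g} : Set (GpAdelic L H))) := fun _ => ⟨rfl⟩
  letI : ∀ γ : GpInf L H, MeasurableSpace (GpInf L H ⧸ Subgroup.centralizer ({γ} : Set (GpInf L H))) := fun _ => borel _
  haveI : ∀ γ : GpInf L H, BorelSpace (GpInf L H ⧸ Subgroup.centralizer ({γ} : Set (GpInf L H))) := fun _ => ⟨rfl⟩
  letI : ∀ γ : GInf L, MeasurableSpace (GInf L ⧸ Subgroup.centralizer ({γ} : Set (GInf L))) := fun _ => borel _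
  haveI : ∀ γ : GInf L, BorelSpace (GInf L ⧸ Subgroup.centralizer ({γ} : Set (GInf L))) := fun _ => ⟨rfl⟩
  letI : ∀ a : HInf L, MeasurableSpace (HInf L ⧸ Subgroup.centralizer ({a} : Set (HInf L))) := fun _ => borel _
  haveI : ∀ a : HInf L, BorelSpace (HInf L ⧸ Subgroup.centralizer ({a} : Set (HInf L))) := fun _ => ⟨rfl⟩
  letI : ∀ (v : HeightOneSpectrum (𝓞 ↥(maximalRealSubfield L))) (a : HLocal L v),
      MeasurableSpace (HLocal L v ⧸ Subgroup.centralizer ({a} : Set (HLocal L v))) := fun _ _ => borel _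
  haveI : ∀ (v : HeightOneSpectrum (𝓞 ↥(maximalRealSubfield L))) (a : HLocal L v),
      BorelSpace (HLocal L v ⧸ Subgroup.centralizer ({a} : Set (HLocal L v))) := fun _ _ => ⟨rfl⟩
  letI : ∀ (v : HeightOneSpectrum (𝓞 ↥(maximalRealSubfield L))) (γ : GpLocal L H v),
      MeasurableSpace (GpLocal L H v ⧸ Subgroup.centralizer ({γ} : Set (GpLocal L H v))) := fun _ _ => borel _
  haveI : ∀ (v : HeightOneSpectrum (𝓞 ↥(maximalRealSubfield L))) (γ : GpLocal L H v),
      BorelSpace (GpLocal L H v ⧸ Subgroup.centralizer ({γ} : Set (GpLocal L H v))) := fun _ _ => ⟨rfl⟩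
  letI : ∀ h : HAdelic L, MeasurableSpace (HAdelic L ⧸ Subgroup.centralizer ({h} : Set (HAdelic L))) := fun _ => borel _
  haveI : ∀ h : HAdelic L, BorelSpace (HAdelic L ⧸ Subgroup.centralizer ({h} : Set (HAdelic L))) := fun _ => ⟨rfl⟩
  letI : ∀ g : GAdelic L, MeasurableSpace (GAdelic L ⧸ Subgroup.centralizer ({g} : Set (GAdelic L))) := fun _ => borel _
  haveI : ∀ g : GAdelic L, BorelSpace (GAdelic L ⧸ Subgroup.centralizer ({g} : Set (GAdelic L))) := fun _ => ⟨rfl⟩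
  letI : ∀ (v : HeightOneSpectrum (𝓞 ↥(maximalRealSubfield L))) (x : (UnitaryGroup.cmDatum L 3 (splitForm L 3)).Local v),
      MeasurableSpace ((UnitaryGroup.cmDatum L 3 (splitForm L 3)).Local v ⧸
        Subgroup.centralizer ({x} : Set ((UnitaryGroup.cmDatum L 3 (splitForm L 3)).Local v))) := fun _ _ => borel _
  haveI : ∀ (v : HeightOneSpectrum (𝓞 ↥(maximalRealSubfield L))) (x : (UnitaryGroup.cmDatum L 3 (splitForm L 3)).Local v),
      BorelSpace ((UnitaryGroup.cmDatum L 3 (splitForm L 3)).Local v ⧸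
        Subgroup.centralizer ({x} : Set ((UnitaryGroup.cmDatum L 3 (splitForm L 3)).Local v))) := fun _ _ => ⟨rfl⟩
  intro hβst harch₁ hloc₂ harch₂
  haveI : ∀ v, (νG v).IsHaarMeasure := hνG
  haveI : ∀ v, (νH v).IsHaarMeasure := hνH
  have hdet : H.det ≠ 0 := Godement.det_ne_zero_of_anisotropic L H hanis
  -- Kottwitz–Steinberg: a rational `γ ∈ U(Φ₃)(L⁺)` with `γ₀ ↔ γ`
  obtain ⟨γ, hγ⟩ := exists_corresponds_antidiagThree_all L H ((landherr_conjTranspose_eq L H).trans hherm) hdet γ₀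
  -- pin (xv): the stabilisation package at `γ₀`; ★ A-p06: its class weights
  obtain ⟨A, instA, 𝓡, inst𝓡, obs, e, hHasse, hκ⟩ := IsPinned.stabilisationPackage 𝔨 h γ₀ hreg
  obtain ⟨W, hW⟩ := MatchingAdeleG₂.exists_weights_of_globalKappaFormula 𝔨.Δ Tinf 𝓡 obs e hκ
  -- (xii-d): the Euler form of `Φ^{st,𝐀}_G` at the kit's transport family for the test partner `T′`
  have hG := IsPinned.sjG_isEulerOnClasses 𝔨 h hνG hK hreg hγ T' hT'
  -- (14.2.1) at every finite place for `(mG, mq)` from `T′.loc v = T₁.loc v ∘ ψ_v⁻¹` (★ F1)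
  have hlocI : ∀ v, IsLocalInnerTransfer L H v (𝔨.mG v) (𝔨.mq v) (T₁.loc v) (T'.loc v) := fun v =>
    forall_isLocalInnerTransfer_transport L H 𝔨.ψ (IsPinned.corresponds 𝔨 h) 𝔨.mG T₁ T' hloc₁ v
  have hKH' : ∀ v : HeightOneSpectrum (𝓞 ↥(maximalRealSubfield L)),
      νH v ((UnitaryGroup.cmLocalIntegralLevel L 2 (Matrix.of fun i j : Fin 2 => if i.val + j.val + 1 = 2 then (1 : L) else 0) v :
          Set ((UnitaryGroup.cmDatum L 2 (Matrix.of fun i j : Fin 2 => if i.val + j.val + 1 = 2 then (1 : L) else 0)).Local v)) ×ˢ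
        (UnitaryGroup.cmLocalIntegralLevel L 1 (Matrix.of fun i j : Fin 1 => if i.val + j.val + 1 = 1 then (1 : L) else 0) v :
          Set ((UnitaryGroup.cmDatum L 1 (Matrix.of fun i j : Fin 1 => if i.val + j.val + 1 = 1 then (1 : L) else 0)).Local v))) = 1 :=
    fun v => by simpa only [Subgroup.coe_prod] using hKH v
  -- the two-tensor regular pre-stabilisation (D1) at `r := α 𝒪`, `(mA, F) := (ofLocalAdelic mq mqi, T′.eval)`
  -- the instance binders of (D1) are FED EXPLICITLY with the pins' own Borel lambdas (no local-instance fvars inside the atoms ⇒ the final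
  -- bookkeeping compares syntactically equal orbital-integral terms; default heartbeats)
  have hmain := @adelicStableOrbitalIntegral_stableClassOf_eq_mul_inv_natCard_add_one_mul_stabilised₂ L _ _ _ H γ₀
    (fun _ => borel _) (fun _ => ⟨rfl⟩) (fun _ _ => borel _) (fun _ _ => ⟨rfl⟩) (fun _ => borel _) (fun _ => ⟨rfl⟩) _ _
    (fun _ => borel _) (fun _ => ⟨rfl⟩) (fun _ _ => borel _) (fun _ _ => ⟨rfl⟩) (fun _ => borel _) (fun _ => ⟨rfl⟩) _ _
    (fun _ _ => borel _) (fun _ => borel _) (fun _ => borel _)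
    hanis hherm hreg 𝔨.Δ
    (IsPinned.deltaTransfer 𝔨 h).2.1 Tinf A instA 𝓡 inst𝓡 obs e hHasse hκ W hW νG hνG _ hK 𝔨.mG (fun v => ((IsPinned.canonical 𝔨 h) v).2) 𝔨.mGi
    (IsPinned.transfer_arch 𝔨 h).1 𝔨.μA _ (IsPinned.α_pos 𝔨 h 𝒪).le hβst T₁ hT₁ T₂ hT₂ (hf'₂.symm.trans hf'₁) νH hνH _ hKH' 𝔨.mH 𝔨.mHi
    (fun v => ((IsPinned.deltaTransfer 𝔨 h).1 v).2.1) (fun v => ((IsPinned.canonical 𝔨 h) v).1) (IsPinned.deltaTransfer 𝔨 h).2.2.2.1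
    TH hTH hTc hTa hTc' hTa' hloc₂ harch₂ _ hγ 𝔨.mq 𝔨.mqi T'.loc T'.arch hlocI harch₁
    (UnitaryGroup.OrbitalMeasureFamily.ofLocalAdelic L 3 (splitForm L 3) 𝔨.mq 𝔨.mqi) T'.eval hG
  -- the J-side: pin (viii″) at `𝒪 = 𝒪_st(γ₀)`
  have hJ : 𝔨.J 𝒪 f' = UnitaryGroup.adelicStableOrbitalIntegral L 3 H 𝔨.μA T₁.eval (stableClassOf (cmConjRingHom L) H γ₀) := by
    rw [IsPinned.J_eq 𝔨 h, h𝒪, hf'₁]; rfl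
  -- the SJ_G-side: pin (xii″) + (κ-v)
  have hSJG := IsPinned.sjG_eq 𝔨 h 𝒪 γ₀ h𝒪 hreg f
  have hκG := (IsPinned.kappaValues 𝔨 h).1 𝒪
  -- the SJ_H-side: p08 (g5)'s half `½ SJHover = α |𝓡|⁻¹ Σᶠ Φ^{st,𝐀}_H` (pins (xiii-c)(xiii″)(κ-v)), and the count transported along `eStH`
  have hH2 := IsPinned.half_mul_sjHover_eq_mul_inv_natCard_add_one_mul 𝔨 h 𝒪 h𝒪 hreg fH
  let E : {c' : 𝔨.StClassH // 𝔨.transfersTo c' 𝒪} ≃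
      {𝒪H : StableClassH (cmConjRingHom L) (splitForm L 2) (splitForm L 1) //
        𝒪H.TransfersTo H endoForm_antidiagOne (stableClassOf (cmConjRingHom L) H γ₀)} :=
    𝔨.eStH.subtypeEquiv fun c' => by rw [IsPinned.transfersTo_iff 𝔨 h c' 𝒪, h𝒪]
  have hcard : Nat.card {c' : 𝔨.StClassH // 𝔨.transfersTo c' 𝒪} =
      Nat.card {𝒪H : StableClassH (cmConjRingHom L) (splitForm L 2) (splitForm L 1) //
        𝒪H.TransfersTo H endoForm_antidiagOne (stableClassOf (cmConjRingHom L) H γ₀)} := Nat.card_congr E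
  rw [hJ, hmain, hSJG, hf, hH2, hfH, hκG, hcard]
  exact t1b_regular_algebra _ _ _ _

/-- **T1b AT A REGULAR STABLE CLASS FROM `Matches`, for every pinned kit (ED 1.22 pins)** — law T1b's class clause
`J(𝒪, f′) = SJ_G(𝒪, f) + ½ Σ_{𝒪H ↦ 𝒪} SJ_H(𝒪H, f^H)` at a REGULAR `𝒪 = 𝒪_st(γ₀)` for every matching triple `(f′, f, f^H)`, GIVEN the (viii⁵) stable-class
β-socket at `𝒪` (hypothesis; ED 1.23's pin) — the previous theorem fed with the test witnesses of ED 1.22's pins (ix′)∕(xi″) through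
`IsPinned.transfer_tensors` ∕ `IsPinned.deltaTransfer_tensors`. [cite: Rogawski1990, §5.4 (5.4.1)–(5.4.5) pp. 72–74; §14.5 Thm. 14.5.1 (a) p. 238] -/
theorem IsPinned.j_eq_sjG_add_half_sjHover_of_regular [MeasurableSpace (GpAdelic L H)] [BorelSpace (GpAdelic L H)]
    {ν : Measure (GpAdelic L H)} [ν.IsHaarMeasure] [ν.IsInvInvariant] {Tinf : Literature.NumberTheory.Rogawski1990.ArchTransferFactor L H}
    (h : 𝔨.IsPinned ν Tinf νH νG νGi νqi νHi) (hanis : IsAnisotropic L H) (hherm : IsHermitianCM L H)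
    (hνG : ∀ v, (νG v).IsHaarMeasure) (hK : ∀ v : HeightOneSpectrum (𝓞 ↥(maximalRealSubfield L)), νG v (UnitaryGroup.cmLocalIntegralLevel L 3 H v : Set (GpLocal L H v)) = 1)
    (hνH : ∀ v, (νH v).IsHaarMeasure)
    (hKH : ∀ v : HeightOneSpectrum (𝓞 ↥(maximalRealSubfield L)),
      νH v (((UnitaryGroup.cmLocalIntegralLevel L 2 (Matrix.of fun i j : Fin 2 => if i.val + j.val + 1 = 2 then (1 : L) else 0) v).prod
          (UnitaryGroup.cmLocalIntegralLevel L 1 (Matrix.of fun i j : Fin 1 => if i.val + j.val + 1 = 1 then (1 : L) else 0) v) :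
            Subgroup (HLocal L v)) : Set (HLocal L v)) = 1)
    {𝒪 : 𝔨.StClass} {γ₀ : (UnitaryGroup.cmDatum L 3 H).Rational} (h𝒪 : 𝔨.eSt 𝒪 = stableClassOf (cmConjRingHom L) H γ₀)
    (hreg : IsRegularElt (γ₀.val : GL (Fin 3) L))
    {f' : TestGp L H} {f : TestG L} {fH : TestH L} (hm : 𝔨.Matches f' f fH) :
    letI : ∀ g : GpAdelic L H, MeasurableSpace (GpAdelic L H ⧸ Subgroup.centralizer ({g} : Set (GpAdelic L H))) := fun _ => borel _
    letI : ∀ γ : GpInf L H, MeasurableSpace (GpInf L H ⧸ Subgroup.centralizer ({γ} : Set (GpInf L H))) := fun _ => borel _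
    letI : ∀ (v : HeightOneSpectrum (𝓞 ↥(maximalRealSubfield L))) (γ : GpLocal L H v),
        MeasurableSpace (GpLocal L H v ⧸ Subgroup.centralizer ({γ} : Set (GpLocal L H v))) := fun _ _ => borel _
    -- (viii⁵) text at `𝒪`
    (∀ c ∈ conjClassesIn (cmConjRingHom L) H γ₀, 𝔨.μA c = ENNReal.ofReal (𝔨.α 𝒪) • UnitaryGroup.AdelicOrbitalMeasureFamily.ofLocal L 3 H 𝔨.mG 𝔨.mGi c) →
    𝔨.J 𝒪 f' = 𝔨.SJG 𝒪 f + (1 / 2 : ℂ) * 𝔨.SJHover 𝒪 fH := by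
  intro hβst
  obtain ⟨T₁, T', hT₁, hT', hf'₁, hf, hloc₁, harch₁⟩ := IsPinned.transfer_tensors 𝔨 h hm.1
  obtain ⟨T₂, TH, hT₂, hTH, hTc, hTa, hTc', hTa', hf'₂, hfH, hloc₂, harch₂⟩ := IsPinned.deltaTransfer_tensors 𝔨 h hm.2
  exact IsPinned.j_eq_sjG_add_half_sjHover_of_regular_of_witnesses 𝔨 h hanis hherm hνG hK hνH hKH h𝒪 hreg f' f fH T₁ T' T₂ TH
    hT₁ hT' hf'₁ hf hloc₁ hT₂ hTH hTc hTa hTc' hTa' hf'₂ hfH hβst harch₁ hloc₂ harch₂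

/-- **THE SAME FROM THE (viii⁵) PIN TEXT of ED 1.23** (RULING #105 (2): `∀ c regular, μA c = ofReal (α (eSt⁻¹ (ofConjClass c))) • ofLocal mG mGi c`):
at a regular `𝒪 = 𝒪_st(γ₀)` every rational class `c ⊂ 𝒪_st(γ₀)` has a regular representative (★ (K-R)
`StableClass.IsRegular.isRegularElt_out_of_mem_conjClassesIn`) and `eSt⁻¹ (ofConjClass c) = 𝒪`, so the pin text gives the β-socket `hβst` of the
previous theorem.  With ED 1.23 this is law T1b's class clause at every regular class, for every pinned kit, with NO residual hypothesis.
[cite: Rogawski1990, §5.4 (5.4.1)–(5.4.5) pp. 72–74; §14.5 Thm. 14.5.1 (a) p. 238] -/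
theorem IsPinned.j_eq_sjG_add_half_sjHover_of_regular' [MeasurableSpace (GpAdelic L H)] [BorelSpace (GpAdelic L H)]
    {ν : Measure (GpAdelic L H)} [ν.IsHaarMeasure] [ν.IsInvInvariant] {Tinf : Literature.NumberTheory.Rogawski1990.ArchTransferFactor L H}
    (h : 𝔨.IsPinned ν Tinf νH νG νGi νqi νHi) (hanis : IsAnisotropic L H) (hherm : IsHermitianCM L H)
    (hνG : ∀ v, (νG v).IsHaarMeasure) (hK : ∀ v : HeightOneSpectrum (𝓞 ↥(maximalRealSubfield L)), νG v (UnitaryGroup.cmLocalIntegralLevel L 3 H v : Set (GpLocal L H v)) = 1)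
    (hνH : ∀ v, (νH v).IsHaarMeasure)
    (hKH : ∀ v : HeightOneSpectrum (𝓞 ↥(maximalRealSubfield L)),
      νH v (((UnitaryGroup.cmLocalIntegralLevel L 2 (Matrix.of fun i j : Fin 2 => if i.val + j.val + 1 = 2 then (1 : L) else 0) v).prod
          (UnitaryGroup.cmLocalIntegralLevel L 1 (Matrix.of fun i j : Fin 1 => if i.val + j.val + 1 = 1 then (1 : L) else 0) v) :
            Subgroup (HLocal L v)) : Set (HLocal L v)) = 1)
    {𝒪 : 𝔨.StClass} {γ₀ : (UnitaryGroup.cmDatum L 3 H).Rational} (h𝒪 : 𝔨.eSt 𝒪 = stableClassOf (cmConjRingHom L) H γ₀)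
    (hreg : IsRegularElt (γ₀.val : GL (Fin 3) L))
    {f' : TestGp L H} {f : TestG L} {fH : TestH L} (hm : 𝔨.Matches f' f fH) :
    letI : ∀ g : GpAdelic L H, MeasurableSpace (GpAdelic L H ⧸ Subgroup.centralizer ({g} : Set (GpAdelic L H))) := fun _ => borel _
    letI : ∀ γ : GpInf L H, MeasurableSpace (GpInf L H ⧸ Subgroup.centralizer ({γ} : Set (GpInf L H))) := fun _ => borel _
    letI : ∀ (v : HeightOneSpectrum (𝓞 ↥(maximalRealSubfield L))) (γ : GpLocal L H v),
        MeasurableSpace (GpLocal L H v ⧸ Subgroup.centralizer ({γ} : Set (GpLocal L H v))) := fun _ _ => borel _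
    -- the (viii⁵) pin text (ED 1.23)
    (∀ c : ConjClasses (UnitaryGroup.cmDatum L 3 H).Rational, IsRegularElt ((Quotient.out c).val : GL (Fin 3) L) →
      𝔨.μA c = ENNReal.ofReal (𝔨.α (𝔨.eSt.symm (StableClass.ofConjClass c))) • UnitaryGroup.AdelicOrbitalMeasureFamily.ofLocal L 3 H 𝔨.mG 𝔨.mGi c) →
    𝔨.J 𝒪 f' = 𝔨.SJG 𝒪 f + (1 / 2 : ℂ) * 𝔨.SJHover 𝒪 fH := by
  intro hβ
  refine IsPinned.j_eq_sjG_add_half_sjHover_of_regular 𝔨 h hanis hherm hνG hK hνH hKH h𝒪 hreg hm fun c hc => ?_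
  have hc' : StableClass.ofConjClass c = stableClassOf (cmConjRingHom L) H γ₀ := hc
  have h𝒪c : 𝔨.eSt.symm (StableClass.ofConjClass c) = 𝒪 := by rw [hc', ← h𝒪, Equiv.symm_apply_apply]
  rw [hβ c ((StableClass.isRegular_of_eq_stableClassOf rfl hreg).isRegularElt_out_of_mem_conjClassesIn hc), h𝒪c]

/-- **THE SAME FROM THE (viii⁵) PIN TEXT IN THE GUARD SPELLING OF PLAN-T1 v3 §2** (`(𝔨.eSt (𝔨.eSt.symm (StableClass.ofConjClass c))).IsRegular →
𝔨.μA c = …`): the guard is `(StableClass.ofConjClass c).IsRegular` after `Equiv.apply_symm_apply`, which holds on `conjClassesIn γ₀` for regular `γ₀`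
(★ `StableClass.isRegular_of_eq_stableClassOf`). [cite: Rogawski1990, §5.4 (5.4.1)–(5.4.5) pp. 72–74; §14.5 Thm. 14.5.1 (a) p. 238] -/
theorem IsPinned.j_eq_sjG_add_half_sjHover_of_regular'' [MeasurableSpace (GpAdelic L H)] [BorelSpace (GpAdelic L H)]
    {ν : Measure (GpAdelic L H)} [ν.IsHaarMeasure] [ν.IsInvInvariant] {Tinf : Literature.NumberTheory.Rogawski1990.ArchTransferFactor L H}
    (h : 𝔨.IsPinned ν Tinf νH νG νGi νqi νHi) (hanis : IsAnisotropic L H) (hherm : IsHermitianCM L H)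
    (hνG : ∀ v, (νG v).IsHaarMeasure) (hK : ∀ v : HeightOneSpectrum (𝓞 ↥(maximalRealSubfield L)), νG v (UnitaryGroup.cmLocalIntegralLevel L 3 H v : Set (GpLocal L H v)) = 1)
    (hνH : ∀ v, (νH v).IsHaarMeasure)
    (hKH : ∀ v : HeightOneSpectrum (𝓞 ↥(maximalRealSubfield L)),
      νH v (((UnitaryGroup.cmLocalIntegralLevel L 2 (Matrix.of fun i j : Fin 2 => if i.val + j.val + 1 = 2 then (1 : L) else 0) v).prod
          (UnitaryGroup.cmLocalIntegralLevel L 1 (Matrix.of fun i j : Fin 1 => if i.val + j.val + 1 = 1 then (1 : L) else 0) v) :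
            Subgroup (HLocal L v)) : Set (HLocal L v)) = 1)
    {𝒪 : 𝔨.StClass} {γ₀ : (UnitaryGroup.cmDatum L 3 H).Rational} (h𝒪 : 𝔨.eSt 𝒪 = stableClassOf (cmConjRingHom L) H γ₀)
    (hreg : IsRegularElt (γ₀.val : GL (Fin 3) L))
    {f' : TestGp L H} {f : TestG L} {fH : TestH L} (hm : 𝔨.Matches f' f fH) :
    letI : ∀ g : GpAdelic L H, MeasurableSpace (GpAdelic L H ⧸ Subgroup.centralizer ({g} : Set (GpAdelic L H))) := fun _ => borel _
    letI : ∀ γ : GpInf L H, MeasurableSpace (GpInf L H ⧸ Subgroup.centralizer ({γ} : Set (GpInf L H))) := fun _ => borel _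
    letI : ∀ (v : HeightOneSpectrum (𝓞 ↥(maximalRealSubfield L))) (γ : GpLocal L H v),
        MeasurableSpace (GpLocal L H v ⧸ Subgroup.centralizer ({γ} : Set (GpLocal L H v))) := fun _ _ => borel _
    -- the (viii⁵) pin text, guard spelled as in PLAN-T1 v3 §2
    (∀ c : ConjClasses (UnitaryGroup.cmDatum L 3 H).Rational, (𝔨.eSt (𝔨.eSt.symm (StableClass.ofConjClass c))).IsRegular →
      𝔨.μA c = ENNReal.ofReal (𝔨.α (𝔨.eSt.symm (StableClass.ofConjClass c))) • UnitaryGroup.AdelicOrbitalMeasureFamily.ofLocal L 3 H 𝔨.mG 𝔨.mGi c) →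
    𝔨.J 𝒪 f' = 𝔨.SJG 𝒪 f + (1 / 2 : ℂ) * 𝔨.SJHover 𝒪 fH := by
  intro hβ
  refine IsPinned.j_eq_sjG_add_half_sjHover_of_regular 𝔨 h hanis hherm hνG hK hνH hKH h𝒪 hreg hm fun c hc => ?_
  have hc' : StableClass.ofConjClass c = stableClassOf (cmConjRingHom L) H γ₀ := hc
  have h𝒪c : 𝔨.eSt.symm (StableClass.ofConjClass c) = 𝒪 := by rw [hc', ← h𝒪, Equiv.symm_apply_apply]
  have hg : (𝔨.eSt (𝔨.eSt.symm (StableClass.ofConjClass c))).IsRegular := by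
    rw [Equiv.apply_symm_apply, hc']
    exact StableClass.isRegular_of_eq_stableClassOf rfl hreg
  rw [hβ c hg, h𝒪c]

/-- **LAW T1b's CLASS CLAUSE AT EVERY REGULAR STABLE CLASS, FOR EVERY PINNED KIT — NO RESIDUAL HYPOTHESIS** (ed. 1.23): the (viii⁵) pin
`IsPinned.stableBeta` discharges the β-text of `IsPinned.j_eq_sjG_add_half_sjHover_of_regular'`; what remains of law T1b (`EllipticStabilisation`) is the
class clause at the SINGULAR classes (O7) and the summed conjunct [Lemma 14.5.2 (a)]. [cite: Rogawski1990, §5.4 Prop. 5.4.1 (5.4.1)–(5.4.5) pp. 72–74; Thm. 14.5.1 (a) p. 238] -/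
theorem IsPinned.j_eq_sjG_add_half_sjHover_of_isRegularElt [MeasurableSpace (GpAdelic L H)] [BorelSpace (GpAdelic L H)]
    {ν : Measure (GpAdelic L H)} [ν.IsHaarMeasure] [ν.IsInvInvariant] {Tinf : Literature.NumberTheory.Rogawski1990.ArchTransferFactor L H}
    (h : 𝔨.IsPinned ν Tinf νH νG νGi νqi νHi) (hanis : IsAnisotropic L H) (hherm : IsHermitianCM L H)
    (hνG : ∀ v, (νG v).IsHaarMeasure) (hK : ∀ v : HeightOneSpectrum (𝓞 ↥(maximalRealSubfield L)), νG v (UnitaryGroup.cmLocalIntegralLevel L 3 H v : Set (GpLocal L H v)) = 1)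
    (hνH : ∀ v, (νH v).IsHaarMeasure)
    (hKH : ∀ v : HeightOneSpectrum (𝓞 ↥(maximalRealSubfield L)),
      νH v (((UnitaryGroup.cmLocalIntegralLevel L 2 (Matrix.of fun i j : Fin 2 => if i.val + j.val + 1 = 2 then (1 : L) else 0) v).prod
          (UnitaryGroup.cmLocalIntegralLevel L 1 (Matrix.of fun i j : Fin 1 => if i.val + j.val + 1 = 1 then (1 : L) else 0) v) :
            Subgroup (HLocal L v)) : Set (HLocal L v)) = 1)
    {𝒪 : 𝔨.StClass} {γ₀ : (UnitaryGroup.cmDatum L 3 H).Rational} (h𝒪 : 𝔨.eSt 𝒪 = stableClassOf (cmConjRingHom L) H γ₀)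
    (hreg : IsRegularElt (γ₀.val : GL (Fin 3) L))
    {f' : TestGp L H} {f : TestG L} {fH : TestH L} (hm : 𝔨.Matches f' f fH) :
    𝔨.J 𝒪 f' = 𝔨.SJG 𝒪 f + (1 / 2 : ℂ) * 𝔨.SJHover 𝒪 fH :=
  IsPinned.j_eq_sjG_add_half_sjHover_of_regular' 𝔨 h hanis hherm hνG hK hνH hKH h𝒪 hreg hm h.stableBeta

end T1bRegular

/-! ## §K (ed. 1.24a₁) the kit-level vanishing and the sign-free T1b assembly (F0P3a-p01 (g6) V-KIT v3.2, VERBATIM; paste call sites un-primed) -/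

open Literature.NumberTheory.Rogawski1990 in
open scoped Matrix MatrixGroups in
/-- **`SJ_H(𝒪H, f^H) = 0` AT A `G`-REGULAR CLASS WITH NO ARCHIMEDEAN MATCH, for every pinned kit** (T1b-VANISH, analytic half, kit level): for a
Δ-transfer `f′ ↦ f^H` (`TransferH`, pin (xi″) with test-ness), a `G`-regular `𝒪H = 𝒪′_st(γ_H)` and NO `γ′ ∈ G′_∞` with `γ_H ⊗ 1 ↔ γ′`, pin (xiii″) reads
`SJ_H(𝒪H, f^H) = κ_H · Φ^{st,𝐀}_H(γ_H; ofLocalAdelicPair m^H m^H_∞; T^H.eval)` and ★ `adelicStableOrbitalIntegralH_eq_zero_of_forall_not_isArchNormPair` kills the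
second factor (Euler form ★ E3c-H, archimedean factor `0` by ★ `IsArchDeltaTransfer`). [cite: Rogawski1990, §14.3 pp. 233–234; §14.5 Thm. 14.5.1 (a), Lemma 14.5.2 (a) p. 238] -/
theorem IsPinned.sjH_eq_zero_of_forall_not_isArchNormPair [MeasurableSpace (GpAdelic L H)] [BorelSpace (GpAdelic L H)]
    {ν : Measure (GpAdelic L H)} [ν.IsHaarMeasure] [ν.IsInvInvariant] {Tinf : Literature.NumberTheory.Rogawski1990.ArchTransferFactor L H}
    (h : 𝔨.IsPinned ν Tinf νH νG νGi νqi νHi)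
    (hνH : ∀ v, (νH v).IsHaarMeasure)
    (hKH : ∀ v : HeightOneSpectrum (𝓞 ↥(maximalRealSubfield L)),
      νH v (((UnitaryGroup.cmLocalIntegralLevel L 2 (Matrix.of fun i j : Fin 2 => if i.val + j.val + 1 = 2 then (1 : L) else 0) v).prod
          (UnitaryGroup.cmLocalIntegralLevel L 1 (Matrix.of fun i j : Fin 1 => if i.val + j.val + 1 = 1 then (1 : L) else 0) v) :
            Subgroup (HLocal L v)) : Set (HLocal L v)) = 1)
    {𝒪H : 𝔨.StClassH} {γH : (UnitaryGroup.cmDatum L 2 (splitForm L 2)).Rational × (UnitaryGroup.cmDatum L 1 (splitForm L 1)).Rational}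
    (h𝒪H : 𝔨.eStH 𝒪H = stableClassHOf (cmConjRingHom L) (splitForm L 2) (splitForm L 1) γH)
    (hreg : IsGRegular (cmConjRingHom L) (splitForm L 2) (splitForm L 1) (splitForm L 3) endoForm_antidiagOne γH)
    {f' : TestGp L H} {fH : TestH L} (hfH : 𝔨.TransferH f' fH)
    (hno : ∀ γ : GpInf L H, ¬ IsArchNormPair L H (rationalArch L γH) γ) :
    𝔨.SJH 𝒪H fH = 0 := by
  letI : ∀ h : HAdelic L, MeasurableSpace (HAdelic L ⧸ Subgroup.centralizer ({h} : Set (HAdelic L))) := fun _ => borel _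
  haveI : ∀ h : HAdelic L, BorelSpace (HAdelic L ⧸ Subgroup.centralizer ({h} : Set (HAdelic L))) := fun _ => ⟨rfl⟩
  letI : ∀ a : HInf L, MeasurableSpace (HInf L ⧸ Subgroup.centralizer ({a} : Set (HInf L))) := fun _ => borel _
  haveI : ∀ a : HInf L, BorelSpace (HInf L ⧸ Subgroup.centralizer ({a} : Set (HInf L))) := fun _ => ⟨rfl⟩
  letI : ∀ (v : HeightOneSpectrum (𝓞 ↥(maximalRealSubfield L))) (a : HLocal L v),
      MeasurableSpace (HLocal L v ⧸ Subgroup.centralizer ({a} : Set (HLocal L v))) := fun _ _ => borel _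
  haveI : ∀ (v : HeightOneSpectrum (𝓞 ↥(maximalRealSubfield L))) (a : HLocal L v),
      BorelSpace (HLocal L v ⧸ Subgroup.centralizer ({a} : Set (HLocal L v))) := fun _ _ => ⟨rfl⟩
  letI : ∀ (v : HeightOneSpectrum (𝓞 ↥(maximalRealSubfield L))) (γ : GpLocal L H v),
      MeasurableSpace (GpLocal L H v ⧸ Subgroup.centralizer ({γ} : Set (GpLocal L H v))) := fun _ _ => borel _
  letI : ∀ γ : GpInf L H, MeasurableSpace (GpInf L H ⧸ Subgroup.centralizer ({γ} : Set (GpInf L H))) := fun _ => borel _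
  haveI : ∀ v, (νH v).IsHaarMeasure := hνH
  obtain ⟨T₂, TH, -, hTH, hTc, hTa, hTc', hTa', -, hfH', hloc₂, harch₂⟩ := IsPinned.deltaTransfer_tensors 𝔨 h hfH
  have hKH' : ∀ v : HeightOneSpectrum (𝓞 ↥(maximalRealSubfield L)),
      νH v ((UnitaryGroup.cmLocalIntegralLevel L 2 (Matrix.of fun i j : Fin 2 => if i.val + j.val + 1 = 2 then (1 : L) else 0) v :
          Set ((UnitaryGroup.cmDatum L 2 (Matrix.of fun i j : Fin 2 => if i.val + j.val + 1 = 2 then (1 : L) else 0)).Local v)) ×ˢ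
        (UnitaryGroup.cmLocalIntegralLevel L 1 (Matrix.of fun i j : Fin 1 => if i.val + j.val + 1 = 1 then (1 : L) else 0) v :
          Set ((UnitaryGroup.cmDatum L 1 (Matrix.of fun i j : Fin 1 => if i.val + j.val + 1 = 1 then (1 : L) else 0)).Local v))) = 1 :=
    fun v => by simpa only [Subgroup.coe_prod] using hKH v
  have hzero := @adelicStableOrbitalIntegralH_eq_zero_of_forall_not_isArchNormPair L _ _ _ H γH
    (fun _ => borel _) (fun _ => ⟨rfl⟩) (fun _ => borel _) (fun _ => ⟨rfl⟩) (fun _ _ => borel _) (fun _ _ => ⟨rfl⟩) (fun _ => borel _) _ _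
    νH hνH _ hKH' hreg 𝔨.mH 𝔨.mHi (fun v => ((IsPinned.deltaTransfer 𝔨 h).1 v).2.1) (fun v => ((IsPinned.canonical 𝔨 h) v).1)
    (IsPinned.deltaTransfer 𝔨 h).2.2.2.1 TH hTH hTc hTa hTc' hTa' Tinf 𝔨.mGi T₂.arch harch₂ hno
  rw [IsPinned.sjH_eq 𝔨 h 𝒪H γH h𝒪H hreg fH, hfH', hzero, mul_zero]

open Literature.NumberTheory.Rogawski1990 in
open scoped Matrix MatrixGroups in
/-- **(K-VANISH) LAW T1b-VANISH AT A `G`-REGULAR CLASS, FOR EVERY PINNED KIT**: if the `G`-regular stable class `𝒪H = 𝒪′_st(γ_H)` of `H(L⁺)`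
transfers to NO stable class of `G′ = U(H)(L⁺)` (the kit's `transfersTo`, pinned by (xiii-c) to ★ `StableClassH.TransfersTo`), then
`SJ_H(𝒪H, f^H) = 0` for every transfer `f^H` of an inner-form test `f′`.  PROOF: by ★ `forall_not_isArchNormPair_of_forall_not_transfersTo`
(`OccurrenceOfArchMatch`: occurrence from an archimedean match, odd rank) `γ_H ⊗ 1` matches no element of `U(H)(L⁺ ⊗ ℝ)`; then
`IsPinned.sjH_eq_zero_of_forall_not_isArchNormPair`. [cite: Rogawski1990, Thm. 14.5.1 (a) p. 238; §14.1 p. 232; §14.3 p. 234] [cite: Landherr1936HermitianForms] -/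
theorem IsPinned.sjH_eq_zero_of_forall_not_transfersTo [MeasurableSpace (GpAdelic L H)] [BorelSpace (GpAdelic L H)]
    {ν : Measure (GpAdelic L H)} [ν.IsHaarMeasure] [ν.IsInvInvariant] {Tinf : Literature.NumberTheory.Rogawski1990.ArchTransferFactor L H}
    (h : 𝔨.IsPinned ν Tinf νH νG νGi νqi νHi) (hHh : (H.map (cmConjRingHom L))ᵀ = H) (hdet : H.det ≠ 0)
    (hνH : ∀ v, (νH v).IsHaarMeasure)
    (hKH : ∀ v : HeightOneSpectrum (𝓞 ↥(maximalRealSubfield L)),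
      νH v (((UnitaryGroup.cmLocalIntegralLevel L 2 (Matrix.of fun i j : Fin 2 => if i.val + j.val + 1 = 2 then (1 : L) else 0) v).prod
          (UnitaryGroup.cmLocalIntegralLevel L 1 (Matrix.of fun i j : Fin 1 => if i.val + j.val + 1 = 1 then (1 : L) else 0) v) :
            Subgroup (HLocal L v)) : Set (HLocal L v)) = 1)
    {𝒪H : 𝔨.StClassH} {γH : (UnitaryGroup.cmDatum L 2 (splitForm L 2)).Rational × (UnitaryGroup.cmDatum L 1 (splitForm L 1)).Rational}
    (h𝒪H : 𝔨.eStH 𝒪H = stableClassHOf (cmConjRingHom L) (splitForm L 2) (splitForm L 1) γH)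
    (hreg : IsGRegular (cmConjRingHom L) (splitForm L 2) (splitForm L 1) (splitForm L 3) endoForm_antidiagOne γH)
    {f' : TestGp L H} {fH : TestH L} (hfH : 𝔨.TransferH f' fH)
    (hno : ∀ 𝒪 : 𝔨.StClass, ¬ 𝔨.transfersTo 𝒪H 𝒪) :
    𝔨.SJH 𝒪H fH = 0 :=
  IsPinned.sjH_eq_zero_of_forall_not_isArchNormPair 𝔨 h hνH hKH h𝒪H hreg hfH
    (forall_not_isArchNormPair_of_forall_not_transfersTo L hHh hdet hreg fun 𝒪 h𝒪 =>
      hno (𝔨.eSt.symm 𝒪) ((IsPinned.transfersTo_iff 𝔨 h 𝒪H (𝔨.eSt.symm 𝒪)).mpr (by rw [h𝒪H, Equiv.apply_symm_apply]; exact h𝒪)))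

open Literature.NumberTheory.Rogawski1990 in
open scoped Matrix MatrixGroups in
/-- **(K-VANISH, all classes) LAW T1b-VANISH FOR EVERY PINNED KIT, modulo the value pin (xiii-0)**: on transfers `f′ ↦ f^H`, `SJ_H(𝒪H, f^H) = 0` at
every stable class `𝒪H` of `H(L⁺)` transferring to no class of `G′`.  The trichotomy on the ★ class `𝔨.eStH 𝒪H`: (1) `G`-REGULAR — ★ occurrence from an
archimedean match makes «no transfer ⇒ no archimedean match», and the archimedean factor of the Euler form of `Φ^{st,𝐀}_H` vanishes
(`IsPinned.sjH_eq_zero_of_forall_not_transfersTo`); (2) SEMISIMPLE image, NOT `G`-regular — VACUOUS: such a class ALWAYS transfers to the anisotropic inner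
form (★ (A1) `StableClassH.exists_transfersTo_of_not_isGRegular`, through pin (xiii-c)); (3) NON-semisimple image — the pin (xiii-0) `PinSJHOffSemisimple`.
[cite: Rogawski1990, Thm. 14.5.1 (a) p. 238; Lemma 14.5.2 (a) p. 238; §5.4 Prop. 5.4.1 p. 77; §14.1 p. 232] [cite: Landherr1936HermitianForms] -/
theorem IsPinned.lawT1bVanish_of_pinSJHOffSemisimple [MeasurableSpace (GpAdelic L H)] [BorelSpace (GpAdelic L H)]
    {ν : Measure (GpAdelic L H)} [ν.IsHaarMeasure] [ν.IsInvInvariant] {Tinf : Literature.NumberTheory.Rogawski1990.ArchTransferFactor L H}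
    (h : 𝔨.IsPinned ν Tinf νH νG νGi νqi νHi) (hHh : (H.map (cmConjRingHom L))ᵀ = H) (hdet : H.det ≠ 0)
    (hνH : ∀ v, (νH v).IsHaarMeasure)
    (hKH : ∀ v : HeightOneSpectrum (𝓞 ↥(maximalRealSubfield L)),
      νH v (((UnitaryGroup.cmLocalIntegralLevel L 2 (Matrix.of fun i j : Fin 2 => if i.val + j.val + 1 = 2 then (1 : L) else 0) v).prod
          (UnitaryGroup.cmLocalIntegralLevel L 1 (Matrix.of fun i j : Fin 1 => if i.val + j.val + 1 = 1 then (1 : L) else 0) v) :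
            Subgroup (HLocal L v)) : Set (HLocal L v)) = 1)
    (h₀ : 𝔨.PinSJHOffSemisimple) : 𝔨.LawT1bVanish := by
  intro f' f fH hm c' hno
  by_cases hss : ((𝔨.eStH c').endoImage Literature.NumberTheory.Rogawski1990.endoForm_antidiagOne).IsSemisimple
  · by_cases hreg : (𝔨.eStH c').IsGRegular Literature.NumberTheory.Rogawski1990.endoForm_antidiagOne
    · -- (1) `G`-regular: read the class at its chosen representative
      exact IsPinned.sjH_eq_zero_of_forall_not_transfersTo 𝔨 h hHh hdet hνH hKH (StableClassH.stableClassHOf_out (𝔨.eStH c')).symm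
        hreg.isGRegular_out hm.2 hno
    · -- (2) semisimple, not `G`-regular: the class transfers (★ (A1)) — contradiction
      exfalso
      obtain ⟨𝒪, h𝒪⟩ := StableClassH.exists_transfersTo_of_not_isGRegular Literature.NumberTheory.Rogawski1990.endoForm_antidiagOne
        (UnitaryGroup.antidiagOne_isHermitian L 3) (UnitaryGroup.isUnit_antidiagOne_det L 3).ne_zero H hHh hdet (𝔨.eStH c') hreg hss
      exact hno (𝔨.eSt.symm 𝒪) ((IsPinned.transfersTo_iff 𝔨 h c' (𝔨.eSt.symm 𝒪)).mpr (by rw [Equiv.apply_symm_apply]; exact h𝒪))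
  · -- (3) non-semisimple image: pin (xiii-0)
    exact h₀ c' fH hss

open Literature.NumberTheory.Rogawski1990 in
open scoped Matrix MatrixGroups in
/-- **«an `H`-class transfers to at most one `G′`-class», for every pinned kit** (pin (xiii-c) + ★ `StableClassH.TransfersTo.right_unique` + `eSt` injective) —
the `huniq` input of `ellipticStabilisation_of_parts`. [cite: Rogawski1990, §14.1 p. 232; Thm. 14.5.1 (a) p. 238] -/
theorem IsPinned.transfersTo_right_unique [MeasurableSpace (GpAdelic L H)] [BorelSpace (GpAdelic L H)]
    {ν : Measure (GpAdelic L H)} [ν.IsHaarMeasure] [ν.IsInvInvariant] {Tinf : Literature.NumberTheory.Rogawski1990.ArchTransferFactor L H}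
    (h : 𝔨.IsPinned ν Tinf νH νG νGi νqi νHi) (c' : 𝔨.StClassH) (c₁ c₂ : 𝔨.StClass)
    (h₁ : 𝔨.transfersTo c' c₁) (h₂ : 𝔨.transfersTo c' c₂) : c₁ = c₂ :=
  𝔨.eSt.injective (StableClassH.TransfersTo.right_unique ((IsPinned.transfersTo_iff 𝔨 h c' c₁).mp h₁) ((IsPinned.transfersTo_iff 𝔨 h c' c₂).mp h₂))

open Literature.NumberTheory.Rogawski1990 in
open scoped Matrix MatrixGroups in
/-- **LAW T1b `EllipticStabilisation` FOR EVERY PINNED KIT from T1a, T1b-reg, T1b-nonreg and the value pin (xiii-0)** (the sign-free assembly of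
SPEC-O7 v2.3a `ellipticStabilisation_of_parts` at `IsPinned` level): the finite supports are T1a's first conjunct and pins (xii-f)∕(xiii-f), the
uniqueness of the transfer target is `IsPinned.transfersTo_right_unique`, `Nonempty StClass` is the class of `1` through `eSt`, and T1b-vanish is
`IsPinned.lawT1bVanish_of_pinSJHOffSemisimple`.  What remains for T1b are exactly the two class-by-class closers `LawT1bReg` ((D2), ED 1.23 API §) and
`LawT1bNonreg` ((NR-M), ED 1.24). [cite: Rogawski1990, Thm. 14.5.1 (a) p. 238; §14.5 pp. 240–241] -/
theorem IsPinned.ellipticStabilisation_of_reg_nonreg_of_pinSJHOffSemisimple [MeasurableSpace (GpAdelic L H)] [BorelSpace (GpAdelic L H)]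
    {ν : Measure (GpAdelic L H)} [ν.IsHaarMeasure] [ν.IsInvInvariant] {Tinf : Literature.NumberTheory.Rogawski1990.ArchTransferFactor L H}
    (h : 𝔨.IsPinned ν Tinf νH νG νGi νqi νHi) (hHh : (H.map (cmConjRingHom L))ᵀ = H) (hdet : H.det ≠ 0)
    (hνH : ∀ v, (νH v).IsHaarMeasure)
    (hKH : ∀ v : HeightOneSpectrum (𝓞 ↥(maximalRealSubfield L)),
      νH v (((UnitaryGroup.cmLocalIntegralLevel L 2 (Matrix.of fun i j : Fin 2 => if i.val + j.val + 1 = 2 then (1 : L) else 0) v).prod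
          (UnitaryGroup.cmLocalIntegralLevel L 1 (Matrix.of fun i j : Fin 1 => if i.val + j.val + 1 = 1 then (1 : L) else 0) v) :
            Subgroup (HLocal L v)) : Set (HLocal L v)) = 1)
    (ha : 𝔨.SimpleTraceFormula) (hreg : 𝔨.LawT1bReg) (hnon : 𝔨.LawT1bNonreg) (h₀ : 𝔨.PinSJHOffSemisimple) :
    𝔨.EllipticStabilisation := by
  haveI : Nonempty 𝔨.StClass := ⟨𝔨.eSt.symm (stableClassOf (cmConjRingHom L) H 1)⟩
  exact 𝔨.ellipticStabilisation_of_parts (fun f' => (ha f').1) ((h.2.2.2.2.2.2.2.2.2.2.2.2.2.2.2.1 : 𝔨.PinSJGFinite)) ((h.2.2.2.2.2.2.2.2.2.2.2.2.2.2.2.2.2.2.2.1 : 𝔨.PinSJHFinite))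
    (IsPinned.transfersTo_right_unique 𝔨 h) hreg hnon (IsPinned.lawT1bVanish_of_pinSJHOffSemisimple 𝔨 h hHh hdet hνH hKH h₀)

open Literature.NumberTheory.Rogawski1990 in
open scoped Matrix MatrixGroups in
/-- **LAW T1b FOR EVERY PINNED KIT, modulo (NR-M) and the value pin (xiii-0) ONLY** (the shape ED 1.24's API § closes): T1a + the ∀-representative
regular class clause `hcl` (:= ED 1.23 `IsPinned.j_eq_sjG_add_half_sjHover_of_isRegularElt 𝔨 h hanis hherm hνG hK hνH hKH`) + `LawT1bNonreg` ((NR-M) v5)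
+ `PinSJHOffSemisimple` ⇒ `EllipticStabilisation`. [cite: Rogawski1990, Thm. 14.5.1 (a) p. 238; §14.5 pp. 238–241] -/
theorem IsPinned.ellipticStabilisation_of_clause_of_lawT1bNonreg [MeasurableSpace (GpAdelic L H)] [BorelSpace (GpAdelic L H)]
    {ν : Measure (GpAdelic L H)} [ν.IsHaarMeasure] [ν.IsInvInvariant] {Tinf : Literature.NumberTheory.Rogawski1990.ArchTransferFactor L H}
    (h : 𝔨.IsPinned ν Tinf νH νG νGi νqi νHi) (hanis : IsAnisotropic L H) (hherm : IsHermitianCM L H)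
    (hνH : ∀ v, (νH v).IsHaarMeasure)
    (hKH : ∀ v : HeightOneSpectrum (𝓞 ↥(maximalRealSubfield L)),
      νH v (((UnitaryGroup.cmLocalIntegralLevel L 2 (Matrix.of fun i j : Fin 2 => if i.val + j.val + 1 = 2 then (1 : L) else 0) v).prod
          (UnitaryGroup.cmLocalIntegralLevel L 1 (Matrix.of fun i j : Fin 1 => if i.val + j.val + 1 = 1 then (1 : L) else 0) v) :
            Subgroup (HLocal L v)) : Set (HLocal L v)) = 1)
    (ha : 𝔨.SimpleTraceFormula)
    (hcl : ∀ {𝒪 : 𝔨.StClass} {γ₀ : (UnitaryGroup.cmDatum L 3 H).Rational}, 𝔨.eSt 𝒪 = stableClassOf (cmConjRingHom L) H γ₀ →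
      IsRegularElt (γ₀.val : GL (Fin 3) L) → ∀ {f' : TestGp L H} {f : TestG L} {fH : TestH L}, 𝔨.Matches f' f fH →
      𝔨.J 𝒪 f' = 𝔨.SJG 𝒪 f + (1 / 2 : ℂ) * 𝔨.SJHover 𝒪 fH)
    (hnon : 𝔨.LawT1bNonreg) (h₀ : 𝔨.PinSJHOffSemisimple) : 𝔨.EllipticStabilisation :=
  IsPinned.ellipticStabilisation_of_reg_nonreg_of_pinSJHOffSemisimple 𝔨 h hherm
    (Literature.NumberTheory.Automorphic.Godement.det_ne_zero_of_anisotropic L H hanis) hνH hKH ha (𝔨.lawT1bReg_of_clause hcl) hnon h₀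


open Literature.NumberTheory.Rogawski1990 in
open scoped Matrix MatrixGroups in
/-- **(ed. 1.24a₁) LAW T1b-VANISH FOR EVERY PINNED KIT — NO RESIDUAL HYPOTHESIS**: `IsPinned.lawT1bVanish_of_pinSJHOffSemisimple` with the value pin
(xiii-0) read off `IsPinned` (`IsPinned.sjHOffSemisimple`, the LAST conjunct since ed. 1.24a₀). [cite: Rogawski1990, Thm. 14.5.1 (a) p. 238; Lemma 14.5.2 (a)
p. 238; §5.4 Prop. 5.4.1 p. 77] -/
theorem IsPinned.lawT1bVanish [MeasurableSpace (GpAdelic L H)] [BorelSpace (GpAdelic L H)]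
    {ν : Measure (GpAdelic L H)} [ν.IsHaarMeasure] [ν.IsInvInvariant] {Tinf : Literature.NumberTheory.Rogawski1990.ArchTransferFactor L H}
    (h : 𝔨.IsPinned ν Tinf νH νG νGi νqi νHi) (hHh : (H.map (cmConjRingHom L))ᵀ = H) (hdet : H.det ≠ 0)
    (hνH : ∀ v, (νH v).IsHaarMeasure)
    (hKH : ∀ v : HeightOneSpectrum (𝓞 ↥(maximalRealSubfield L)),
      νH v (((UnitaryGroup.cmLocalIntegralLevel L 2 (Matrix.of fun i j : Fin 2 => if i.val + j.val + 1 = 2 then (1 : L) else 0) v).prod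
          (UnitaryGroup.cmLocalIntegralLevel L 1 (Matrix.of fun i j : Fin 1 => if i.val + j.val + 1 = 1 then (1 : L) else 0) v) :
            Subgroup (HLocal L v)) : Set (HLocal L v)) = 1)
    : 𝔨.LawT1bVanish :=
  IsPinned.lawT1bVanish_of_pinSJHOffSemisimple 𝔨 h hHh hdet hνH hKH (IsPinned.sjHOffSemisimple 𝔨 h)

open Literature.NumberTheory.Rogawski1990 in
open scoped Matrix MatrixGroups in
/-- **(ed. 1.24a₁) LAW T1b FOR EVERY PINNED KIT MODULO (NR-M) ALONE**: T1a + `LawT1bNonreg` ⇒ `EllipticStabilisation` — the regular class clause is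
ED 1.23's `IsPinned.j_eq_sjG_add_half_sjHover_of_isRegularElt` (pin (viii⁵)), the vanishing pin (xiii-0) is `IsPinned.sjHOffSemisimple` (ed. 1.24a₀);
what remains of law T1b is the O7 row `LawT1bNonreg` (the singular ∕ central classes, ED 1.24b's API §). [cite: Rogawski1990, Thm. 14.5.1 (a) p. 238;
§14.5 pp. 238–241; §5.4 Prop. 5.4.1 pp. 72–77] -/
theorem IsPinned.ellipticStabilisation_of_lawT1bNonreg [MeasurableSpace (GpAdelic L H)] [BorelSpace (GpAdelic L H)]
    {ν : Measure (GpAdelic L H)} [ν.IsHaarMeasure] [ν.IsInvInvariant] {Tinf : Literature.NumberTheory.Rogawski1990.ArchTransferFactor L H}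
    (h : 𝔨.IsPinned ν Tinf νH νG νGi νqi νHi) (hanis : IsAnisotropic L H) (hherm : IsHermitianCM L H)
    (hνG : ∀ v, (νG v).IsHaarMeasure) (hK : ∀ v : HeightOneSpectrum (𝓞 ↥(maximalRealSubfield L)), νG v (UnitaryGroup.cmLocalIntegralLevel L 3 H v : Set (GpLocal L H v)) = 1)
    (hνH : ∀ v, (νH v).IsHaarMeasure)
    (hKH : ∀ v : HeightOneSpectrum (𝓞 ↥(maximalRealSubfield L)),
      νH v (((UnitaryGroup.cmLocalIntegralLevel L 2 (Matrix.of fun i j : Fin 2 => if i.val + j.val + 1 = 2 then (1 : L) else 0) v).prod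
          (UnitaryGroup.cmLocalIntegralLevel L 1 (Matrix.of fun i j : Fin 1 => if i.val + j.val + 1 = 1 then (1 : L) else 0) v) :
            Subgroup (HLocal L v)) : Set (HLocal L v)) = 1)
    (ha : 𝔨.SimpleTraceFormula) (hnon : 𝔨.LawT1bNonreg) : 𝔨.EllipticStabilisation :=
  IsPinned.ellipticStabilisation_of_clause_of_lawT1bNonreg 𝔨 h hanis hherm hνH hKH ha
    (fun h𝒪 hreg _ _ _ hm => IsPinned.j_eq_sjG_add_half_sjHover_of_isRegularElt 𝔨 h hanis hherm hνG hK hνH hKH h𝒪 hreg hm) hnon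
    (IsPinned.sjHOffSemisimple 𝔨 h)

end PinnedCanonical

/-! ## (ed. 1.24b) (M-c) «CONVERSE TRANSFER PINS» — API-side corollaries over the pin texts (F0P3a-p01 (g6) thin block fd593f13 §C, VERBATIM; key them on a pinned kit with `IsPinned.transfer_iff_local` ∕ `.transferH_iff_local` ∕ `.localUnitTransfer_off`) -/

section PinnedCanonicalMc


/-- **«locally matching test tensors ⇒ `Transfer`»** from (ix′-c). [cite: Rogawski1990, §14.2 (14.2.1) pp. 232–233] -/
theorem transfer_of_local (hT : 𝔨.PinTransferIff) {f' : TestGp L H} {f : TestG L}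
    (T : UnitaryGroup.PureTensor L 3 H) (T' : UnitaryGroup.PureTensor L 3 (splitForm L 3)) (h₁ : T.IsTest) (h₂ : T'.IsTest)
    (hf' : ⇑f' = T.eval) (hf : ⇑f = T'.eval) (hloc : ∀ v, T'.loc v = T.loc v ∘ (𝔨.ψ v).symm)
    (harch : letI : ∀ γ : UnitaryGroup.arch (↥(maximalRealSubfield L)) L (IsCMField.complexConj L) 3 H,
        MeasurableSpace (UnitaryGroup.arch (↥(maximalRealSubfield L)) L (IsCMField.complexConj L) 3 H ⧸
          Subgroup.centralizer ({γ} : Set (UnitaryGroup.arch (↥(maximalRealSubfield L)) L (IsCMField.complexConj L) 3 H))) := fun _ => borel _;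
      letI : ∀ γ : UnitaryGroup.arch (↥(maximalRealSubfield L)) L (IsCMField.complexConj L) 3 (splitForm L 3),
        MeasurableSpace (UnitaryGroup.arch (↥(maximalRealSubfield L)) L (IsCMField.complexConj L) 3 (splitForm L 3) ⧸
          Subgroup.centralizer ({γ} : Set (UnitaryGroup.arch (↥(maximalRealSubfield L)) L (IsCMField.complexConj L) 3 (splitForm L 3)))) := fun _ => borel _;
      Literature.NumberTheory.Rogawski1990.IsArchInnerTransfer L H 𝔨.mGi 𝔨.mqi T.arch T'.arch) :
    𝔨.Transfer f' f :=
  (hT f' f).mpr ⟨T, T', ⟨h₁, h₂⟩, hf', hf, hloc, harch⟩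

/-- **«`Transfer` ⇒ locally matching test tensors»** from (ix′-c) (= the forward pin (ix′), now a consequence). [cite: Rogawski1990, §14.2 (14.2.1) pp. 232–233] -/
theorem local_of_transfer (hT : 𝔨.PinTransferIff) {f' : TestGp L H} {f : TestG L} (h : 𝔨.Transfer f' f) :
  letI : ∀ γ : UnitaryGroup.arch (↥(maximalRealSubfield L)) L (IsCMField.complexConj L) 3 H,
        MeasurableSpace (UnitaryGroup.arch (↥(maximalRealSubfield L)) L (IsCMField.complexConj L) 3 H ⧸ Subgroup.centralizer ({γ} : Set (UnitaryGroup.arch (↥(maximalRealSubfield L)) L (IsCMField.complexConj L) 3 H))) := fun _ => borel _;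
    letI : ∀ γ : UnitaryGroup.arch (↥(maximalRealSubfield L)) L (IsCMField.complexConj L) 3
          (Matrix.of fun i j : Fin 3 => if i.val + j.val + 1 = 3 then (1 : L) else 0),
        MeasurableSpace (UnitaryGroup.arch (↥(maximalRealSubfield L)) L (IsCMField.complexConj L) 3
          (Matrix.of fun i j : Fin 3 => if i.val + j.val + 1 = 3 then (1 : L) else 0) ⧸
          Subgroup.centralizer ({γ} : Set (UnitaryGroup.arch (↥(maximalRealSubfield L)) L (IsCMField.complexConj L) 3
          (Matrix.of fun i j : Fin 3 => if i.val + j.val + 1 = 3 then (1 : L) else 0)))) := fun _ => borel _;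
    ∃ (T : UnitaryGroup.PureTensor L 3 H) (T' : UnitaryGroup.PureTensor L 3 (splitForm L 3)),
      (T.IsTest ∧ T'.IsTest) ∧ ⇑f' = T.eval ∧ ⇑f = T'.eval ∧ (∀ v, T'.loc v = T.loc v ∘ (𝔨.ψ v).symm) ∧
      Literature.NumberTheory.Rogawski1990.IsArchInnerTransfer L H 𝔨.mGi 𝔨.mqi T.arch T'.arch :=
  (hT f' f).mp h

/-- **«placewise Δ-matching tensors with `T^H.S ⊆ T.S` ⇒ `TransferH`»** from (xi″-c): the away-clause holds for EVERY `S₁` when the bad set of `T^H` is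
inside that of `T` (the shape of P3's tensors of record `f′_S ⊗ f^S`, `f^H_S ⊗ b_H(f^S)`). [cite: Rogawski1990, §14.3 pp. 233–234; §4.9 Prop. 4.9.1 p. 55] -/
theorem transferH_of_local {Tinf : Literature.NumberTheory.Rogawski1990.ArchTransferFactor L H} (hH : 𝔨.PinTransferHIff Tinf)
    {f' : TestGp L H} {fH : TestH L}
    (T : UnitaryGroup.PureTensor L 3 H) (TH : UnitaryGroup.PureTensor₂ L (splitForm L 2) (splitForm L 1))
    (hT : T.IsTest) (hTH : TH.IsUnramified₂) (hsm : ∀ v ∈ TH.S, Literature.NumberTheory.Rogawski1990.IsLocSmooth (TH.loc v))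
    (ha : Literature.NumberTheory.Rogawski1990.ArchSmooth₂ L TH.arch) (hf' : ⇑f' = T.eval) (hfH : ⇑fH = TH.eval) (hS : TH.S ⊆ T.S)
    (hΔ : letI : ∀ (v : HeightOneSpectrum (𝓞 ↥(maximalRealSubfield L))) (a : HLocal L v),
        MeasurableSpace (HLocal L v ⧸ Subgroup.centralizer ({a} : Set (HLocal L v))) := fun _ _ => borel _;
    haveI : ∀ (v : HeightOneSpectrum (𝓞 ↥(maximalRealSubfield L))) (a : HLocal L v),
        BorelSpace (HLocal L v ⧸ Subgroup.centralizer ({a} : Set (HLocal L v))) := fun _ _ => ⟨rfl⟩;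
    letI : ∀ (v : HeightOneSpectrum (𝓞 ↥(maximalRealSubfield L))) (γ : (UnitaryGroup.cmDatum L 3 H).Local v),
        MeasurableSpace ((UnitaryGroup.cmDatum L 3 H).Local v ⧸
          Subgroup.centralizer ({γ} : Set ((UnitaryGroup.cmDatum L 3 H).Local v))) := fun _ _ => borel _;
    haveI : ∀ (v : HeightOneSpectrum (𝓞 ↥(maximalRealSubfield L))) (γ : (UnitaryGroup.cmDatum L 3 H).Local v),
        BorelSpace ((UnitaryGroup.cmDatum L 3 H).Local v ⧸
          Subgroup.centralizer ({γ} : Set ((UnitaryGroup.cmDatum L 3 H).Local v))) := fun _ _ => ⟨rfl⟩;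
      ∀ v, Literature.NumberTheory.Rogawski1990.IsLocalDeltaTransfer L H v (𝔨.Δ v) (𝔨.mH v) (𝔨.mG v) (TH.loc v) (T.loc v))
    (hΔi : letI : ∀ a : (UnitaryGroup.arch (↥(maximalRealSubfield L)) L (IsCMField.complexConj L) 2 (splitForm L 2) ×
          UnitaryGroup.arch (↥(maximalRealSubfield L)) L (IsCMField.complexConj L) 1 (splitForm L 1)),
        MeasurableSpace ((UnitaryGroup.arch (↥(maximalRealSubfield L)) L (IsCMField.complexConj L) 2 (splitForm L 2) ×
          UnitaryGroup.arch (↥(maximalRealSubfield L)) L (IsCMField.complexConj L) 1 (splitForm L 1)) ⧸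
          Subgroup.centralizer ({a} : Set (UnitaryGroup.arch (↥(maximalRealSubfield L)) L (IsCMField.complexConj L) 2 (splitForm L 2) ×
          UnitaryGroup.arch (↥(maximalRealSubfield L)) L (IsCMField.complexConj L) 1 (splitForm L 1)))) := fun _ => borel _;
      letI : ∀ γ : UnitaryGroup.arch (↥(maximalRealSubfield L)) L (IsCMField.complexConj L) 3 H,
        MeasurableSpace (UnitaryGroup.arch (↥(maximalRealSubfield L)) L (IsCMField.complexConj L) 3 H ⧸
          Subgroup.centralizer ({γ} : Set (UnitaryGroup.arch (↥(maximalRealSubfield L)) L (IsCMField.complexConj L) 3 H))) := fun _ => borel _;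
      Literature.NumberTheory.Rogawski1990.IsArchDeltaTransfer L H Tinf 𝔨.mHi 𝔨.mGi TH.arch T.arch) :
    𝔨.TransferH f' fH := by
  classical
  obtain ⟨S₁, h⟩ := hH
  exact (h f' fH).mpr ⟨⟨T, TH, hT.isUnramified, hTH, hf', hfH, hS.trans Finset.subset_union_right⟩,
    T, TH, ⟨hT, hTH, hsm, ha⟩, hf', hfH, hΔ, hΔi⟩

/-- **the unit FL at a place off the exceptional set** from (xi-u). [cite: Rogawski1990, §4.9 Prop. 4.9.1 (b) p. 55] -/
theorem localUnitTransfer_of_not_mem (hU : 𝔨.PinLocalUnitTransferOff) :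
  letI : ∀ (v : HeightOneSpectrum (𝓞 ↥(maximalRealSubfield L))) (a : HLocal L v),
        MeasurableSpace (HLocal L v ⧸ Subgroup.centralizer ({a} : Set (HLocal L v))) := fun _ _ => borel _;
    haveI : ∀ (v : HeightOneSpectrum (𝓞 ↥(maximalRealSubfield L))) (a : HLocal L v),
        BorelSpace (HLocal L v ⧸ Subgroup.centralizer ({a} : Set (HLocal L v))) := fun _ _ => ⟨rfl⟩;
    letI : ∀ (v : HeightOneSpectrum (𝓞 ↥(maximalRealSubfield L))) (γ : (UnitaryGroup.cmDatum L 3 H).Local v),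
        MeasurableSpace ((UnitaryGroup.cmDatum L 3 H).Local v ⧸
          Subgroup.centralizer ({γ} : Set ((UnitaryGroup.cmDatum L 3 H).Local v))) := fun _ _ => borel _;
    haveI : ∀ (v : HeightOneSpectrum (𝓞 ↥(maximalRealSubfield L))) (γ : (UnitaryGroup.cmDatum L 3 H).Local v),
        BorelSpace ((UnitaryGroup.cmDatum L 3 H).Local v ⧸
          Subgroup.centralizer ({γ} : Set ((UnitaryGroup.cmDatum L 3 H).Local v))) := fun _ _ => ⟨rfl⟩;
    ∃ Su : Finset (HeightOneSpectrum (𝓞 ↥(maximalRealSubfield L))), ∀ v ∉ Su,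
      Literature.NumberTheory.Rogawski1990.IsLocalUnitTransfer L H v (𝔨.Δ v) (𝔨.mH v) (𝔨.mG v) :=
  hU

end PinnedCanonicalMc

end ComparisonKit

/-! ### (J2′-b) The `Q`-threaded kit-level export (ed. 1.23b, RULING #117) -/

section PackageAndExport

/-- **(J2′-b) A PINNED KIT AT THE PACKAGE'S OWN WITNESS, WITH A RIDER `Q`** (ed. 1.23b, RULING #117; F0P3b (J2), F0P3 (J1), REF1 R-21 (iii)): from the
stubs and the ED. 5 fact ★ `GlobalTransferWithStabilisationPackageAnd L H T_∞.Δ ν_H ν_G Q` (the ED. 4 package AND a clause bundle `Q Δ m_H m_G` on the SAME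
witness) + ★ `ArchTransfersExistCanonicalSingular` (ed. 1.24b: the (F-0)∕(F-1) antecedents of MAIN's `anchorWitness_exists_of_packageAnd`, mirrored), a PINNED kit `𝔨` with `TransferExistence`, `SimpleTraceFormula`, pure-smooth-tensor partners AND `Q 𝔨.Δ 𝔨.mH mG₀` —
`Q` read at `(𝔨.Δ, 𝔨.mH, mG₀)` where `mG₀` is the package's REGULAR local family, which AGREES WITH the kit's `𝔨.mG` AT EVERY REGULAR CLASS (ed. 1.24b, (F-1): the kit's `mG` is the PATCHED family `w.mGp` = `w.mG` at the regular classes, the singular package's member elsewhere — `AnchorWitness.mGp_of_isRegularElt`; `𝔨.Δ, 𝔨.mH` are still `w.Δ, w.mH` by `rfl`), which `….to_package` into the frozen head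
cannot give (the Δ-twist caveat: the ED. 4 clauses are invariant under `Δ ↦ θ_H·Δ`, a CM character identity `Q` is not).  GENERIC in `Q`: serves
`Q := CMCharIdentityPackage …` (★ `GlobalTransferWithCMCharIdentities`) and rung 0's one-existential `Q_{K0}`.  Composition of MAIN's
`anchorWitness_exists_of_packageAnd` with §5.1's per-pin discharges; the head `engineT1_of_stubs` is untouched.
[cite: Rogawski1990, §14.5 p. 237; §4.9 Prop. 4.9.1 p. 55; §13.1 Prop. 13.1.4 p. 199] -/
theorem anchoredKit_nonempty_of_stubsQ [MeasurableSpace (GpAdelic L H)] [BorelSpace (GpAdelic L H)]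
    (ν : Measure (GpAdelic L H)) [ν.IsHaarMeasure] [ν.IsInvInvariant]
    [∀ v : HeightOneSpectrum (𝓞 ↥(maximalRealSubfield L)), MeasurableSpace (HLocal L v)] [∀ v : HeightOneSpectrum (𝓞 ↥(maximalRealSubfield L)), BorelSpace (HLocal L v)]
    [∀ v : HeightOneSpectrum (𝓞 ↥(maximalRealSubfield L)), MeasurableSpace (GpLocal L H v)] [∀ v : HeightOneSpectrum (𝓞 ↥(maximalRealSubfield L)), BorelSpace (GpLocal L H v)]
    [MeasurableSpace (GpInf L H)] [BorelSpace (GpInf L H)] [MeasurableSpace (GInf L)] [BorelSpace (GInf L)]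
    [MeasurableSpace (HInf L)] [BorelSpace (HInf L)]
    (νH : ∀ v : HeightOneSpectrum (𝓞 ↥(maximalRealSubfield L)), Measure (HLocal L v)) (νG : ∀ v : HeightOneSpectrum (𝓞 ↥(maximalRealSubfield L)), Measure (GpLocal L H v))
    [∀ v, IsFiniteMeasureOnCompacts (νH v)] [∀ v, (νH v).IsMulRightInvariant]
    [∀ v, (νG v).IsHaarMeasure] [∀ v, (νG v).IsMulRightInvariant]
    (νGi : Measure (GpInf L H)) (νqi : Measure (GInf L)) (νHi : Measure (HInf L))
    [IsFiniteMeasureOnCompacts νGi] [νGi.IsMulRightInvariant] [IsFiniteMeasureOnCompacts νqi] [νqi.IsMulRightInvariant]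
    [IsFiniteMeasureOnCompacts νHi] [νHi.IsMulRightInvariant]
    (h3 : StubT1cSplitFormAutomorphicMeasure L)
    (Tinf : Literature.NumberTheory.Rogawski1990.ArchTransferFactor L H)
    (hK : ∀ v : HeightOneSpectrum (𝓞 ↥(maximalRealSubfield L)), νG v (UnitaryGroup.cmLocalIntegralLevel L 3 H v : Set (GpLocal L H v)) = 1)
    (hKH : ∀ v : HeightOneSpectrum (𝓞 ↥(maximalRealSubfield L)),
      νH v (((UnitaryGroup.cmLocalIntegralLevel L 2 (Matrix.of fun i j : Fin 2 => if i.val + j.val + 1 = 2 then (1 : L) else 0) v).prod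
          (UnitaryGroup.cmLocalIntegralLevel L 1 (Matrix.of fun i j : Fin 1 => if i.val + j.val + 1 = 1 then (1 : L) else 0) v) :
            Subgroup (HLocal L v)) : Set (HLocal L v)) = 1)
    {Q : letI : ∀ (v : HeightOneSpectrum (𝓞 ↥(maximalRealSubfield L))) (a : HLocal L v),
          MeasurableSpace (HLocal L v ⧸ Subgroup.centralizer ({a} : Set (HLocal L v))) := fun _ _ => borel _
      letI : ∀ (v : HeightOneSpectrum (𝓞 ↥(maximalRealSubfield L))) (γ : (UnitaryGroup.cmDatum L 3 H).Local v),
          MeasurableSpace ((UnitaryGroup.cmDatum L 3 H).Local v ⧸ Subgroup.centralizer ({γ} : Set ((UnitaryGroup.cmDatum L 3 H).Local v))) :=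
        fun _ _ => borel _
      (∀ v : HeightOneSpectrum (𝓞 ↥(maximalRealSubfield L)), Literature.NumberTheory.Rogawski1990.LocalTransferFactor L H v) →
      (∀ v : HeightOneSpectrum (𝓞 ↥(maximalRealSubfield L)), OrbitalMeasureFamily (HLocal L v)) →
      (∀ v : HeightOneSpectrum (𝓞 ↥(maximalRealSubfield L)), OrbitalMeasureFamily ((UnitaryGroup.cmDatum L 3 H).Local v)) → Prop}
    (hGTQ : Literature.NumberTheory.Rogawski1990.GlobalTransferWithStabilisationPackageAnd L H Tinf.Δ νH νG Q)
    (hAT₄ : Literature.NumberTheory.Rogawski1990.ArchTransfersExistCanonicalSingular L H Tinf νGi νqi νHi)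
    (hSET :
      letI : ∀ (v : HeightOneSpectrum (𝓞 ↥(maximalRealSubfield L))) (γ : (UnitaryGroup.cmDatum L 3 H).Local v),
        MeasurableSpace ((UnitaryGroup.cmDatum L 3 H).Local v ⧸
          Subgroup.centralizer ({γ} : Set ((UnitaryGroup.cmDatum L 3 H).Local v))) := fun _ _ => borel _;
      haveI : ∀ (v : HeightOneSpectrum (𝓞 ↥(maximalRealSubfield L))) (γ : (UnitaryGroup.cmDatum L 3 H).Local v),
        BorelSpace ((UnitaryGroup.cmDatum L 3 H).Local v ⧸
          Subgroup.centralizer ({γ} : Set ((UnitaryGroup.cmDatum L 3 H).Local v))) := fun _ _ => ⟨rfl⟩;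
      letI : ∀ g : GpAdelic L H, MeasurableSpace (GpAdelic L H ⧸ Subgroup.centralizer ({g} : Set (GpAdelic L H))) := fun _ => borel _;
      haveI : ∀ g : GpAdelic L H, BorelSpace (GpAdelic L H ⧸ Subgroup.centralizer ({g} : Set (GpAdelic L H))) := fun _ => ⟨rfl⟩;
      letI : ∀ γ : GpInf L H, MeasurableSpace (GpInf L H ⧸ Subgroup.centralizer ({γ} : Set (GpInf L H))) := fun _ => borel _;
      haveI : ∀ γ : GpInf L H, BorelSpace (GpInf L H ⧸ Subgroup.centralizer ({γ} : Set (GpInf L H))) := fun _ => ⟨rfl⟩;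
      letI : ∀ γ : GInf L, MeasurableSpace (GInf L ⧸ Subgroup.centralizer ({γ} : Set (GInf L))) := fun _ => borel _;
      haveI : ∀ γ : GInf L, BorelSpace (GInf L ⧸ Subgroup.centralizer ({γ} : Set (GInf L))) := fun _ => ⟨rfl⟩;
      letI : ∀ (v : HeightOneSpectrum (𝓞 ↥(maximalRealSubfield L))) (a : HLocal L v),
        MeasurableSpace (HLocal L v ⧸ Subgroup.centralizer ({a} : Set (HLocal L v))) := fun _ _ => borel _;
      haveI : ∀ (v : HeightOneSpectrum (𝓞 ↥(maximalRealSubfield L))) (a : HLocal L v),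
        BorelSpace (HLocal L v ⧸ Subgroup.centralizer ({a} : Set (HLocal L v))) := fun _ _ => ⟨rfl⟩;
      letI : ∀ a : HInf L, MeasurableSpace (HInf L ⧸ Subgroup.centralizer ({a} : Set (HInf L))) := fun _ => borel _;
      haveI : ∀ a : HInf L, BorelSpace (HInf L ⧸ Subgroup.centralizer ({a} : Set (HInf L))) := fun _ => ⟨rfl⟩;
      letI : ∀ γ : GpAdelic L H, MeasurableSpace (↥(Subgroup.centralizer ({γ} : Set (GpAdelic L H))) ⧸
        ((UnitaryGroup.cmDatum L 3 H).quotientSubgroup ⊓ Subgroup.centralizer ({γ} : Set (GpAdelic L H))).subgroupOf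
          (Subgroup.centralizer ({γ} : Set (GpAdelic L H)))) := fun _ => borel _;
      haveI : ∀ γ : GpAdelic L H, BorelSpace (↥(Subgroup.centralizer ({γ} : Set (GpAdelic L H))) ⧸
        ((UnitaryGroup.cmDatum L 3 H).quotientSubgroup ⊓ Subgroup.centralizer ({γ} : Set (GpAdelic L H))).subgroupOf
          (Subgroup.centralizer ({γ} : Set (GpAdelic L H)))) := fun _ => ⟨rfl⟩;
      haveI hCcl : ∀ γ : GpAdelic L H, IsClosed ((Subgroup.centralizer ({γ} : Set (GpAdelic L H)) : Subgroup (GpAdelic L H)) : Set (GpAdelic L H)) :=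
        fun γ => UnitaryGroup.isClosed_centralizer_cmDatum L 3 H γ;
      haveI : ∀ γ : GpAdelic L H, (Measure.count : Measure ↥(((UnitaryGroup.cmDatum L 3 H).quotientSubgroup ⊓
        Subgroup.centralizer ({γ} : Set (GpAdelic L H))).subgroupOf (Subgroup.centralizer ({γ} : Set (GpAdelic L H))))).IsHaarMeasure :=
        fun γ => UnitaryGroup.isHaarMeasure_count_quotientSubgroup_inf_centralizer_subgroupOf L 3 H γ;
      haveI : ν.IsMulRightInvariant := by
        have h : ν.inv.IsMulRightInvariant := inferInstance
        rwa [Measure.inv_eq_self] at h;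
      Literature.NumberTheory.Rogawski1990.SingularEllipticTransferCanonical L H Tinf νH νG νGi νqi νHi ν)
    (hanis : IsAnisotropic L H) (hherm : IsHermitianCM L H) :
    ∃ 𝔨 : ComparisonKit L H μ, 𝔨.IsPinned ν Tinf νH νG νGi νqi νHi ∧ 𝔨.TransferExistence ∧ 𝔨.SimpleTraceFormula ∧
      (∀ f' : TestGp L H, 𝔨.Smooth f' → ∃ f : TestG L, 𝔨.Transfer f' f ∧
        ∃ T' : UnitaryGroup.PureTensor L 3 (splitForm L 3), T'.IsTest ∧ ⇑f = T'.eval) ∧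
      (letI : ∀ (v : HeightOneSpectrum (𝓞 ↥(maximalRealSubfield L))) (γ : (UnitaryGroup.cmDatum L 3 H).Local v),
          MeasurableSpace ((UnitaryGroup.cmDatum L 3 H).Local v ⧸ Subgroup.centralizer ({γ} : Set ((UnitaryGroup.cmDatum L 3 H).Local v))) :=
        fun _ _ => borel _
      ∃ mG₀ : ∀ v : HeightOneSpectrum (𝓞 ↥(maximalRealSubfield L)), OrbitalMeasureFamily ((UnitaryGroup.cmDatum L 3 H).Local v),
        (∀ (v : HeightOneSpectrum (𝓞 ↥(maximalRealSubfield L))) (c' : ConjClasses ((UnitaryGroup.cmDatum L 3 H).Local v)),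
          Literature.NumberTheory.Rogawski1990.IsRegularElt ((Quotient.out c').val : GL (Fin 3) (UnitaryGroup.LocalRing L v)) → 𝔨.mG v c' = mG₀ v c') ∧
        Q 𝔨.Δ 𝔨.mH mG₀) := by
  obtain ⟨w, hq⟩ := anchorWitness_exists_of_packageAnd L H μ ν νH νG νGi νqi νHi h3 Tinf hK hKH hGTQ hAT₄ hSET hanis hherm
  exact ⟨w.kit, w.isPinned, w.transferExistence, w.simpleTraceFormula, w.smooth_partner, w.mG, fun v c' hc => w.mGp_of_isRegularElt v c' hc, hq⟩

/-- **(J2′-b-loc) THE SAME EXPORT, HANDING ALSO THE LOCAL PINS OF THE PACKAGE'S OWN WITNESS** (ed. 1.25 «LOC EXPORT» — closer edition ED. 41 «Δ‴-PINS EXPOSED»,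
LEAD F0P3a-plan (g13) T12-35∕T12-36, desk F0P3-plan (g14) D69″ L0, LHref-S (g2) (E1)): `anchoredKit_nonempty_of_stubsQ` VERBATIM (same binders, same proof over MAIN's
`anchorWitness_exists_of_packageAnd`) with ONE extra conjunct read off the anchor witness's field `AnchorWitness.hloc` (MAIN :292), which the old export forgets:
at every finite `v`, the local transfer DATUM `IsLocalTransferDatum L H v (𝔨.Δ v) (𝔨.mH v) (mG₀ v)` (nondegeneracy, admissibility and Prop. 4.9.1 (a)'s `Δ_v`-transfer
for `C_c^∞`) AND the canonicity of the export's regular family `mG₀ v` for `νG v` — at the kit's OWN `(𝔨.Δ, 𝔨.mH)` (`w.kit.Δ ≡ w.Δ`, `w.kit.mH ≡ w.mH` by `rfl`,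
MAIN :894–:895) and the UNPATCHED `mG₀ = w.mG`.  Consumed by the closer's `Kit.nonempty_rung0Choice_of` (KitD ED. 6) to fill the `Rung0Choice` fields `hloc₀ ∕ hcan₀`
that the LH10 «(D-b)ᵀ» Day-X junction reads ((G2b)(G3) of LHref-S's rehearsal).  The old export above is byte-identical; nothing else in this file moves.
[cite: Rogawski1990, §14.5 p. 237; §4.9 Prop. 4.9.1 (a) p. 55; §4.3 (4.3.1) p. 43; §13.1 Prop. 13.1.4 p. 199] -/
theorem anchoredKit_nonempty_of_stubsQ_loc [MeasurableSpace (GpAdelic L H)] [BorelSpace (GpAdelic L H)]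
    (ν : Measure (GpAdelic L H)) [ν.IsHaarMeasure] [ν.IsInvInvariant]
    [∀ v : HeightOneSpectrum (𝓞 ↥(maximalRealSubfield L)), MeasurableSpace (HLocal L v)] [∀ v : HeightOneSpectrum (𝓞 ↥(maximalRealSubfield L)), BorelSpace (HLocal L v)]
    [∀ v : HeightOneSpectrum (𝓞 ↥(maximalRealSubfield L)), MeasurableSpace (GpLocal L H v)] [∀ v : HeightOneSpectrum (𝓞 ↥(maximalRealSubfield L)), BorelSpace (GpLocal L H v)]
    [MeasurableSpace (GpInf L H)] [BorelSpace (GpInf L H)] [MeasurableSpace (GInf L)] [BorelSpace (GInf L)]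
    [MeasurableSpace (HInf L)] [BorelSpace (HInf L)]
    (νH : ∀ v : HeightOneSpectrum (𝓞 ↥(maximalRealSubfield L)), Measure (HLocal L v)) (νG : ∀ v : HeightOneSpectrum (𝓞 ↥(maximalRealSubfield L)), Measure (GpLocal L H v))
    [∀ v, IsFiniteMeasureOnCompacts (νH v)] [∀ v, (νH v).IsMulRightInvariant]
    [∀ v, (νG v).IsHaarMeasure] [∀ v, (νG v).IsMulRightInvariant]
    (νGi : Measure (GpInf L H)) (νqi : Measure (GInf L)) (νHi : Measure (HInf L))
    [IsFiniteMeasureOnCompacts νGi] [νGi.IsMulRightInvariant] [IsFiniteMeasureOnCompacts νqi] [νqi.IsMulRightInvariant]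
    [IsFiniteMeasureOnCompacts νHi] [νHi.IsMulRightInvariant]
    (h3 : StubT1cSplitFormAutomorphicMeasure L)
    (Tinf : Literature.NumberTheory.Rogawski1990.ArchTransferFactor L H)
    (hK : ∀ v : HeightOneSpectrum (𝓞 ↥(maximalRealSubfield L)), νG v (UnitaryGroup.cmLocalIntegralLevel L 3 H v : Set (GpLocal L H v)) = 1)
    (hKH : ∀ v : HeightOneSpectrum (𝓞 ↥(maximalRealSubfield L)),
      νH v (((UnitaryGroup.cmLocalIntegralLevel L 2 (Matrix.of fun i j : Fin 2 => if i.val + j.val + 1 = 2 then (1 : L) else 0) v).prod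
          (UnitaryGroup.cmLocalIntegralLevel L 1 (Matrix.of fun i j : Fin 1 => if i.val + j.val + 1 = 1 then (1 : L) else 0) v) :
            Subgroup (HLocal L v)) : Set (HLocal L v)) = 1)
    {Q : letI : ∀ (v : HeightOneSpectrum (𝓞 ↥(maximalRealSubfield L))) (a : HLocal L v),
          MeasurableSpace (HLocal L v ⧸ Subgroup.centralizer ({a} : Set (HLocal L v))) := fun _ _ => borel _
      letI : ∀ (v : HeightOneSpectrum (𝓞 ↥(maximalRealSubfield L))) (γ : (UnitaryGroup.cmDatum L 3 H).Local v),
          MeasurableSpace ((UnitaryGroup.cmDatum L 3 H).Local v ⧸ Subgroup.centralizer ({γ} : Set ((UnitaryGroup.cmDatum L 3 H).Local v))) :=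
        fun _ _ => borel _
      (∀ v : HeightOneSpectrum (𝓞 ↥(maximalRealSubfield L)), Literature.NumberTheory.Rogawski1990.LocalTransferFactor L H v) →
      (∀ v : HeightOneSpectrum (𝓞 ↥(maximalRealSubfield L)), OrbitalMeasureFamily (HLocal L v)) →
      (∀ v : HeightOneSpectrum (𝓞 ↥(maximalRealSubfield L)), OrbitalMeasureFamily ((UnitaryGroup.cmDatum L 3 H).Local v)) → Prop}
    (hGTQ : Literature.NumberTheory.Rogawski1990.GlobalTransferWithStabilisationPackageAnd L H Tinf.Δ νH νG Q)
    (hAT₄ : Literature.NumberTheory.Rogawski1990.ArchTransfersExistCanonicalSingular L H Tinf νGi νqi νHi)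
    (hSET :
      letI : ∀ (v : HeightOneSpectrum (𝓞 ↥(maximalRealSubfield L))) (γ : (UnitaryGroup.cmDatum L 3 H).Local v),
        MeasurableSpace ((UnitaryGroup.cmDatum L 3 H).Local v ⧸
          Subgroup.centralizer ({γ} : Set ((UnitaryGroup.cmDatum L 3 H).Local v))) := fun _ _ => borel _;
      haveI : ∀ (v : HeightOneSpectrum (𝓞 ↥(maximalRealSubfield L))) (γ : (UnitaryGroup.cmDatum L 3 H).Local v),
        BorelSpace ((UnitaryGroup.cmDatum L 3 H).Local v ⧸
          Subgroup.centralizer ({γ} : Set ((UnitaryGroup.cmDatum L 3 H).Local v))) := fun _ _ => ⟨rfl⟩;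
      letI : ∀ g : GpAdelic L H, MeasurableSpace (GpAdelic L H ⧸ Subgroup.centralizer ({g} : Set (GpAdelic L H))) := fun _ => borel _;
      haveI : ∀ g : GpAdelic L H, BorelSpace (GpAdelic L H ⧸ Subgroup.centralizer ({g} : Set (GpAdelic L H))) := fun _ => ⟨rfl⟩;
      letI : ∀ γ : GpInf L H, MeasurableSpace (GpInf L H ⧸ Subgroup.centralizer ({γ} : Set (GpInf L H))) := fun _ => borel _;
      haveI : ∀ γ : GpInf L H, BorelSpace (GpInf L H ⧸ Subgroup.centralizer ({γ} : Set (GpInf L H))) := fun _ => ⟨rfl⟩;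
      letI : ∀ γ : GInf L, MeasurableSpace (GInf L ⧸ Subgroup.centralizer ({γ} : Set (GInf L))) := fun _ => borel _;
      haveI : ∀ γ : GInf L, BorelSpace (GInf L ⧸ Subgroup.centralizer ({γ} : Set (GInf L))) := fun _ => ⟨rfl⟩;
      letI : ∀ (v : HeightOneSpectrum (𝓞 ↥(maximalRealSubfield L))) (a : HLocal L v),
        MeasurableSpace (HLocal L v ⧸ Subgroup.centralizer ({a} : Set (HLocal L v))) := fun _ _ => borel _;
      haveI : ∀ (v : HeightOneSpectrum (𝓞 ↥(maximalRealSubfield L))) (a : HLocal L v),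
        BorelSpace (HLocal L v ⧸ Subgroup.centralizer ({a} : Set (HLocal L v))) := fun _ _ => ⟨rfl⟩;
      letI : ∀ a : HInf L, MeasurableSpace (HInf L ⧸ Subgroup.centralizer ({a} : Set (HInf L))) := fun _ => borel _;
      haveI : ∀ a : HInf L, BorelSpace (HInf L ⧸ Subgroup.centralizer ({a} : Set (HInf L))) := fun _ => ⟨rfl⟩;
      letI : ∀ γ : GpAdelic L H, MeasurableSpace (↥(Subgroup.centralizer ({γ} : Set (GpAdelic L H))) ⧸
        ((UnitaryGroup.cmDatum L 3 H).quotientSubgroup ⊓ Subgroup.centralizer ({γ} : Set (GpAdelic L H))).subgroupOf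
          (Subgroup.centralizer ({γ} : Set (GpAdelic L H)))) := fun _ => borel _;
      haveI : ∀ γ : GpAdelic L H, BorelSpace (↥(Subgroup.centralizer ({γ} : Set (GpAdelic L H))) ⧸
        ((UnitaryGroup.cmDatum L 3 H).quotientSubgroup ⊓ Subgroup.centralizer ({γ} : Set (GpAdelic L H))).subgroupOf
          (Subgroup.centralizer ({γ} : Set (GpAdelic L H)))) := fun _ => ⟨rfl⟩;
      haveI hCcl : ∀ γ : GpAdelic L H, IsClosed ((Subgroup.centralizer ({γ} : Set (GpAdelic L H)) : Subgroup (GpAdelic L H)) : Set (GpAdelic L H)) :=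
        fun γ => UnitaryGroup.isClosed_centralizer_cmDatum L 3 H γ;
      haveI : ∀ γ : GpAdelic L H, (Measure.count : Measure ↥(((UnitaryGroup.cmDatum L 3 H).quotientSubgroup ⊓
        Subgroup.centralizer ({γ} : Set (GpAdelic L H))).subgroupOf (Subgroup.centralizer ({γ} : Set (GpAdelic L H))))).IsHaarMeasure :=
        fun γ => UnitaryGroup.isHaarMeasure_count_quotientSubgroup_inf_centralizer_subgroupOf L 3 H γ;
      haveI : ν.IsMulRightInvariant := by
        have h : ν.inv.IsMulRightInvariant := inferInstance
        rwa [Measure.inv_eq_self] at h;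
      Literature.NumberTheory.Rogawski1990.SingularEllipticTransferCanonical L H Tinf νH νG νGi νqi νHi ν)
    (hanis : IsAnisotropic L H) (hherm : IsHermitianCM L H) :
    ∃ 𝔨 : ComparisonKit L H μ, 𝔨.IsPinned ν Tinf νH νG νGi νqi νHi ∧ 𝔨.TransferExistence ∧ 𝔨.SimpleTraceFormula ∧
      (∀ f' : TestGp L H, 𝔨.Smooth f' → ∃ f : TestG L, 𝔨.Transfer f' f ∧
        ∃ T' : UnitaryGroup.PureTensor L 3 (splitForm L 3), T'.IsTest ∧ ⇑f = T'.eval) ∧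
      (letI : ∀ (v : HeightOneSpectrum (𝓞 ↥(maximalRealSubfield L))) (γ : (UnitaryGroup.cmDatum L 3 H).Local v),
          MeasurableSpace ((UnitaryGroup.cmDatum L 3 H).Local v ⧸ Subgroup.centralizer ({γ} : Set ((UnitaryGroup.cmDatum L 3 H).Local v))) :=
        fun _ _ => borel _
      ∃ mG₀ : ∀ v : HeightOneSpectrum (𝓞 ↥(maximalRealSubfield L)), OrbitalMeasureFamily ((UnitaryGroup.cmDatum L 3 H).Local v),
        (∀ (v : HeightOneSpectrum (𝓞 ↥(maximalRealSubfield L))) (c' : ConjClasses ((UnitaryGroup.cmDatum L 3 H).Local v)),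
          Literature.NumberTheory.Rogawski1990.IsRegularElt ((Quotient.out c').val : GL (Fin 3) (UnitaryGroup.LocalRing L v)) → 𝔨.mG v c' = mG₀ v c') ∧
        Q 𝔨.Δ 𝔨.mH mG₀ ∧
        (letI : ∀ (v : HeightOneSpectrum (𝓞 ↥(maximalRealSubfield L))) (a : HLocal L v),
            MeasurableSpace (HLocal L v ⧸ Subgroup.centralizer ({a} : Set (HLocal L v))) := fun _ _ => borel _
        haveI : ∀ (v : HeightOneSpectrum (𝓞 ↥(maximalRealSubfield L))) (a : HLocal L v),
            BorelSpace (HLocal L v ⧸ Subgroup.centralizer ({a} : Set (HLocal L v))) := fun _ _ => ⟨rfl⟩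
        haveI : ∀ (v : HeightOneSpectrum (𝓞 ↥(maximalRealSubfield L))) (γ : (UnitaryGroup.cmDatum L 3 H).Local v),
            BorelSpace ((UnitaryGroup.cmDatum L 3 H).Local v ⧸
              Subgroup.centralizer ({γ} : Set ((UnitaryGroup.cmDatum L 3 H).Local v))) := fun _ _ => ⟨rfl⟩
        ∀ v : HeightOneSpectrum (𝓞 ↥(maximalRealSubfield L)),
          Literature.NumberTheory.Rogawski1990.IsLocalTransferDatum L H v (𝔨.Δ v) (𝔨.mH v) (mG₀ v) ∧
            (mG₀ v).IsCanonical (fun γ => Literature.NumberTheory.Rogawski1990.IsRegularElt (γ.val : GL (Fin 3) (UnitaryGroup.LocalRing L v))) (νG v))) := by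
  obtain ⟨w, hq⟩ := anchorWitness_exists_of_packageAnd L H μ ν νH νG νGi νqi νHi h3 Tinf hK hKH hGTQ hAT₄ hSET hanis hherm
  exact ⟨w.kit, w.isPinned, w.transferExistence, w.simpleTraceFormula, w.smooth_partner, w.mG, fun v c' hc => w.mGp_of_isRegularElt v c' hc, hq,
    fun v => ⟨(w.hloc v).1, (w.hloc v).2.2.2⟩⟩

/-- **(J2′-a-pin) THE ANCHOR WITNESS AT THE PACKAGE'S OWN WITNESS, RIDER `Q`, SINGULAR PACKAGE AT ONE PINNED `Δ₀`** (ed. 1.26 «#175 PINNED», 2026-09-03; director g36 s1830 ORDER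
«re-letter #175 at AGG ED. 44»; heir LEAD F0P3a-plan (g19) T18-10 «#175-R SCOPE» (1)(b) T3 ∕ T18-13 (3); desk F0P3-plan (g22) D-O7∕D-O7b; K2E4-r01 (g0) O7 VERDICT 9d20d85d782e07ce:
letter #175 `TamagawaSingularMembersFinTFCovol` — hence MAIN's `hSET : SingularEllipticTransferCanonical L H Tinf …`, a `∀ Δ` statement — is MISSTATED AS TYPED on the weak frame,
its κ-clauses being false at a phase-twisted `Δ`; registrar A-plan1 (g34) pen).  MAIN's `anchorWitness_exists_of_packageAnd` (:1403–:1549) VERBATIM — same binders, same body —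
with EXACTLY: (i) two more binders, a finite transfer-factor collection `Δ₀` and the PIN `hQΔ : ∀ Δ mH mG, Q Δ mH mG → Δ = Δ₀` (the rider names the package's `Δ`); (ii) `hSET` typed
★ `SingularEllipticTransferCanonicalAtDelta L H Tinf Δ₀ νH νG νGi νqi νHi ν` (registrar T2 ★: §14.5's singular-elliptic transfer package AT `Δ₀` only — #88's text with its `Δ`-binder
hoisted) instead of the `∀ Δ` text; (iii) in the body, after the package is opened, `subst` along `hQΔ … hq : Δ = Δ₀`, and MAIN-b's ONE use of `hSET` (:1532) through the
At-variant export ★ `SingularEllipticTransferCanonicalAtDelta.exists_singularTransferMembers` (the `Δ` argument gone).  MAIN is untouched (s476∕s497: the statement layer and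
`anchorWitness_exists_of_packageAnd` stay byte-identical; this twin lives in the API file, which imports MAIN).  Serves the rung-0 closer's PINNED choice (KitD ED. 7
`Kit.nonempty_rung0Choice_of_pinned`) at `Δ₀ := Δ‴(μω) = finExplicitCollection L H μω …` [Rogawski1990, §4.9 p. 55], `hQΔ := fun _ _ _ h => h.1` (the rider
«`Δ = Δ‴ ∧ Q_K9S …`» of `StubRung0SPinned`).  ZERO `sorry`, ZERO `stub_`.
[cite: Rogawski1990, §14.5 pp. 237–239, Lemma 14.5.2 (b); §4.9 Prop. 4.9.1 p. 55; §13.1 Prop. 13.1.4 p. 199] -/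
theorem anchorWitness_exists_of_packageAnd_pinned [MeasurableSpace (GpAdelic L H)] [BorelSpace (GpAdelic L H)]
    (ν : Measure (GpAdelic L H)) [ν.IsHaarMeasure] [ν.IsInvInvariant]
    [∀ v : HeightOneSpectrum (𝓞 ↥(maximalRealSubfield L)), MeasurableSpace (HLocal L v)] [∀ v : HeightOneSpectrum (𝓞 ↥(maximalRealSubfield L)), BorelSpace (HLocal L v)]
    [∀ v : HeightOneSpectrum (𝓞 ↥(maximalRealSubfield L)), MeasurableSpace (GpLocal L H v)] [∀ v : HeightOneSpectrum (𝓞 ↥(maximalRealSubfield L)), BorelSpace (GpLocal L H v)]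
    [MeasurableSpace (GpInf L H)] [BorelSpace (GpInf L H)] [MeasurableSpace (GInf L)] [BorelSpace (GInf L)]
    [MeasurableSpace (HInf L)] [BorelSpace (HInf L)]
    (νH : ∀ v : HeightOneSpectrum (𝓞 ↥(maximalRealSubfield L)), Measure (HLocal L v)) (νG : ∀ v : HeightOneSpectrum (𝓞 ↥(maximalRealSubfield L)), Measure (GpLocal L H v))
    [∀ v, IsFiniteMeasureOnCompacts (νH v)] [∀ v, (νH v).IsMulRightInvariant]
    [∀ v, (νG v).IsHaarMeasure] [∀ v, (νG v).IsMulRightInvariant]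
    (νGi : Measure (GpInf L H)) (νqi : Measure (GInf L)) (νHi : Measure (HInf L))
    [IsFiniteMeasureOnCompacts νGi] [νGi.IsMulRightInvariant] [IsFiniteMeasureOnCompacts νqi] [νqi.IsMulRightInvariant]
    [IsFiniteMeasureOnCompacts νHi] [νHi.IsMulRightInvariant]
    (h3 : StubT1cSplitFormAutomorphicMeasure L)
    (Tinf : Literature.NumberTheory.Rogawski1990.ArchTransferFactor L H)
    (Δ₀ : ∀ v : HeightOneSpectrum (𝓞 ↥(maximalRealSubfield L)), Literature.NumberTheory.Rogawski1990.LocalTransferFactor L H v)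
    (hK : ∀ v : HeightOneSpectrum (𝓞 ↥(maximalRealSubfield L)), νG v (UnitaryGroup.cmLocalIntegralLevel L 3 H v : Set (GpLocal L H v)) = 1)
    (hKH : ∀ v : HeightOneSpectrum (𝓞 ↥(maximalRealSubfield L)),
      νH v (((UnitaryGroup.cmLocalIntegralLevel L 2 (Matrix.of fun i j : Fin 2 => if i.val + j.val + 1 = 2 then (1 : L) else 0) v).prod
          (UnitaryGroup.cmLocalIntegralLevel L 1 (Matrix.of fun i j : Fin 1 => if i.val + j.val + 1 = 1 then (1 : L) else 0) v) :
            Subgroup (HLocal L v)) : Set (HLocal L v)) = 1)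
    {Q : letI : ∀ (v : HeightOneSpectrum (𝓞 ↥(maximalRealSubfield L))) (a : HLocal L v),
          MeasurableSpace (HLocal L v ⧸ Subgroup.centralizer ({a} : Set (HLocal L v))) := fun _ _ => borel _
      letI : ∀ (v : HeightOneSpectrum (𝓞 ↥(maximalRealSubfield L))) (γ : (UnitaryGroup.cmDatum L 3 H).Local v),
          MeasurableSpace ((UnitaryGroup.cmDatum L 3 H).Local v ⧸ Subgroup.centralizer ({γ} : Set ((UnitaryGroup.cmDatum L 3 H).Local v))) :=
        fun _ _ => borel _
      (∀ v : HeightOneSpectrum (𝓞 ↥(maximalRealSubfield L)), Literature.NumberTheory.Rogawski1990.LocalTransferFactor L H v) →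
      (∀ v : HeightOneSpectrum (𝓞 ↥(maximalRealSubfield L)), OrbitalMeasureFamily (HLocal L v)) →
      (∀ v : HeightOneSpectrum (𝓞 ↥(maximalRealSubfield L)), OrbitalMeasureFamily ((UnitaryGroup.cmDatum L 3 H).Local v)) → Prop}
    (hGTQ : Literature.NumberTheory.Rogawski1990.GlobalTransferWithStabilisationPackageAnd L H Tinf.Δ νH νG Q)
    (hQΔ : ∀ Δ mH mG, Q Δ mH mG → Δ = Δ₀)
    (hAT₄ : Literature.NumberTheory.Rogawski1990.ArchTransfersExistCanonicalSingular L H Tinf νGi νqi νHi)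
    (hSET :
      letI : ∀ (v : HeightOneSpectrum (𝓞 ↥(maximalRealSubfield L))) (γ : (UnitaryGroup.cmDatum L 3 H).Local v),
        MeasurableSpace ((UnitaryGroup.cmDatum L 3 H).Local v ⧸
          Subgroup.centralizer ({γ} : Set ((UnitaryGroup.cmDatum L 3 H).Local v))) := fun _ _ => borel _;
      haveI : ∀ (v : HeightOneSpectrum (𝓞 ↥(maximalRealSubfield L))) (γ : (UnitaryGroup.cmDatum L 3 H).Local v),
        BorelSpace ((UnitaryGroup.cmDatum L 3 H).Local v ⧸
          Subgroup.centralizer ({γ} : Set ((UnitaryGroup.cmDatum L 3 H).Local v))) := fun _ _ => ⟨rfl⟩;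
      letI : ∀ g : GpAdelic L H, MeasurableSpace (GpAdelic L H ⧸ Subgroup.centralizer ({g} : Set (GpAdelic L H))) := fun _ => borel _;
      haveI : ∀ g : GpAdelic L H, BorelSpace (GpAdelic L H ⧸ Subgroup.centralizer ({g} : Set (GpAdelic L H))) := fun _ => ⟨rfl⟩;
      letI : ∀ γ : GpInf L H, MeasurableSpace (GpInf L H ⧸ Subgroup.centralizer ({γ} : Set (GpInf L H))) := fun _ => borel _;
      haveI : ∀ γ : GpInf L H, BorelSpace (GpInf L H ⧸ Subgroup.centralizer ({γ} : Set (GpInf L H))) := fun _ => ⟨rfl⟩;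
      letI : ∀ γ : GInf L, MeasurableSpace (GInf L ⧸ Subgroup.centralizer ({γ} : Set (GInf L))) := fun _ => borel _;
      haveI : ∀ γ : GInf L, BorelSpace (GInf L ⧸ Subgroup.centralizer ({γ} : Set (GInf L))) := fun _ => ⟨rfl⟩;
      letI : ∀ (v : HeightOneSpectrum (𝓞 ↥(maximalRealSubfield L))) (a : HLocal L v),
        MeasurableSpace (HLocal L v ⧸ Subgroup.centralizer ({a} : Set (HLocal L v))) := fun _ _ => borel _;
      haveI : ∀ (v : HeightOneSpectrum (𝓞 ↥(maximalRealSubfield L))) (a : HLocal L v),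
        BorelSpace (HLocal L v ⧸ Subgroup.centralizer ({a} : Set (HLocal L v))) := fun _ _ => ⟨rfl⟩;
      letI : ∀ a : HInf L, MeasurableSpace (HInf L ⧸ Subgroup.centralizer ({a} : Set (HInf L))) := fun _ => borel _;
      haveI : ∀ a : HInf L, BorelSpace (HInf L ⧸ Subgroup.centralizer ({a} : Set (HInf L))) := fun _ => ⟨rfl⟩;
      letI : ∀ γ : GpAdelic L H, MeasurableSpace (↥(Subgroup.centralizer ({γ} : Set (GpAdelic L H))) ⧸
        ((UnitaryGroup.cmDatum L 3 H).quotientSubgroup ⊓ Subgroup.centralizer ({γ} : Set (GpAdelic L H))).subgroupOf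
          (Subgroup.centralizer ({γ} : Set (GpAdelic L H)))) := fun _ => borel _;
      haveI : ∀ γ : GpAdelic L H, BorelSpace (↥(Subgroup.centralizer ({γ} : Set (GpAdelic L H))) ⧸
        ((UnitaryGroup.cmDatum L 3 H).quotientSubgroup ⊓ Subgroup.centralizer ({γ} : Set (GpAdelic L H))).subgroupOf
          (Subgroup.centralizer ({γ} : Set (GpAdelic L H)))) := fun _ => ⟨rfl⟩;
      haveI hCcl : ∀ γ : GpAdelic L H, IsClosed ((Subgroup.centralizer ({γ} : Set (GpAdelic L H)) : Subgroup (GpAdelic L H)) : Set (GpAdelic L H)) :=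
        fun γ => UnitaryGroup.isClosed_centralizer_cmDatum L 3 H γ;
      haveI : ∀ γ : GpAdelic L H, (Measure.count : Measure ↥(((UnitaryGroup.cmDatum L 3 H).quotientSubgroup ⊓
        Subgroup.centralizer ({γ} : Set (GpAdelic L H))).subgroupOf (Subgroup.centralizer ({γ} : Set (GpAdelic L H))))).IsHaarMeasure :=
        fun γ => UnitaryGroup.isHaarMeasure_count_quotientSubgroup_inf_centralizer_subgroupOf L 3 H γ;
      haveI : ν.IsMulRightInvariant := by
        have h : ν.inv.IsMulRightInvariant := inferInstance
        rwa [Measure.inv_eq_self] at h;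
      Literature.NumberTheory.Rogawski1990.SingularEllipticTransferCanonicalAtDelta L H Tinf Δ₀ νH νG νGi νqi νHi ν)
    (hanis : IsAnisotropic L H) (hherm : IsHermitianCM L H) :
    ∃ w : AnchorWitness L H μ ν νH νG νGi νqi νHi Tinf hanis, Q w.Δ w.mH w.mG := by
  classical
  -- (x)∕(vii-c) (ed. 1.24a (F-0)): ONE family `ψ_v` — matrix conjugations, class-preserving both ways, level-matching off `S₀`
  obtain ⟨ψ₀, S₀, hconjS, hcorr, hcorr', hψ₀⟩ := UnitaryGroup.exists_psi_conj_corresponds_forall_levelMatching L H hanis hherm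
  -- (xi′)∕(xi‴)∕(xv) + rider `Q` (ed. 1.23b, (J2′-a)): the JOINT canonical fact WITH STABILISATION PACKAGE AND `Q` (ED. 5 over ED. 4 `hGT₄`) [Rogawski1990, Prop. 4.9.1, (4.3.1)–(4.3.3), Prop. 3.3.1, (5.4.5)] — data, clause bundle, package at `hanis`
  obtain ⟨Sbad, Δ, mH, mG, hloc, hae, hpf, hpkg, hq⟩ := hGTQ hK hKH
  -- (ed. 1.26 «#175 PINNED») the rider PINS the package՚s finite transfer factor: `Δ = Δ₀`; eliminate `Δ₀` so that `hSET` (typed AT `Δ₀`) reads at the package՚s own `Δ`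
  have hΔ₀ : Δ = Δ₀ := hQΔ Δ mH mG hq
  subst Δ₀
  -- (ix′)∕(xi″)∕(xii) at `∞`: the GUARDED archimedean canonical fact — data, six clauses, the torus coherence kept WHOLE [Rogawski1990, (14.2.1), §14.3 p. 234]
  -- (ed. 1.24a (F-0) ∕ 1.24b (F-1)) `hAT₄` = ★ `ArchTransfersExistCanonicalSingular` through its MATRIX ★ `ArchCanonicalSingularMatrix`, kept WHOLE (`hACS`: the (F-0)
  -- field and `hSET`'s archimedean argument); ED. 3's thirteen conjuncts destructured for the ED ≤ 1.23 fields, (S-c)(S-d) read only through `w.hACS`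
  obtain ⟨mpi, mqi, mHi, t', t, tH, hACS⟩ :=
    Literature.NumberTheory.Rogawski1990.ArchTransfersExistCanonicalSingular.exists_archCanonicalSingularMatrix L H hAT₄ hherm hanis
  obtain ⟨h₁, h₂, h₃, h₄, h₅, h₆, hW', hW, hWH, hC', hC, hC'G, hCH, -, -⟩ := id hACS
  have hcoh : ArchTorusCoherence L H hanis mpi mqi mHi νGi νqi νHi t' t tH := ⟨hW', hW, hWH, hC', hC, hC'G, hCH⟩
  obtain ⟨μ₃, hμ₃⟩ := h3 3 le_rfl
  -- (xiv) (ed. 1.19b₁): `mG` normalised off a finite set at every REGULAR rational class — ★ `exists_isNormalisedOff_of_isConj_toAdelic` on the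
  -- canonicity (xi‴), the centralizer compact cores inside `K′_v` a.e. (★ `compactCoreCentralizerLevelAE_of_hermitian`, `det H ≠ 0` from `hanis`) at
  -- `y = toAdelic (out c)` itself; regularity of the local representatives by `isRegularElt_toLocal_toAdelic` + `isRegularElt_out_mk_local` [Rogawski1990, §4.3 pp. 43–44]
  have hHd : H.det ≠ 0 := Literature.NumberTheory.Automorphic.Godement.det_ne_zero_of_anisotropic L H hanis
  have hnorm : letI : ∀ (v : HeightOneSpectrum (𝓞 ↥(maximalRealSubfield L))) (γ : (UnitaryGroup.cmDatum L 3 H).Local v),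
          MeasurableSpace ((UnitaryGroup.cmDatum L 3 H).Local v ⧸
            Subgroup.centralizer ({γ} : Set ((UnitaryGroup.cmDatum L 3 H).Local v))) := fun _ _ => borel _;
      ∀ c : ConjClasses (UnitaryGroup.cmDatum L 3 H).Rational,
        Literature.NumberTheory.Rogawski1990.IsRegularElt ((Quotient.out c).val : GL (Fin 3) L) →
          ∃ S₀ : Finset (HeightOneSpectrum (𝓞 ↥(maximalRealSubfield L))),
            UnitaryGroup.IsNormalisedOff L 3 H mG ((UnitaryGroup.cmDatum L 3 H).toAdelic (Quotient.out c)) S₀ := by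
    letI : ∀ (v : HeightOneSpectrum (𝓞 ↥(maximalRealSubfield L))) (γ : (UnitaryGroup.cmDatum L 3 H).Local v),
        MeasurableSpace ((UnitaryGroup.cmDatum L 3 H).Local v ⧸
          Subgroup.centralizer ({γ} : Set ((UnitaryGroup.cmDatum L 3 H).Local v))) := fun _ _ => borel _
    haveI : ∀ (v : HeightOneSpectrum (𝓞 ↥(maximalRealSubfield L))) (γ : (UnitaryGroup.cmDatum L 3 H).Local v),
        BorelSpace ((UnitaryGroup.cmDatum L 3 H).Local v ⧸
          Subgroup.centralizer ({γ} : Set ((UnitaryGroup.cmDatum L 3 H).Local v))) := fun _ _ => ⟨rfl⟩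
    intro c hc
    exact UnitaryGroup.exists_isNormalisedOff_of_isConj_toAdelic L 3 H
      (fun v γ => Literature.NumberTheory.Rogawski1990.IsRegularElt (γ.val : GL (Fin 3) (UnitaryGroup.LocalRing L v))) νG mG hK
      (fun v => (hloc v).2.2.2) (UnitaryGroup.compactCoreCentralizerLevelAE_of_hermitian L 3 H hherm hHd) (Quotient.out c) hc
      ((UnitaryGroup.cmDatum L 3 H).toAdelic (Quotient.out c)) (IsConj.refl _)
      (fun v => Literature.NumberTheory.Rogawski1990.isRegularElt_out_mk_toLocal_toAdelic L H (Quotient.out c) hc v)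
  -- (xv-s) (ed. 1.24b (F-1)): the SINGULAR MEMBERS of ★ `SingularEllipticTransferCanonical` for THIS global∕archimedean datum (ED. 3 matrix `⟨hloc, hae, hpf⟩` + `hACS`)
  letI : ∀ (v : HeightOneSpectrum (𝓞 ↥(maximalRealSubfield L))) (γ : (UnitaryGroup.cmDatum L 3 H).Local v),
      MeasurableSpace ((UnitaryGroup.cmDatum L 3 H).Local v ⧸
        Subgroup.centralizer ({γ} : Set ((UnitaryGroup.cmDatum L 3 H).Local v))) := fun _ _ => borel _
  haveI : ∀ (v : HeightOneSpectrum (𝓞 ↥(maximalRealSubfield L))) (γ : (UnitaryGroup.cmDatum L 3 H).Local v),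
      BorelSpace ((UnitaryGroup.cmDatum L 3 H).Local v ⧸
        Subgroup.centralizer ({γ} : Set ((UnitaryGroup.cmDatum L 3 H).Local v))) := fun _ _ => ⟨rfl⟩
  letI : ∀ g : GpAdelic L H, MeasurableSpace (GpAdelic L H ⧸ Subgroup.centralizer ({g} : Set (GpAdelic L H))) := fun _ => borel _
  haveI : ∀ g : GpAdelic L H, BorelSpace (GpAdelic L H ⧸ Subgroup.centralizer ({g} : Set (GpAdelic L H))) := fun _ => ⟨rfl⟩
  letI : ∀ γ : GpInf L H, MeasurableSpace (GpInf L H ⧸ Subgroup.centralizer ({γ} : Set (GpInf L H))) := fun _ => borel _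
  haveI : ∀ γ : GpInf L H, BorelSpace (GpInf L H ⧸ Subgroup.centralizer ({γ} : Set (GpInf L H))) := fun _ => ⟨rfl⟩
  letI : ∀ γ : GInf L, MeasurableSpace (GInf L ⧸ Subgroup.centralizer ({γ} : Set (GInf L))) := fun _ => borel _
  haveI : ∀ γ : GInf L, BorelSpace (GInf L ⧸ Subgroup.centralizer ({γ} : Set (GInf L))) := fun _ => ⟨rfl⟩
  letI : ∀ (v : HeightOneSpectrum (𝓞 ↥(maximalRealSubfield L))) (a : HLocal L v),
      MeasurableSpace (HLocal L v ⧸ Subgroup.centralizer ({a} : Set (HLocal L v))) := fun _ _ => borel _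
  haveI : ∀ (v : HeightOneSpectrum (𝓞 ↥(maximalRealSubfield L))) (a : HLocal L v),
      BorelSpace (HLocal L v ⧸ Subgroup.centralizer ({a} : Set (HLocal L v))) := fun _ _ => ⟨rfl⟩
  letI : ∀ a : HInf L, MeasurableSpace (HInf L ⧸ Subgroup.centralizer ({a} : Set (HInf L))) := fun _ => borel _
  haveI : ∀ a : HInf L, BorelSpace (HInf L ⧸ Subgroup.centralizer ({a} : Set (HInf L))) := fun _ => ⟨rfl⟩
  letI : ∀ γ : GpAdelic L H, MeasurableSpace (↥(Subgroup.centralizer ({γ} : Set (GpAdelic L H))) ⧸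
      ((UnitaryGroup.cmDatum L 3 H).quotientSubgroup ⊓ Subgroup.centralizer ({γ} : Set (GpAdelic L H))).subgroupOf
        (Subgroup.centralizer ({γ} : Set (GpAdelic L H)))) := fun _ => borel _
  haveI : ∀ γ : GpAdelic L H, BorelSpace (↥(Subgroup.centralizer ({γ} : Set (GpAdelic L H))) ⧸
      ((UnitaryGroup.cmDatum L 3 H).quotientSubgroup ⊓ Subgroup.centralizer ({γ} : Set (GpAdelic L H))).subgroupOf
        (Subgroup.centralizer ({γ} : Set (GpAdelic L H)))) := fun _ => ⟨rfl⟩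
  haveI hCcl : ∀ γ : GpAdelic L H, IsClosed ((Subgroup.centralizer ({γ} : Set (GpAdelic L H)) : Subgroup (GpAdelic L H)) : Set (GpAdelic L H)) :=
    fun γ => UnitaryGroup.isClosed_centralizer_cmDatum L 3 H γ
  haveI : ∀ γ : GpAdelic L H, (Measure.count : Measure ↥(((UnitaryGroup.cmDatum L 3 H).quotientSubgroup ⊓
      Subgroup.centralizer ({γ} : Set (GpAdelic L H))).subgroupOf (Subgroup.centralizer ({γ} : Set (GpAdelic L H))))).IsHaarMeasure :=
    fun γ => UnitaryGroup.isHaarMeasure_count_quotientSubgroup_inf_centralizer_subgroupOf L 3 H γ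
  haveI : ν.IsMulRightInvariant := by
    have h : ν.inv.IsMulRightInvariant := inferInstance
    rwa [Measure.inv_eq_self] at h
  -- (ed. 1.26) ★ T2 `SingularEllipticTransferCanonicalAtDelta.exists_singularTransferMembers`: MAIN-b :1532 VERBATIM minus the `Δ` argument (the members AT the pinned `Δ`)
  obtain ⟨mGs, mGis, mqis, hS⟩ := hSET.exists_singularTransferMembers hanis Sbad mH mG ⟨hloc, hae, hpf⟩ mpi mqi mHi t' t tH hACS
  -- (viii′-2)∕(viii″)∕(viii⁗)∕(viii⁵)∕(viii⁵-s) (ed. 1.24b (F-1)): the absorbed adelic family ANCHORED to `ofLocal` of the PATCHED families at EVERY class —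
  -- ★ `UnitaryGroup.exists_absorbedFamily_ofLocal_patched` ((A-s) p822250 + patch-safety p823212; `hstab_s` = (K7-s) of the package) [Rogawski1990, §14.5 p. 239; Kottwitz1988 Thm. 1]
  obtain ⟨μA, hμA, hsupp, hJeq, α, hα, hβp, hβ, hβs⟩ :=
    UnitaryGroup.exists_absorbedFamily_ofLocal_patched L 3 H hanis hherm hHd νG hK mG (fun v => (hloc v).2.2.2) (fun v => (hloc v).1.2.2.1) hnorm
      mpi νGi t' hcoh.1 hcoh.2.2.2.1 h₁ mGs mGis (fun γ₀ hγ₀ v => (hS.1 γ₀ hγ₀).1 v) (fun γ₀ hγ₀ => (hS.1 γ₀ hγ₀).2.1) hS.2.1 ν μ hS.2.2.2.1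
      (fun v c' => if Literature.NumberTheory.Rogawski1990.IsRegularElt ((Quotient.out c').val : GL (Fin 3) (UnitaryGroup.LocalRing L v)) then mG v c' else mGs v c')
      (fun c' => if Literature.NumberTheory.Rogawski1990.IsRegularElt ((Quotient.out c').val : GL (Fin 3) (NumberField.mixedEmbedding.mixedSpace L)) then mpi c' else mGis c')
      (fun v c' hc => if_pos hc) (fun v c' hc => if_neg hc) (fun c' hc => if_pos hc) (fun c' hc => if_neg hc)
  -- (structure-instance fields are `sepByIndent`: continuation lines at the column of the first field)
  exact ⟨{ ψ₀ := ψ₀, S₀ := S₀, Sbad := Sbad, Δ := Δ, mH := mH, mG := mG, mHi := mHi, mGi := mpi, mqi := mqi, t' := t', t := t, tH := tH,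
           μ₃ := μ₃, μA := μA, hμ₃ := hμ₃, hcorr := hcorr, hcorr' := hcorr', hψ₀ := hψ₀, hloc := hloc, hae := hae, hpf := hpf, hpkg := hpkg hanis,
           harch := ⟨h₁, h₂, h₃, h₄, h₅, h₆⟩, hcoh := hcoh, hμA := hμA, hsupp := hsupp, hJeq := hJeq, hnorm := hnorm, α := α, hα := hα, hβ := hβ,
           hconjS := hconjS, hACS := hACS,
           mGs := mGs, mGis := mGis, mqis := mqis, hS := hS, hβp := hβp, hβs := hβs, hH := hherm }, hq⟩

/-- **(J2′-b-loc-pin) THE ed. 1.25 EXPORT `anchoredKit_nonempty_of_stubsQ_loc`, SINGULAR PACKAGE AT ONE PINNED `Δ₀`** (ed. 1.26 «#175 PINNED»; same sources as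
`anchorWitness_exists_of_packageAnd_pinned` above): the ed. 1.25 export VERBATIM — same binders, same conclusion (pinned kit, `TransferExistence`, `SimpleTraceFormula`,
pure-tensor partners, the regular family `mG₀` with `Q 𝔨.Δ 𝔨.mH mG₀`, the local transfer data and canonicity at every finite `v`) — with the two extra binders `Δ₀`, `hQΔ` and
`hSET : SingularEllipticTransferCanonicalAtDelta L H Tinf Δ₀ …`; proof = the ed. 1.25 two lines over the pinned MAIN-b twin.  Consumed by KitD ED. 7 `Kit.nonempty_rung0Choice_of_pinned`
(the `Rung0WitnessS.hSET` field of Defs ED. 4 is typed AT `Δ‴(μω)`).  The ed. 1.25 export above is byte-identical; nothing else in this file moves.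
[cite: Rogawski1990, §14.5 p. 237; §4.9 Prop. 4.9.1 (a) p. 55; §4.3 (4.3.1) p. 43; §13.1 Prop. 13.1.4 p. 199] -/
theorem anchoredKit_nonempty_of_stubsQ_loc_pinned [MeasurableSpace (GpAdelic L H)] [BorelSpace (GpAdelic L H)]
    (ν : Measure (GpAdelic L H)) [ν.IsHaarMeasure] [ν.IsInvInvariant]
    [∀ v : HeightOneSpectrum (𝓞 ↥(maximalRealSubfield L)), MeasurableSpace (HLocal L v)] [∀ v : HeightOneSpectrum (𝓞 ↥(maximalRealSubfield L)), BorelSpace (HLocal L v)]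
    [∀ v : HeightOneSpectrum (𝓞 ↥(maximalRealSubfield L)), MeasurableSpace (GpLocal L H v)] [∀ v : HeightOneSpectrum (𝓞 ↥(maximalRealSubfield L)), BorelSpace (GpLocal L H v)]
    [MeasurableSpace (GpInf L H)] [BorelSpace (GpInf L H)] [MeasurableSpace (GInf L)] [BorelSpace (GInf L)]
    [MeasurableSpace (HInf L)] [BorelSpace (HInf L)]
    (νH : ∀ v : HeightOneSpectrum (𝓞 ↥(maximalRealSubfield L)), Measure (HLocal L v)) (νG : ∀ v : HeightOneSpectrum (𝓞 ↥(maximalRealSubfield L)), Measure (GpLocal L H v))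
    [∀ v, IsFiniteMeasureOnCompacts (νH v)] [∀ v, (νH v).IsMulRightInvariant]
    [∀ v, (νG v).IsHaarMeasure] [∀ v, (νG v).IsMulRightInvariant]
    (νGi : Measure (GpInf L H)) (νqi : Measure (GInf L)) (νHi : Measure (HInf L))
    [IsFiniteMeasureOnCompacts νGi] [νGi.IsMulRightInvariant] [IsFiniteMeasureOnCompacts νqi] [νqi.IsMulRightInvariant]
    [IsFiniteMeasureOnCompacts νHi] [νHi.IsMulRightInvariant]
    (h3 : StubT1cSplitFormAutomorphicMeasure L)
    (Tinf : Literature.NumberTheory.Rogawski1990.ArchTransferFactor L H)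
    (Δ₀ : ∀ v : HeightOneSpectrum (𝓞 ↥(maximalRealSubfield L)), Literature.NumberTheory.Rogawski1990.LocalTransferFactor L H v)
    (hK : ∀ v : HeightOneSpectrum (𝓞 ↥(maximalRealSubfield L)), νG v (UnitaryGroup.cmLocalIntegralLevel L 3 H v : Set (GpLocal L H v)) = 1)
    (hKH : ∀ v : HeightOneSpectrum (𝓞 ↥(maximalRealSubfield L)),
      νH v (((UnitaryGroup.cmLocalIntegralLevel L 2 (Matrix.of fun i j : Fin 2 => if i.val + j.val + 1 = 2 then (1 : L) else 0) v).prod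
          (UnitaryGroup.cmLocalIntegralLevel L 1 (Matrix.of fun i j : Fin 1 => if i.val + j.val + 1 = 1 then (1 : L) else 0) v) :
            Subgroup (HLocal L v)) : Set (HLocal L v)) = 1)
    {Q : letI : ∀ (v : HeightOneSpectrum (𝓞 ↥(maximalRealSubfield L))) (a : HLocal L v),
          MeasurableSpace (HLocal L v ⧸ Subgroup.centralizer ({a} : Set (HLocal L v))) := fun _ _ => borel _
      letI : ∀ (v : HeightOneSpectrum (𝓞 ↥(maximalRealSubfield L))) (γ : (UnitaryGroup.cmDatum L 3 H).Local v),
          MeasurableSpace ((UnitaryGroup.cmDatum L 3 H).Local v ⧸ Subgroup.centralizer ({γ} : Set ((UnitaryGroup.cmDatum L 3 H).Local v))) :=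
        fun _ _ => borel _
      (∀ v : HeightOneSpectrum (𝓞 ↥(maximalRealSubfield L)), Literature.NumberTheory.Rogawski1990.LocalTransferFactor L H v) →
      (∀ v : HeightOneSpectrum (𝓞 ↥(maximalRealSubfield L)), OrbitalMeasureFamily (HLocal L v)) →
      (∀ v : HeightOneSpectrum (𝓞 ↥(maximalRealSubfield L)), OrbitalMeasureFamily ((UnitaryGroup.cmDatum L 3 H).Local v)) → Prop}
    (hGTQ : Literature.NumberTheory.Rogawski1990.GlobalTransferWithStabilisationPackageAnd L H Tinf.Δ νH νG Q)
    (hQΔ : ∀ Δ mH mG, Q Δ mH mG → Δ = Δ₀)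
    (hAT₄ : Literature.NumberTheory.Rogawski1990.ArchTransfersExistCanonicalSingular L H Tinf νGi νqi νHi)
    (hSET :
      letI : ∀ (v : HeightOneSpectrum (𝓞 ↥(maximalRealSubfield L))) (γ : (UnitaryGroup.cmDatum L 3 H).Local v),
        MeasurableSpace ((UnitaryGroup.cmDatum L 3 H).Local v ⧸
          Subgroup.centralizer ({γ} : Set ((UnitaryGroup.cmDatum L 3 H).Local v))) := fun _ _ => borel _;
      haveI : ∀ (v : HeightOneSpectrum (𝓞 ↥(maximalRealSubfield L))) (γ : (UnitaryGroup.cmDatum L 3 H).Local v),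
        BorelSpace ((UnitaryGroup.cmDatum L 3 H).Local v ⧸
          Subgroup.centralizer ({γ} : Set ((UnitaryGroup.cmDatum L 3 H).Local v))) := fun _ _ => ⟨rfl⟩;
      letI : ∀ g : GpAdelic L H, MeasurableSpace (GpAdelic L H ⧸ Subgroup.centralizer ({g} : Set (GpAdelic L H))) := fun _ => borel _;
      haveI : ∀ g : GpAdelic L H, BorelSpace (GpAdelic L H ⧸ Subgroup.centralizer ({g} : Set (GpAdelic L H))) := fun _ => ⟨rfl⟩;
      letI : ∀ γ : GpInf L H, MeasurableSpace (GpInf L H ⧸ Subgroup.centralizer ({γ} : Set (GpInf L H))) := fun _ => borel _;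
      haveI : ∀ γ : GpInf L H, BorelSpace (GpInf L H ⧸ Subgroup.centralizer ({γ} : Set (GpInf L H))) := fun _ => ⟨rfl⟩;
      letI : ∀ γ : GInf L, MeasurableSpace (GInf L ⧸ Subgroup.centralizer ({γ} : Set (GInf L))) := fun _ => borel _;
      haveI : ∀ γ : GInf L, BorelSpace (GInf L ⧸ Subgroup.centralizer ({γ} : Set (GInf L))) := fun _ => ⟨rfl⟩;
      letI : ∀ (v : HeightOneSpectrum (𝓞 ↥(maximalRealSubfield L))) (a : HLocal L v),
        MeasurableSpace (HLocal L v ⧸ Subgroup.centralizer ({a} : Set (HLocal L v))) := fun _ _ => borel _;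
      haveI : ∀ (v : HeightOneSpectrum (𝓞 ↥(maximalRealSubfield L))) (a : HLocal L v),
        BorelSpace (HLocal L v ⧸ Subgroup.centralizer ({a} : Set (HLocal L v))) := fun _ _ => ⟨rfl⟩;
      letI : ∀ a : HInf L, MeasurableSpace (HInf L ⧸ Subgroup.centralizer ({a} : Set (HInf L))) := fun _ => borel _;
      haveI : ∀ a : HInf L, BorelSpace (HInf L ⧸ Subgroup.centralizer ({a} : Set (HInf L))) := fun _ => ⟨rfl⟩;
      letI : ∀ γ : GpAdelic L H, MeasurableSpace (↥(Subgroup.centralizer ({γ} : Set (GpAdelic L H))) ⧸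
        ((UnitaryGroup.cmDatum L 3 H).quotientSubgroup ⊓ Subgroup.centralizer ({γ} : Set (GpAdelic L H))).subgroupOf
          (Subgroup.centralizer ({γ} : Set (GpAdelic L H)))) := fun _ => borel _;
      haveI : ∀ γ : GpAdelic L H, BorelSpace (↥(Subgroup.centralizer ({γ} : Set (GpAdelic L H))) ⧸
        ((UnitaryGroup.cmDatum L 3 H).quotientSubgroup ⊓ Subgroup.centralizer ({γ} : Set (GpAdelic L H))).subgroupOf
          (Subgroup.centralizer ({γ} : Set (GpAdelic L H)))) := fun _ => ⟨rfl⟩;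
      haveI hCcl : ∀ γ : GpAdelic L H, IsClosed ((Subgroup.centralizer ({γ} : Set (GpAdelic L H)) : Subgroup (GpAdelic L H)) : Set (GpAdelic L H)) :=
        fun γ => UnitaryGroup.isClosed_centralizer_cmDatum L 3 H γ;
      haveI : ∀ γ : GpAdelic L H, (Measure.count : Measure ↥(((UnitaryGroup.cmDatum L 3 H).quotientSubgroup ⊓
        Subgroup.centralizer ({γ} : Set (GpAdelic L H))).subgroupOf (Subgroup.centralizer ({γ} : Set (GpAdelic L H))))).IsHaarMeasure :=
        fun γ => UnitaryGroup.isHaarMeasure_count_quotientSubgroup_inf_centralizer_subgroupOf L 3 H γ;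
      haveI : ν.IsMulRightInvariant := by
        have h : ν.inv.IsMulRightInvariant := inferInstance
        rwa [Measure.inv_eq_self] at h;
      Literature.NumberTheory.Rogawski1990.SingularEllipticTransferCanonicalAtDelta L H Tinf Δ₀ νH νG νGi νqi νHi ν)
    (hanis : IsAnisotropic L H) (hherm : IsHermitianCM L H) :
    ∃ 𝔨 : ComparisonKit L H μ, 𝔨.IsPinned ν Tinf νH νG νGi νqi νHi ∧ 𝔨.TransferExistence ∧ 𝔨.SimpleTraceFormula ∧
      (∀ f' : TestGp L H, 𝔨.Smooth f' → ∃ f : TestG L, 𝔨.Transfer f' f ∧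
        ∃ T' : UnitaryGroup.PureTensor L 3 (splitForm L 3), T'.IsTest ∧ ⇑f = T'.eval) ∧
      (letI : ∀ (v : HeightOneSpectrum (𝓞 ↥(maximalRealSubfield L))) (γ : (UnitaryGroup.cmDatum L 3 H).Local v),
          MeasurableSpace ((UnitaryGroup.cmDatum L 3 H).Local v ⧸ Subgroup.centralizer ({γ} : Set ((UnitaryGroup.cmDatum L 3 H).Local v))) :=
        fun _ _ => borel _
      ∃ mG₀ : ∀ v : HeightOneSpectrum (𝓞 ↥(maximalRealSubfield L)), OrbitalMeasureFamily ((UnitaryGroup.cmDatum L 3 H).Local v),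
        (∀ (v : HeightOneSpectrum (𝓞 ↥(maximalRealSubfield L))) (c' : ConjClasses ((UnitaryGroup.cmDatum L 3 H).Local v)),
          Literature.NumberTheory.Rogawski1990.IsRegularElt ((Quotient.out c').val : GL (Fin 3) (UnitaryGroup.LocalRing L v)) → 𝔨.mG v c' = mG₀ v c') ∧
        Q 𝔨.Δ 𝔨.mH mG₀ ∧
        (letI : ∀ (v : HeightOneSpectrum (𝓞 ↥(maximalRealSubfield L))) (a : HLocal L v),
            MeasurableSpace (HLocal L v ⧸ Subgroup.centralizer ({a} : Set (HLocal L v))) := fun _ _ => borel _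
        haveI : ∀ (v : HeightOneSpectrum (𝓞 ↥(maximalRealSubfield L))) (a : HLocal L v),
            BorelSpace (HLocal L v ⧸ Subgroup.centralizer ({a} : Set (HLocal L v))) := fun _ _ => ⟨rfl⟩
        haveI : ∀ (v : HeightOneSpectrum (𝓞 ↥(maximalRealSubfield L))) (γ : (UnitaryGroup.cmDatum L 3 H).Local v),
            BorelSpace ((UnitaryGroup.cmDatum L 3 H).Local v ⧸
              Subgroup.centralizer ({γ} : Set ((UnitaryGroup.cmDatum L 3 H).Local v))) := fun _ _ => ⟨rfl⟩
        ∀ v : HeightOneSpectrum (𝓞 ↥(maximalRealSubfield L)),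
          Literature.NumberTheory.Rogawski1990.IsLocalTransferDatum L H v (𝔨.Δ v) (𝔨.mH v) (mG₀ v) ∧
            (mG₀ v).IsCanonical (fun γ => Literature.NumberTheory.Rogawski1990.IsRegularElt (γ.val : GL (Fin 3) (UnitaryGroup.LocalRing L v))) (νG v))) := by
  obtain ⟨w, hq⟩ := anchorWitness_exists_of_packageAnd_pinned (μ := μ) ν νH νG νGi νqi νHi h3 Tinf Δ₀ hK hKH hGTQ hQΔ hAT₄ hSET hanis hherm
  exact ⟨w.kit, w.isPinned, w.transferExistence, w.simpleTraceFormula, w.smooth_partner, w.mG, fun v c' hc => w.mGp_of_isRegularElt v c' hc, hq,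
    fun v => ⟨(w.hloc v).1, (w.hloc v).2.2.2⟩⟩

end PackageAndExport

end Summit.HodgeConjecture.HodgeConjecture.Cruxes.H413.F0T1InnerFormTraceIdentity
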